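import Literature.Topology.FourManifolds.DependentTripleGenusThreeTrisections
import Literature.Topology.FourManifolds.WeaklyReducibleTrisectionsNaturality
import Literature.Barriers.SmoothPoincare4.WeaklyReducibleGenusThreeStandard
import Literature.Barriers.SmoothPoincare4.WeaklyReducibleGenusThreeStandardProofs
import Literature.Barriers.SmoothPoincare4.WeaklyReducibleGenusThreeStandardOfLoopSurgery
import Literature.Barriers.SmoothPoincare4.WeaklyReducibleGenusThreeStandardOfSeparatingSplitting
import Literature.Barriers.SmoothPoincare4.WeaklyReducibleGenusThreeStandardOfClassification
import HarnessLib

/-!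
# Aranda–Zupan 2025, Thm. 1.4 (homotopy-sphere corollary): the dependent-triple vocabulary and
# the PROVED reductions of the fact to its five-chain core

Companion (`…Proofs.lean` sibling) of `DependentTripleGenusThreeTrisections.lean`, which vendors
the named fact
`Literature.Topology.FourManifolds.arandaZupan_dependentTriple_genusThree_homotopySphere`
(Aranda–Zupan, *Manifolds with weakly reducible genus-three trisections are standard*,
arXiv:2503.04607, Thm. 1.4 / Cor. 1.5, p. 2, homotopy-sphere corollary over
`IsGKTrisection`): a smooth `M ≃ₕ S⁴` with a genus-`3` Gay–Kirby trisection admitting a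
DEPENDENT TRIPLE is diffeomorphic to `S⁴`.  That fact is NOT discharged here (triaged XL; see the
"Proof status" section of its module docstring: the printed proof, §7 pp. 24–26, runs on Thm. 1.3
of the same paper — the tree's unproved fact
`Literature.Topology.FourManifolds.arandaZupan_weaklyReducible_genusThree_homotopySphere` — on
Lemmas 3.7/3.8 (thin position), on five-chain surgery (§5) and on the genus-two classification
[MZ17b], none of which has a counterpart in the tree).  This file introduces NO new fact
(D-0026).  It records, kernel-checked, the architecture of the printed proof as far as the tree's
vocabulary carries it — exactly parallel to what
`Literature/Barriers/SmoothPoincare4/WeaklyReducibleGenusThreeStandard.lean` does for Thm. 1.3: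

* `Trisection.HasDependentTriple S` — Aranda–Zupan's **dependent triple** (p. 2 and §7 p. 24)
  as a predicate on three sectors `S : Fin 3 → Set X`, in the vocabulary
  `Trisection.IsCurve / IsNonSeparating / BoundsDisc / spineHandlebody / centralSurfaceSet` of
  `WeaklyReducibleTrisections.lean`; `Trisection.hasDependentTriple_iff` — it unfolds BY `rfl` to
  the inline `let`-block of the fact (and of the route item
  `Summit.SmoothPoincare4.SmoothPoincare4.Theses.WeakReductionDescent.DependentTripleGenusThreeStandard`),
  so `arandaZupan_dependentTriple_genusThree_homotopySphere_iff` restates the fact through it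
  (`Iff.rfl`); `Trisection.hasDependentTriple_iff_exists_fun` (indexed form: one compressing
  curve `f i ⊂ H_i` per handlebody), `Trisection.hasDependentTriple_comp_perm` (invariance under
  relabelling the sectors, `IsGKTrisection.comp_perm`) and
  `Trisection.HasDependentTriple.image_diffeomorph` / `hasDependentTriple_image_diffeomorph_iff`
  (naturality under diffeomorphisms, on top of `WeaklyReducibleTrisectionsNaturality.lean`).
* `Trisection.isWeaklyReducible_of_boundsDisc_two`,
  `Trisection.isWeaklyReducible_of_triple_of_boundsDisc_other` — the sentence of the printed
  proof (§7, p. 25) "If any of the curves bounds a disk in another handlebody, then the splitting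
  is weakly reducible": a curve of the triple compressing in a SECOND handlebody, together with
  the curve of the triple in the third handlebody, is a weak reduction
  (`Trisection.IsWeaklyReducible`).
* `arandaZupan_dependentTriple_genusThree_homotopySphere_of_smoothPoincare` — shield (PROVED):
  the fact is a consequence of the smooth 4-dimensional Poincaré conjecture in homotopy-sphere
  form, so it is summit-safe as a route input.
* `arandaZupan_dependentTriple_genusThree_homotopySphere_of_msz_of_balanced` and the converse
  `arandaZupan_dependentTriple_genusThree_homotopySphere.balanced` — GIVEN Meier–Schirmer–Zupan's
  fact `Literature.Barriers.SmoothPoincare4.msz_homotopySphere_gk`, the fact is EQUIVALENT to its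
  instance for balanced `(3; 1,1,1)`-trisections (Aranda–Zupan's standing assumption
  `kᵢ ∈ {0, 1}`, p. 6, sharpened for homotopy spheres by the proved Euler identity
  `g = k₀ + k₁ + k₂`; same argument as the Summits-side
  `dependentTripleGenusThreeStandard_of_msz_of_balanced`, recorded Literature-side so that the
  reductions below compose).
* `arandaZupan_dependentTriple_genusThree_homotopySphere_of_weaklyReducible_of_notWeaklyReducible`
  — GIVEN the Thm. 1.3 fact, the fact reduces to dependent triples of trisections that are NOT
  weakly reducible.  In the printed proof (§7, p. 25) the configurations (1) "two curves
  homotopic", (2) "two curves homologous, not homotopic" (via Lemma 3.8) and the sub-case of (3)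
  in which a curve compresses in a second handlebody all END in "`𝒯` is weakly reducible, apply
  Theorem 1.3"; what is left is the five-chain construction of case (3).
* `arandaZupan_dependentTriple_genusThree_homotopySphere_of_msz_of_splitting_of_irreducible` —
  GIVEN `msz_homotopySphere_gk` and the two splitting facts for REDUCIBLE trisections
  (`Trisection.isConnectedSum_of_reducing_separating`,
  `Trisection.isConnectedSum_circleProd_of_reducing_nonseparating`, AZ25 §2 p. 6), the fact
  reduces to IRREDUCIBLE balanced trisections with a dependent triple: the reducible branch for
  homotopy spheres is the PROVED
  `Literature.Barriers.SmoothPoincare4.nonempty_diffeomorph_sphere_of_isReducible_genusThree_of_splitting`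
  (Kosinski's summand fact being discharged in the tree).  This matches the first sentence of
  Thm. 1.4: "either `𝒯` is reducible, or `𝒯` contains a five-chain".
* `arandaZupan_dependentTriple_genusThree_homotopySphere_of_facts_of_fiveChainCase` — all four
  facts GIVEN, the outstanding content of the fact is exactly: *a smooth `M ≃ₕ S⁴` with a
  `(3; 1,1,1)`-trisection that admits a dependent triple but is neither weakly reducible nor
  reducible is diffeomorphic to `S⁴`* — Aranda–Zupan's case (3) of §7 (pp. 25–26: Lemma 3.7
  twice, handle slides, the five-chain `{γ₁, β₂, α₁, γ₂*, β₁}` of Fig. 19, Lemma 5.4 and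
  Prop. 5.5, [MZ17b], and for a homotopy sphere `X′ = S¹ × S³`, `X ∈ {S_1, S′_1} = {S⁴}` by
  Lemma 2.7 / p. 7).  None of that has a counterpart in the tree and it is NOT restated here as a
  named fact (D-0026); it appears only as the HYPOTHESIS `h5` of the reduction.
* Section "Catalogue" — the same reductions with the named facts taken in the forms and at the
  universes in which the tree TRACKS them: the Thm. 1.3 fact as the barrier-catalogue entry
  `Literature.Barriers.SmoothPoincare4.az2025_weaklyReducible_genusThree_homotopySphere_gk.{u}`
  (the vendoring that carries the proof-status record of Thm. 1.3; by the PROVED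
  `az2025_weaklyReducible_genusThree_homotopySphere_gk_iff_routeShape_univ` it is, at every
  universe, the route-shaped `Type 0` statement `arandaZupan_weaklyReducible_genusThree_homotopySphere`
  used above), and `msz_homotopySphere_gk`, `Trisection.isConnectedSum_of_reducing_separating`,
  `Trisection.isConnectedSum_circleProd_of_reducing_nonseparating` at arbitrary universes (all
  universe-free, `WeaklyReducibleGenusThreeStandardProofs.lean`, `ReducibleTrisectionSplittingUniv.lean`):
  `…_of_az2025_of_notWeaklyReducible`, `…_of_msz_of_splitting_of_irreducible_univ`,
  `…_of_az2025_facts_of_fiveChainCase`, and the converse bookkeeping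
  `arandaZupan_dependentTriple_genusThree_homotopySphere.fiveChainCase` /
  `…_iff_fiveChainCase_of_facts` (the four facts granted, the fact is EQUIVALENT to `h5`).
* Section "CaseSplit" — the case split of the printed proof (§7, p. 25) AT SET LEVEL, proved:
  for pairwise disjoint non-separating curves the three configurations of p. 24 are told apart
  by which sub-unions separate `Σ` ((1), (2): some PAIR of the triple separates; (3): no pair
  does), so `h5` follows (`fiveChainCase_of_separatingPair_of_pantsCase`) from two inline
  hypotheses: `hL38` — a separating pair `x ⊂ H_i`, `y ⊂ H_j` (`i ≠ j`) of disjoint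
  non-separating compressing curves of a `(3; 1,1,1)`-trisection has one of its curves
  compressing in the other handlebody too (Lemma 3.8, p. 10, for configuration (2); the
  parallel-discs remark "in case (1), `𝒯` is weakly reducible" for configuration (1); also the
  first step of the proof of Prop. 3.9, hence shared with the Thm. 1.3 fact's core) — and
  `hPants` — configuration (3) on a `(3; 1,1,1)`-trisected homotopy sphere, neither weakly
  reducible nor reducible, gives `S⁴` (p. 25 "The third case requires more work" onwards).
  Assemblies `…_of_az2025_facts_of_separatingPair_of_pantsCase`, `….pantsCase`,
  `…_iff_pantsCase_of_facts` (the four facts and `hL38` granted, the fact is EQUIVALENT to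
  `hPants`), and the same reductions with the non-separating splitting record replaced by its
  `π₁`-shadow (`…_of_az2025_of_msz_of_sep_of_pi1_of_fiveChainCase`,
  `…_of_az2025_of_msz_of_sep_of_pi1_of_separatingPair_of_pantsCase`), aligning the inputs of
  this fact with those against which the Thm. 1.3 fact is tracked
  (`az2025_weaklyReducible_genusThree_homotopySphere_gk_of_msz_of_sep_of_pi1_of_irreducible`).
* Section "CaseSplitIndexed" — the same dichotomy in the INDEXED vocabulary of
  `hasDependentTriple_iff_exists_fun`, for every type `(3; k)` and with both inputs restricted
  to homotopy spheres: `notWeaklyReducibleCore_of_separatingPair_of_pantsTriple` (output: the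
  hypothesis `hcore` of `…_of_weaklyReducible_of_notWeaklyReducible`, verbatim), so that the
  fact follows from the Thm. 1.3 fact, a separating-pair lemma `h38` and a pants-triple
  statement `hp` ALONE (`…_of_az2025_of_separatingPair_of_pantsTriple` — no MSZ, no splitting
  fact on this road) and is, the first two granted, EQUIVALENT to `hp`
  (`…_iff_pantsTriple_of_az2025_of_separatingPair`).  These are the binder shapes of the idea
  cards of the Summits-side crux `DependentTripleGenusThreeStandard` (stmt-SmoothPoincare4-18000:
  `SeparatingPairReducing`, `IsPantsTriple` / `PantsTripleStandard`, `NotWeaklyReducibleCore`),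
  predicates inlined.
* Section "LoopSurgeryEndgame" — the END of configuration (3) as printed (p. 25: "It follows
  from Lemma 5.4 and Proposition 5.5 that `X` is obtained by surgery on a loop `ℓ` in a manifold
  `X′` admitting a `(2; k₁, k₂, k₃)` trisection"), run on the tree's named fact
  `Literature.Topology.FourManifolds.msz_loopSurgery_homotopySphere_gk` (Meier–Schirmer–Zupan
  Thm. 1.2 + Pao, `LoopSurgeryHomotopySphere.lean`) — the same fact against which the Thm. 1.3
  fact is now tracked (`WeaklyReducibleGenusThreeStandardOfLoopSurgery.lean`).  By Lemma 5.4
  (p. 19) the loop partner `X′` of a genus-three `X` is `(2; k₁, k₂, k₃ + 1)`-trisected, which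
  is the Meier–Schirmer–Zupan range `∃ i, 2 ≤ k′ᵢ + 1`; so for a homotopy 4-sphere neither the
  genus-two classification [MZ17b] nor Lemma 7.1 is needed, and the pants-triple statement `hp`
  follows (`pantsTriple_of_loopSurgery_of_loopPartner`) from the loop-surgery fact and the
  LOOP-PARTNER STEP `hP` of the printed proof in tree vocabulary (`IsCircleSurgery`): *a
  `(3; k)`-trisected `M ≃ₕ S⁴` with a pants-type triple, not weakly reducible, is a circle surgery
  on a smoothly embedded loop of a smooth `X′ : Type` with a genus-`2` GK-trisection in the MSZ
  range* (§7 case (3): Lemma 3.7 twice, handle slides, the five-chain of Fig. 19, Lemma 5.4,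
  Prop. 5.5 — Aranda–Zupan-specific, no counterpart in the tree, NOT vendored, D-0026).
  Assemblies: `notWeaklyReducibleCore_of_separatingPair_of_loopSurgery_of_loopPartner`,
  `…_of_az2025_of_separatingPair_of_loopSurgery_of_loopPartner` (the fact from the Thm. 1.3 fact,
  `h38`, the loop-surgery fact and `hP`), the per-type and balanced forms (`…_type`,
  `…_of_az2025_of_msz_of_separatingPair_of_loopSurgery_of_loopPartner_balanced`), and — with the
  Thm. 1.3 fact replaced by its own standing reduction
  `az2025_weaklyReducible_genusThree_homotopySphere_gk_of_msz_zero_of_sep_of_pi1_of_loopSurgery_of_fiveChainSurgery`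
  — **where the fact stands with no reference to Thm. 1.3**
  (`…_of_msz_zero_of_sep_of_pi1_of_loopSurgery_of_fiveChainSurgery_of_separatingPair_of_loopPartner`):
  three tracked named facts (`msz_homotopySphere_gk.{0}`,
  `Trisection.isConnectedSum_of_reducing_separating.{0}`, `msz_loopSurgery_homotopySphere_gk`),
  the `π₁`-shadow of the non-separating reducible case, and three Aranda–Zupan-specific inline
  steps — the five-chain surgery step for weak reductions (`h5` of the Thm. 1.3 fact's file:
  Thm. 1.3 first part + Lemma 5.4 + Prop. 5.5), the separating-pair lemma `h38` (Lemma 3.8 + the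
  parallel case) and the loop-partner step `hP`, the last two for balanced `(3; 1,1,1)`
  homotopy spheres only.
* Section "ShadowDischarged" — the `π₁`-shadow `hπ` is now a THEOREM of the tree
  (`Literature.Topology.FourManifolds.Trisection.not_simplyConnectedSpace_of_reducing_nonseparating`,
  `ReducibleTrisectionNotSimplyConnected.lean`; binder-shape form
  `Literature.Barriers.SmoothPoincare4.not_simplyConnectedSpace_of_reducing_nonseparating_binderShape`),
  so it is fed in and disappears from the assemblies that carried it:
  `…_of_az2025_of_msz_of_sep_of_fiveChainCase`, `…_of_az2025_of_msz_of_sep_of_separatingPair_of_pantsCase`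
  and — **the standing of the fact** — `…_of_msz_zero_of_sep_of_loopSurgery_of_fiveChainSurgery_of_separatingPair_of_loopPartner`:
  the fact follows from the three tracked named facts `msz_homotopySphere_gk.{0}`,
  `Trisection.isConnectedSum_of_reducing_separating.{0}`, `msz_loopSurgery_homotopySphere_gk` and
  the three Aranda–Zupan-specific inline steps `h5` (five-chain surgery step for weak reductions),
  `h38` (Lemma 3.8 + parallel case) and `hP` (loop-partner step), nothing else; likewise over the
  classification `msz_trisection_classification_gk` at any universe
  (`…_of_classification_of_sep_of_loopSurgery_of_fiveChainSurgery_of_separatingPair_of_loopPartner`).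

* Section "LoopSurgeryDischarged" — the loop-surgery fact `hL` is now REDUCED in the tree to
  the Meier–Schirmer–Zupan classification (`msz_loopSurgery_homotopySphere_gk_of_classification`,
  `LoopSurgeryHomotopySphereGKProofs.lean`; universe bookkeeping
  `msz_trisection_classification_gk_of_univ`), so it is fed in:
  `pantsTriple_of_classification_of_loopPartner`,
  `notWeaklyReducibleCore_of_separatingPair_of_classification_of_loopPartner`,
  `…_of_az2025_of_separatingPair_of_classification_of_loopPartner` (the fact from the Thm. 1.3
  fact, `h38`, the classification and `hP`) and — **the standing of the fact** —
  `…_of_classification_of_sep_of_fiveChainSurgery_of_separatingPair_of_loopPartner`: the fact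
  follows from TWO tracked named facts, `msz_trisection_classification_gk` (any universe) and
  `Trisection.isConnectedSum_of_reducing_separating.{0}`, and the three Aranda–Zupan-specific
  inline steps `h5`, `h38`, `hP`, nothing else (matching the Thm. 1.3 fact's standing
  `az2025_weaklyReducible_genusThree_homotopySphere_gk_of_classification_of_sep_of_fiveChainSurgery`).
* Section "NoRange" — both loop-partner inputs in their WEAKEST form: for a homotopy 4-sphere
  the Meier–Schirmer–Zupan range clause, the genus `= 2` and the smoothness of the loop in the
  conclusions of `h5` and `hP` are free once the loop partner carries SOME GK-trisection of
  genus `≤ 2` (`mszRange_of_genus_le_two_of_isCircleSurgery_homotopySphere`: `Σ k′ᵢ = g′ + 2` by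
  `gkTrisection_sum_eq_add_two_of_loopSurgery_homotopySphere_holds`, then pigeonhole;
  `nonempty_diffeomorph_sphere_of_isCircleSurgery_of_genus_le_two`), so the pants-triple statement
  `hp` follows from the UNRANGED loop-partner step `hP♭`
  (`pantsTriple_of_loopSurgery_of_loopPartnerNoRange_type`; at `k = (1,1,1)` `hP♭` is verbatim
  the registered Summits stub `stub_loopPartnerNoRange` of
  `Cruxes/DependentTripleGenusThreeStandard/Lines/Sketch.lean`), the Thm. 1.3 fact's irreducible
  core follows from the UNRANGED five-chain surgery step `h5♭` asked for homotopy spheres only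
  (`irreducibleCore_zero_of_loopSurgery_of_fiveChainSurgeryNoRange`), each unranged step is
  implied by its ranged form (`loopPartnerNoRange_of_loopPartner_type`,
  `fiveChainSurgeryNoRange_of_fiveChainSurgery`), and — **the standing of the fact, weakest
  form** — `…_of_classification_of_sep_of_fiveChainSurgeryNoRange_of_separatingPair_of_loopPartnerNoRange`:
  the fact follows from `msz_trisection_classification_gk` (any universe),
  `Trisection.isConnectedSum_of_reducing_separating.{0}` and the inline steps `h5♭`, `h38`, `hP♭`
  (balanced Thm.-1.3-road form `…_of_az2025_of_msz_of_separatingPair_of_loopSurgery_of_loopPartnerNoRange_balanced`,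
  the composition of the registered Summits skeleton).
## References

* [ArandaZupan2025] R. Aranda, A. Zupan, *Manifolds with weakly reducible genus-three
  trisections are standard*, arXiv:2503.04607 (2025): Thm. 1.4, Cor. 1.5 and the definition of a
  dependent triple (p. 2), §7 (pp. 24–26), §2 (p. 6: weakly reducible, reducible, `kᵢ ∈ {0,1}`),
  Lemma 5.4 and Prop. 5.5 (pp. 19–20), Lemma 2.7 / §2 p. 7 (`S₁ ≅ S′₁ ≅ S⁴`).
* [MeierSchirmerZupan2016] J. Meier, T. Schirmer, A. Zupan, *Classification of trisections and
  the Generalized Property R Conjecture*, PAMS 144 (2016), Thm. 1.2.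
* [GayKirby2016] D. Gay, R. Kirby, *Trisecting 4-manifolds*, Geom. Topol. 20 (2016), Def. 1.
* [Pao1977] P. S. Pao, *The topological structure of 4-manifolds with effective torus actions. I*,
  Trans. AMS 227 (1977) (the surgeries `S_{±1}`, `S′_{±1}` on `S¹ × S³` are `S⁴`).
-/

noncomputable section

open scoped Manifold ContDiff
open Set ContinuousMap

namespace Literature.Topology.FourManifolds

universe u v

/-- Local notation for the model space `ℝⁿ = EuclideanSpace ℝ (Fin n)`. -/
local notation "𝔼 " n:arg => EuclideanSpace ℝ (Fin n)

/-- Local notation for the unit sphere `Sⁿ ⊂ ℝⁿ⁺¹`. -/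
local notation "𝕊 " n:arg => (Metric.sphere (0 : EuclideanSpace ℝ (Fin (n + 1))) 1)

/-- Local notation for the closed unit ball `𝔻ⁿ ⊂ ℝⁿ`. -/
local notation "𝔻 " n:arg => (Metric.closedBall (0 : EuclideanSpace ℝ (Fin n)) 1)

/-! ### The dependent-triple vocabulary -/

namespace Trisection

section Vocabulary

variable {X : Type u} [TopologicalSpace X] [ChartedSpace (𝔼 4) X]

/-- **Dependent triple** (Aranda–Zupan 2025, p. 2, verbatim: "Given a trisection `𝒯` for `X`
with spine `H_α ∪ H_β ∪ H_γ`, a dependent triple for `𝒯` consists of three pairwise disjoint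
non-separating curves `α₁`, `β₁`, and `γ₁` bounding disks in `H_α`, `H_β`, and `H_γ`,
respectively, such that the homology classes `[α₁]`, `[β₁]`, and `[γ₁]` are linearly dependent
in `H₁(Σ)`"), for three sectors `S : Fin 3 → Set X` of a smooth 4-manifold, in the vocabulary of
`WeaklyReducibleTrisections.lean`: pairwise disjoint curves `a, b, c` on the central surface
`Σ = centralSurfaceSet S`, each non-separating, `a` compressing in the handlebody
`H_0 = spineHandlebody S 0`, `b` in `H_1`, `c` in `H_2`, whose union SEPARATES `Σ` — the tree's
rendering of the printed homological dependence, equivalent to it for pairwise disjoint simple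
closed curves on a closed connected orientable surface (module docstring of
`DependentTripleGenusThreeTrisections.lean`; §7 p. 24 lists the three configurations, in each
of which `Σ ∖ (α₁ ∪ β₁ ∪ γ₁)` is disconnected).  This is, by `rfl`, the inline `let`-block of
the fact `arandaZupan_dependentTriple_genusThree_homotopySphere` (`hasDependentTriple_iff`).
[cite: ArandaZupan2025, p. 2 (definition of a dependent triple) and §7 (p. 24)] -/
def HasDependentTriple (S : Fin 3 → Set X) : Prop :=
  ∃ a b c : Set X, IsCurve S a ∧ IsCurve S b ∧ IsCurve S c ∧
    Disjoint a b ∧ Disjoint b c ∧ Disjoint a c ∧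
    IsNonSeparating S a ∧ IsNonSeparating S b ∧ IsNonSeparating S c ∧
    BoundsDisc S (spineHandlebody S 0) a ∧ BoundsDisc S (spineHandlebody S 1) b ∧
    BoundsDisc S (spineHandlebody S 2) c ∧
    ¬ IsPreconnected (centralSurfaceSet S \ (a ∪ b ∪ c))

/-- `HasDependentTriple` fully inlined (by `rfl`): the `let`-bound shape in which the fact
`arandaZupan_dependentTriple_genusThree_homotopySphere` and the route item
`DependentTripleGenusThreeStandard` spell the dependent triple over `IsGKTrisection`.
[cite: ArandaZupan2025, p. 2 (definition of a dependent triple)] -/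
theorem hasDependentTriple_iff (S : Fin 3 → Set X) :
    HasDependentTriple S ↔
      (let F : Set X := ⋂ l, S l
       let H : Fin 3 → Set X := fun p => ⋂ (l : Fin 3) (_ : l ≠ p), S l
       let IsCurve : Set X → Prop := fun c => c ⊆ F ∧
         ∃ γ : 𝕊 1 → X, Manifold.IsSmoothEmbedding (𝓡 1) (𝓡 4) ∞ γ ∧ range γ = c
       let BoundsDisc : Set X → Set X → Prop := fun A c =>
         ∃ d : 𝔻 2 → X, Manifold.IsSmoothEmbedding (𝓡∂ 2) (𝓡 4) ∞ d ∧ range d ⊆ A ∧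
           d '' (𝓡∂ 2).boundary (𝔻 2) = c ∧ range d ∩ F = c
       let NonSep : Set X → Prop := fun c => IsConnected (F \ c)
       ∃ (a b c : Set X), IsCurve a ∧ IsCurve b ∧ IsCurve c ∧
         Disjoint a b ∧ Disjoint b c ∧ Disjoint a c ∧ NonSep a ∧ NonSep b ∧ NonSep c ∧
         BoundsDisc (H 0) a ∧ BoundsDisc (H 1) b ∧ BoundsDisc (H 2) c ∧
         ¬ IsPreconnected (F \ (a ∪ b ∪ c))) :=
  Iff.rfl

/-- A union indexed by `Fin 3` is the union of its three values. [folklore] -/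
theorem iUnion_fin_three {α : Type v} (f : Fin 3 → Set α) : (⋃ i, f i) = f 0 ∪ f 1 ∪ f 2 := by
  apply le_antisymm
  · refine iUnion_subset fun i => ?_
    fin_cases i
    · exact subset_union_left.trans subset_union_left
    · exact subset_union_right.trans subset_union_left
    · exact subset_union_right
  · exact union_subset (union_subset (subset_iUnion f 0) (subset_iUnion f 1)) (subset_iUnion f 2)

/-- **Indexed form of a dependent triple**: one compressing curve `f i ⊂ H_i` per handlebody of
the spine, the three curves pairwise disjoint and non-separating, with `Σ ∖ ⋃ i, f i`
disconnected. [cite: ArandaZupan2025, p. 2 (definition of a dependent triple)] -/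
theorem hasDependentTriple_iff_exists_fun (S : Fin 3 → Set X) :
    HasDependentTriple S ↔
      ∃ f : Fin 3 → Set X, (∀ i, IsCurve S (f i)) ∧ (Pairwise fun i j => Disjoint (f i) (f j)) ∧
        (∀ i, IsNonSeparating S (f i)) ∧ (∀ i, BoundsDisc S (spineHandlebody S i) (f i)) ∧
        ¬ IsPreconnected (centralSurfaceSet S \ ⋃ i, f i) := by
  constructor
  · rintro ⟨a, b, c, ha, hb, hc, hab, hbc, hac, hna, hnb, hnc, hda, hdb, hdc, hdep⟩
    let f : Fin 3 → Set X := fun i => match i with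
      | 0 => a
      | 1 => b
      | 2 => c
    have hf : (⋃ i, f i) = a ∪ b ∪ c := iUnion_fin_three f
    refine ⟨f, fun i => ?_, fun i j hij => ?_, fun i => ?_, fun i => ?_, hf ▸ hdep⟩
    · fin_cases i
      · exact ha
      · exact hb
      · exact hc
    · fin_cases i <;> fin_cases j <;>
        first
        | exact absurd rfl hij
        | exact hab
        | exact hab.symm
        | exact hbc
        | exact hbc.symm
        | exact hac
        | exact hac.symm
    · fin_cases i
      · exact hna
      · exact hnb
      · exact hnc
    · fin_cases i
      · exact hda
      · exact hdb
      · exact hdc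
  · rintro ⟨f, hcur, hdis, hns, hbd, hdep⟩
    refine ⟨f 0, f 1, f 2, hcur 0, hcur 1, hcur 2, hdis (by decide), hdis (by decide),
      hdis (by decide), hns 0, hns 1, hns 2, hbd 0, hbd 1, hbd 2, ?_⟩
    rwa [iUnion_fin_three] at hdep

/-- **A dependent triple of `S` is a dependent triple of the relabelled sectors `S ∘ σ`**: the
central surface is fixed and the handlebody of `S ∘ σ` opposite `i` is the handlebody of `S`
opposite `σ i` (`Literature.Barriers.SmoothPoincare4.Trisection.spineHandlebody_comp_perm`), so
the curve attached to `H_{σ i}` serves as the `i`-th curve. [cite: ArandaZupan2025, p. 2] [cite: GayKirby2016, Def. 1] -/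
theorem HasDependentTriple.comp_perm {S : Fin 3 → Set X} (h : HasDependentTriple S)
    (σ : Equiv.Perm (Fin 3)) : HasDependentTriple (S ∘ σ) := by
  rw [hasDependentTriple_iff_exists_fun] at h ⊢
  obtain ⟨f, hcur, hdis, hns, hbd, hdep⟩ := h
  refine ⟨f ∘ σ,
    fun i => (Literature.Barriers.SmoothPoincare4.Trisection.isCurve_comp_perm S σ _).2 (hcur (σ i)),
    fun i j hij => hdis (σ.injective.ne hij),
    fun i => (Literature.Barriers.SmoothPoincare4.Trisection.isNonSeparating_comp_perm S σ _).2
      (hns (σ i)),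
    fun i => ?_, ?_⟩
  · rw [Literature.Barriers.SmoothPoincare4.Trisection.spineHandlebody_comp_perm,
      Literature.Barriers.SmoothPoincare4.Trisection.boundsDisc_comp_perm]
    exact hbd (σ i)
  · rw [Literature.Barriers.SmoothPoincare4.Trisection.centralSurfaceSet_comp_perm]
    have hU : (⋃ i, (f ∘ σ) i) = ⋃ j, f j := σ.surjective.iUnion_comp f
    rwa [hU]

/-- **Admitting a dependent triple is invariant under relabelling the sectors.**
[cite: ArandaZupan2025, p. 2] [cite: GayKirby2016, Def. 1] -/
theorem hasDependentTriple_comp_perm (S : Fin 3 → Set X) (σ : Equiv.Perm (Fin 3)) :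
    HasDependentTriple (S ∘ σ) ↔ HasDependentTriple S := by
  refine ⟨fun h => ?_, fun h => h.comp_perm σ⟩
  have h' := h.comp_perm σ.symm
  rwa [Function.comp_assoc, Equiv.self_comp_symm, Function.comp_id] at h'

/-- **A curve compressing in two handlebodies plus a disjoint curve compressing in the third
is a weak reduction**: if `{i, j, p} = {0, 1, 2}`, `c` compresses in `H_p` and `c′` in `H_i`
and in `H_j`, with `c`, `c′` disjoint non-separating curves, then the sectors are weakly
reducible (`Trisection.IsWeaklyReducible`, at the label `p`).
[cite: ArandaZupan2025, §2 (p. 6, definition of weakly reducible) and §7 (p. 25)] -/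
theorem isWeaklyReducible_of_boundsDisc_two {S : Fin 3 → Set X} {p i j : Fin 3}
    (hij : i ≠ j) (hip : i ≠ p) (hjp : j ≠ p) {c c' : Set X}
    (hc : IsCurve S c) (hc' : IsCurve S c') (hd : Disjoint c c')
    (hn : IsNonSeparating S c) (hn' : IsNonSeparating S c')
    (hp : BoundsDisc S (spineHandlebody S p) c)
    (hi : BoundsDisc S (spineHandlebody S i) c') (hj : BoundsDisc S (spineHandlebody S j) c') :
    IsWeaklyReducible S := by
  refine ⟨p, c, c', hc, hc', hd, hn, hn', hp, fun q hq => ?_⟩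
  have key : ∀ p i j q : Fin 3, i ≠ j → i ≠ p → j ≠ p → q ≠ p → q = i ∨ q = j := by decide
  rcases key p i j q hij hip hjp hq with rfl | rfl
  · exact hi
  · exact hj

/-- **"If any of the curves bounds a disk in another handlebody, then the splitting is weakly
reducible"** (Aranda–Zupan, proof of Thm. 1.4, §7 p. 25, verbatim), for three pairwise disjoint
non-separating curves `a ⊂ H_0`, `b ⊂ H_1`, `c ⊂ H_2` (the curves of a dependent triple; the
dependence is not used): if `a` also compresses in some `H_q`, `q ≠ 0` — or `b` in some `H_q`,
`q ≠ 1`, or `c` in some `H_q`, `q ≠ 2` — then that curve compresses in two handlebodies and the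
curve of the triple in the remaining handlebody is disjoint from it, which is a weak reduction.
[cite: ArandaZupan2025, §7 (p. 25) and §2 (p. 6)] -/
theorem isWeaklyReducible_of_triple_of_boundsDisc_other {S : Fin 3 → Set X} {a b c : Set X}
    (ha : IsCurve S a) (hb : IsCurve S b) (hc : IsCurve S c)
    (hab : Disjoint a b) (hbc : Disjoint b c) (hac : Disjoint a c)
    (hna : IsNonSeparating S a) (hnb : IsNonSeparating S b) (hnc : IsNonSeparating S c)
    (hda : BoundsDisc S (spineHandlebody S 0) a) (hdb : BoundsDisc S (spineHandlebody S 1) b)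
    (hdc : BoundsDisc S (spineHandlebody S 2) c)
    (h2 : (∃ q, q ≠ 0 ∧ BoundsDisc S (spineHandlebody S q) a) ∨
      (∃ q, q ≠ 1 ∧ BoundsDisc S (spineHandlebody S q) b) ∨
      (∃ q, q ≠ 2 ∧ BoundsDisc S (spineHandlebody S q) c)) :
    IsWeaklyReducible S := by
  rcases h2 with ⟨q, hq, h⟩ | ⟨q, hq, h⟩ | ⟨q, hq, h⟩
  · -- `a` compresses in `H_0` and in `H_q`, `q ∈ {1, 2}`
    fin_cases q
    · exact absurd rfl hq
    · -- `a ⊂ H_0, H_1`; the third curve is `c ⊂ H_2`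
      exact isWeaklyReducible_of_boundsDisc_two (p := 2) (i := 0) (j := 1) (by decide)
        (by decide) (by decide) hc ha hac.symm hnc hna hdc hda h
    · -- `a ⊂ H_0, H_2`; the third curve is `b ⊂ H_1`
      exact isWeaklyReducible_of_boundsDisc_two (p := 1) (i := 0) (j := 2) (by decide)
        (by decide) (by decide) hb ha hab.symm hnb hna hdb hda h
  · -- `b` compresses in `H_1` and in `H_q`, `q ∈ {0, 2}`
    fin_cases q
    · -- `b ⊂ H_1, H_0`; the third curve is `c ⊂ H_2`
      exact isWeaklyReducible_of_boundsDisc_two (p := 2) (i := 0) (j := 1) (by decide)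
        (by decide) (by decide) hc hb hbc.symm hnc hnb hdc h hdb
    · exact absurd rfl hq
    · -- `b ⊂ H_1, H_2`; the third curve is `a ⊂ H_0`
      exact isWeaklyReducible_of_boundsDisc_two (p := 0) (i := 1) (j := 2) (by decide)
        (by decide) (by decide) ha hb hab hna hnb hda hdb h
  · -- `c` compresses in `H_2` and in `H_q`, `q ∈ {0, 1}`
    fin_cases q
    · -- `c ⊂ H_2, H_0`; the third curve is `b ⊂ H_1`
      exact isWeaklyReducible_of_boundsDisc_two (p := 1) (i := 0) (j := 2) (by decide)
        (by decide) (by decide) hb hc hbc hnb hnc hdb h hdc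
    · -- `c ⊂ H_2, H_1`; the third curve is `a ⊂ H_0`
      exact isWeaklyReducible_of_boundsDisc_two (p := 0) (i := 1) (j := 2) (by decide)
        (by decide) (by decide) ha hc hac hna hnc hda h hdc
    · exact absurd rfl hq

end Vocabulary

/-! ### Naturality of dependent triples under diffeomorphisms -/

section Smooth

variable {X : Type u} [TopologicalSpace X] [ChartedSpace (𝔼 4) X] [IsManifold (𝓡 4) ∞ X]
  {X' : Type v} [TopologicalSpace X'] [ChartedSpace (𝔼 4) X'] [IsManifold (𝓡 4) ∞ X']

/-- **A diffeomorphism carries dependent triples to dependent triples**: the images of the three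
curves are pairwise disjoint non-separating curves on `Φ(Σ)` compressing in the image
handlebodies (`WeaklyReducibleTrisectionsNaturality.lean`), and `Φ(Σ) ∖ (Φa ∪ Φb ∪ Φc) =
Φ(Σ ∖ (a ∪ b ∪ c))` is disconnected because a homeomorphism preserves preconnectedness in both
directions. [cite: ArandaZupan2025, p. 2 (definition of a dependent triple)] -/
theorem HasDependentTriple.image_diffeomorph {S : Fin 3 → Set X} (h : HasDependentTriple S)
    (Φ : X ≃ₘ⟮𝓡 4, 𝓡 4⟯ X') : HasDependentTriple (fun i => Φ '' S i) := by
  obtain ⟨a, b, c, ha, hb, hc, hab, hbc, hac, hna, hnb, hnc, hda, hdb, hdc, hdep⟩ := h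
  have hinj : Function.Injective Φ := EquivLike.injective Φ
  refine ⟨Φ '' a, Φ '' b, Φ '' c, ha.image_diffeomorph Φ, hb.image_diffeomorph Φ,
    hc.image_diffeomorph Φ, (disjoint_image_iff hinj).2 hab, (disjoint_image_iff hinj).2 hbc,
    (disjoint_image_iff hinj).2 hac, hna.image_homeomorph Φ.toHomeomorph,
    hnb.image_homeomorph Φ.toHomeomorph, hnc.image_homeomorph Φ.toHomeomorph, ?_, ?_, ?_, ?_⟩
  · rw [spineHandlebody_image S hinj]
    exact hda.image_diffeomorph Φ
  · rw [spineHandlebody_image S hinj]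
    exact hdb.image_diffeomorph Φ
  · rw [spineHandlebody_image S hinj]
    exact hdc.image_diffeomorph Φ
  · rw [centralSurfaceSet_image S (EquivLike.bijective Φ), ← image_union, ← image_union,
      ← image_sdiff hinj]
    intro hpre
    refine hdep ?_
    have h' := hpre.image Φ.symm Φ.symm.continuous.continuousOn
    rwa [Diffeomorph.symm_image_image] at h'

/-- Admitting a dependent triple is invariant under diffeomorphisms.
[cite: ArandaZupan2025, p. 2 (definition of a dependent triple)] -/
theorem hasDependentTriple_image_diffeomorph_iff (S : Fin 3 → Set X)
    (Φ : X ≃ₘ⟮𝓡 4, 𝓡 4⟯ X') : HasDependentTriple (fun i => Φ '' S i) ↔ HasDependentTriple S := by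
  refine ⟨fun h => ?_, fun h => h.image_diffeomorph Φ⟩
  have h' := h.image_diffeomorph Φ.symm
  simp only [Diffeomorph.symm_image_image] at h'
  exact h'

end Smooth

end Trisection

/-! ### The fact through the vocabulary, and the shield -/

/-- **Dedup record (by `rfl`)**: the fact `arandaZupan_dependentTriple_genusThree_homotopySphere`
is the statement "a smooth `M ≃ₕ S⁴` with a genus-`3` GK-trisection `T` admitting a dependent
triple (`Trisection.HasDependentTriple T`) is diffeomorphic to `S⁴`".
[cite: ArandaZupan2025, Thm. 1.4 and Cor. 1.5 (p. 2)] -/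
theorem arandaZupan_dependentTriple_genusThree_homotopySphere_iff :
    arandaZupan_dependentTriple_genusThree_homotopySphere ↔
      ∀ (M : Type) [TopologicalSpace M] [T2Space M] [SecondCountableTopology M]
        [ChartedSpace (𝔼 4) M] [IsManifold (𝓡 4) ∞ M],
        M ≃ₕ 𝕊 4 → ∀ (k : Fin 3 → ℕ) (T : Fin 3 → Set M), IsGKTrisection M 3 k T →
          Trisection.HasDependentTriple T → Nonempty (M ≃ₘ⟮𝓡 4, 𝓡 4⟯ 𝕊 4) :=
  Iff.rfl

/-- **Shield (PROVED): the fact is implied by the smooth 4-dimensional Poincaré conjecture** in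
its homotopy-sphere form "every compact smooth `M ≃ₕ S⁴` is diffeomorphic to `S⁴`" (a trisected
manifold is compact, `IsGKTrisection.compactSpace`; the dependent triple is not used).  So the
fact cannot contradict the summit statement and can only be refuted by an exotic 4-sphere
carrying a genus-`3` trisection with a dependent triple. [folklore] -/
theorem arandaZupan_dependentTriple_genusThree_homotopySphere_of_smoothPoincare
    (hSPC : ∀ (M : Type) [TopologicalSpace M] [T2Space M] [SecondCountableTopology M]
      [ChartedSpace (𝔼 4) M] [IsManifold (𝓡 4) ∞ M] [CompactSpace M],
      M ≃ₕ 𝕊 4 → Nonempty (M ≃ₘ⟮𝓡 4, 𝓡 4⟯ 𝕊 4)) :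
    arandaZupan_dependentTriple_genusThree_homotopySphere := by
  intro M _ _ _ _ _ e k T hT _hdt
  haveI : CompactSpace M := hT.compactSpace
  exact hSPC M e

/-! ### Reduction to the balanced type `(3; 1,1,1)` (PROVED, GIVEN Meier–Schirmer–Zupan) -/

/-- **Modulo MSZ only the balanced type `(3; 1,1,1)` carries content (PROVED glue).**  GIVEN
Meier–Schirmer–Zupan's homotopy-sphere fact `Literature.Barriers.SmoothPoincare4.msz_homotopySphere_gk`
(D-0014 hypothesis `hMSZ`), the fact follows from its instance `hbal` for trisections of type
`(3; 1,1,1)`: if a genus-`3` GK-trisected smooth `M ≃ₕ S⁴` were not diffeomorphic to `S⁴`, then —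
`M` being compact (`IsGKTrisection.compactSpace`), simply connected (transported from `S⁴`,
`simplyConnectedSpace_sphere_four_holds`) and orientable (Lee Thm. 15.43,
`isOrientable_of_homotopyEquiv_sphere_four_holds`) — the PROVED tree theorem
`Literature.Barriers.SmoothPoincare4.eq_one_of_exotic_of_genus_three_of_msz_alone` (MSZ's range
`kᵢ ≥ g - 1` plus the proved Euler identity `3 = k₀ + k₁ + k₂`) forces `k = (1,1,1)`, where
`hbal` applies.  This is Aranda–Zupan's standing reduction "henceforth, we will assume that
`(g; k₁, k₂, k₃)`-trisections satisfy `kᵢ < g - 1`" (§2, p. 6, after Prop. 2.6 = [MSZ16]) for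
homotopy spheres.  (Same argument as the Summits-side
`dependentTripleGenusThreeStandard_of_msz_of_balanced`.)
[cite: ArandaZupan2025, §2 (p. 6, Prop. 2.6) and Thm. 1.4 (p. 2)] [cite: MeierSchirmerZupan2016, Thm. 1.2] -/
theorem arandaZupan_dependentTriple_genusThree_homotopySphere_of_msz_of_balanced
    (hMSZ : Literature.Barriers.SmoothPoincare4.msz_homotopySphere_gk.{0})
    (hbal : ∀ (M : Type) [TopologicalSpace M] [T2Space M] [SecondCountableTopology M]
      [ChartedSpace (𝔼 4) M] [IsManifold (𝓡 4) ∞ M],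
      M ≃ₕ 𝕊 4 → ∀ T : Fin 3 → Set M, IsGKTrisection M 3 (fun _ => 1) T →
        Trisection.HasDependentTriple T → Nonempty (M ≃ₘ⟮𝓡 4, 𝓡 4⟯ 𝕊 4)) :
    arandaZupan_dependentTriple_genusThree_homotopySphere := by
  intro M _ _ _ _ _ e k T hT hdt
  by_contra hE
  haveI hE' : IsEmpty (M ≃ₘ⟮𝓡 4, 𝓡 4⟯ 𝕊 4) := not_nonempty_iff.mp hE
  haveI : CompactSpace M := hT.compactSpace
  haveI : SimplyConnectedSpace (𝕊 4) := simplyConnectedSpace_sphere_four_holds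
  haveI : SimplyConnectedSpace M := e.simplyConnectedSpace
  obtain ⟨o⟩ := isOrientable_of_homotopyEquiv_sphere_four_holds M e
  have hk : k = fun _ => 1 := funext fun i =>
    Literature.Barriers.SmoothPoincare4.eq_one_of_exotic_of_genus_three_of_msz_alone
      hMSZ M o hT e hE' i
  subst hk
  exact hE (hbal M e T hT hdt)

/-- The trivial converse: the fact contains its balanced instance (so that, GIVEN
`msz_homotopySphere_gk`, the two are equivalent). [cite: ArandaZupan2025, Thm. 1.4 (p. 2)] -/
theorem arandaZupan_dependentTriple_genusThree_homotopySphere.balanced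
    (h : arandaZupan_dependentTriple_genusThree_homotopySphere)
    (M : Type) [TopologicalSpace M] [T2Space M] [SecondCountableTopology M]
    [ChartedSpace (𝔼 4) M] [IsManifold (𝓡 4) ∞ M] (e : M ≃ₕ 𝕊 4) (T : Fin 3 → Set M)
    (hT : IsGKTrisection M 3 (fun _ => 1) T) (hdt : Trisection.HasDependentTriple T) :
    Nonempty (M ≃ₘ⟮𝓡 4, 𝓡 4⟯ 𝕊 4) :=
  h M e _ T hT hdt

/-! ### Reduction to trisections that are NOT weakly reducible (PROVED, GIVEN the Thm. 1.3 fact) -/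

/-- **GIVEN Aranda–Zupan's Thm. 1.3 (homotopy-sphere corollary, the tree's fact
`arandaZupan_weaklyReducible_genusThree_homotopySphere`), the fact reduces to dependent triples
of trisections that are NOT weakly reducible** (PROVED glue, a case split on
`Trisection.IsWeaklyReducible T`).  In the printed proof of Thm. 1.4 (§7, p. 25) the
configurations (1) "two of the curves are homotopic" ("`𝒯` is weakly reducible, and the conclusion
follows from Theorem 1.3"), (2) "two of the curves are homologous but not homotopic" (Lemma 3.8 on
the Heegaard splitting `H_β ∪ H_γ`: "the trisection `𝒯` is again weakly reducible, and we apply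
Theorem 1.3") and the first sub-case of (3) ("If any of the curves bounds a disk in another
handlebody, then the splitting is weakly reducible", cf.
`Trisection.isWeaklyReducible_of_triple_of_boundsDisc_other`) are all absorbed by `hWR`; the
hypothesis `hcore` is what remains — the five-chain construction of case (3).
[cite: ArandaZupan2025, Thm. 1.3, Thm. 1.4 (p. 2) and §7 (p. 25)] -/
theorem arandaZupan_dependentTriple_genusThree_homotopySphere_of_weaklyReducible_of_notWeaklyReducible
    (hWR : arandaZupan_weaklyReducible_genusThree_homotopySphere)
    (hcore : ∀ (M : Type) [TopologicalSpace M] [T2Space M] [SecondCountableTopology M]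
      [ChartedSpace (𝔼 4) M] [IsManifold (𝓡 4) ∞ M],
      M ≃ₕ 𝕊 4 → ∀ (k : Fin 3 → ℕ) (T : Fin 3 → Set M), IsGKTrisection M 3 k T →
        Trisection.HasDependentTriple T → ¬ Trisection.IsWeaklyReducible T →
        Nonempty (M ≃ₘ⟮𝓡 4, 𝓡 4⟯ 𝕊 4)) :
    arandaZupan_dependentTriple_genusThree_homotopySphere := by
  intro M _ _ _ _ _ e k T hT hdt
  by_cases hwr : Trisection.IsWeaklyReducible T
  · exact hWR M e k T hT hwr
  · exact hcore M e k T hT hdt hwr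

/-- **GIVEN the Thm. 1.3 fact and MSZ, the fact reduces to balanced `(3; 1,1,1)`-trisections with
a dependent triple that are not weakly reducible** (PROVED glue: the two previous reductions
composed). [cite: ArandaZupan2025, Thm. 1.3, Thm. 1.4 (p. 2), §2 (p. 6) and §7 (p. 25)] [cite: MeierSchirmerZupan2016, Thm. 1.2] -/
theorem arandaZupan_dependentTriple_genusThree_homotopySphere_of_facts_of_notWeaklyReducible
    (hWR : arandaZupan_weaklyReducible_genusThree_homotopySphere)
    (hMSZ : Literature.Barriers.SmoothPoincare4.msz_homotopySphere_gk.{0})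
    (hcore : ∀ (M : Type) [TopologicalSpace M] [T2Space M] [SecondCountableTopology M]
      [ChartedSpace (𝔼 4) M] [IsManifold (𝓡 4) ∞ M],
      M ≃ₕ 𝕊 4 → ∀ T : Fin 3 → Set M, IsGKTrisection M 3 (fun _ => 1) T →
        Trisection.HasDependentTriple T → ¬ Trisection.IsWeaklyReducible T →
        Nonempty (M ≃ₘ⟮𝓡 4, 𝓡 4⟯ 𝕊 4)) :
    arandaZupan_dependentTriple_genusThree_homotopySphere := by
  refine arandaZupan_dependentTriple_genusThree_homotopySphere_of_msz_of_balanced hMSZ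
    fun M _ _ _ _ _ e T hT hdt => ?_
  by_cases hwr : Trisection.IsWeaklyReducible T
  · exact hWR M e _ T hT hwr
  · exact hcore M e T hT hdt hwr

/-! ### The dichotomy "reducible, or a five-chain": the reducible branch runs on tree facts -/

/-- **GIVEN MSZ and the two splitting facts for reducible trisections, the fact reduces to
IRREDUCIBLE balanced trisections with a dependent triple** (PROVED glue).  The first sentence of
Thm. 1.4 is the dichotomy "either `𝒯` is reducible, or `𝒯` contains a five-chain"; for a
homotopy 4-sphere the reducible branch is the PROVED tree theorem
`Literature.Barriers.SmoothPoincare4.nonempty_diffeomorph_sphere_of_isReducible_genusThree_of_splitting`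
(GIVEN `Trisection.isConnectedSum_of_reducing_separating`,
`Trisection.isConnectedSum_circleProd_of_reducing_nonseparating` and the genus-`≤ 2` fact, itself
a consequence of `msz_homotopySphere_gk` by `mz_genus_le_two_homotopySphere_gk_of_msz_alone`;
Kosinski's summand fact is discharged in the tree): a non-separating reducing curve would make
`S¹ × S³` a summand of the simply connected `M`, a separating one writes `M = M₁ # M₂` with
homotopy-sphere summands trisected in genus `≤ 2`, hence `M ≅ S⁴ # S⁴ ≅ S⁴`.  The hypothesis
`hirr` is the five-chain half of the dichotomy for homotopy spheres.
[cite: ArandaZupan2025, Thm. 1.4 (p. 2), §2 (p. 6) and §7 (pp. 25–26)] [cite: MeierSchirmerZupan2016, Thm. 1.2] -/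
theorem arandaZupan_dependentTriple_genusThree_homotopySphere_of_msz_of_splitting_of_irreducible
    (hMSZ : Literature.Barriers.SmoothPoincare4.msz_homotopySphere_gk.{0})
    (hsep : Trisection.isConnectedSum_of_reducing_separating.{0})
    (hns : Trisection.isConnectedSum_circleProd_of_reducing_nonseparating.{0})
    (hirr : ∀ (M : Type) [TopologicalSpace M] [T2Space M] [SecondCountableTopology M]
      [ChartedSpace (𝔼 4) M] [IsManifold (𝓡 4) ∞ M],
      M ≃ₕ 𝕊 4 → ∀ T : Fin 3 → Set M, IsGKTrisection M 3 (fun _ => 1) T →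
        Trisection.HasDependentTriple T → ¬ Trisection.IsReducible T →
        Nonempty (M ≃ₘ⟮𝓡 4, 𝓡 4⟯ 𝕊 4)) :
    arandaZupan_dependentTriple_genusThree_homotopySphere := by
  refine arandaZupan_dependentTriple_genusThree_homotopySphere_of_msz_of_balanced hMSZ
    fun M _ _ _ _ _ e T hT hdt => ?_
  by_cases hred : Trisection.IsReducible T
  · haveI : CompactSpace M := hT.compactSpace
    haveI : SimplyConnectedSpace (𝕊 4) := simplyConnectedSpace_sphere_four_holds
    haveI : SimplyConnectedSpace M := e.simplyConnectedSpace
    obtain ⟨o⟩ := isOrientable_of_homotopyEquiv_sphere_four_holds M e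
    exact Literature.Barriers.SmoothPoincare4.nonempty_diffeomorph_sphere_of_isReducible_genusThree_of_splitting
      hsep hns (Literature.Barriers.SmoothPoincare4.mz_genus_le_two_homotopySphere_gk_of_msz_alone hMSZ)
      M o (fun _ => 1) T hT hred e
  · exact hirr M e T hT hdt hred

/-- **Where the fact stands (PROVED glue): GIVEN the FOUR named facts of the tree** — the
Thm. 1.3 fact `arandaZupan_weaklyReducible_genusThree_homotopySphere`, Meier–Schirmer–Zupan's
`msz_homotopySphere_gk`, and the two splitting facts for reducible trisections — the fact is
implied by (and so, these facts granted, EQUIVALENT to, cf.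
`arandaZupan_dependentTriple_genusThree_homotopySphere.balanced`) its instance `h5`: *a smooth
`M ≃ₕ S⁴` with a `(3; 1,1,1)`-trisection that admits a dependent triple but is neither weakly
reducible nor reducible is diffeomorphic to `S⁴`*.  In the printed proof this is case (3) of §7
(pp. 25–26) past its first sentence: Lemma 3.7 applied to `H_α ∪ H_β` and to `H_α ∪ H_γ`, handle
slides, the five-chain `{γ₁, β₂, α₁, γ₂*, β₁}` (Fig. 19), five-chain surgery (Lemma 5.4,
Prop. 5.5: `X` is surgery on a loop `ℓ` in `X′` with a `(2; k₁, k₂, k₃)`-trisection), the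
genus-two classification [MZ17b] and Lemma 7.1 — for a homotopy sphere `ℓ` cannot be
null-homotopic (`H₂ ≠ 0` otherwise), so `X′ = S¹ × S³` and `X ∈ {S_1, S′_1} = {S⁴}` (Lemma 2.7,
p. 7).  None of it (thin position, handle slides, five-chains, loop surgery, [MZ17b], trisection
diagrams ↔ `IsGKTrisection`) has a counterpart in the tree; it is the outstanding content of the
fact and is NOT restated here as a named fact (D-0026).
[cite: ArandaZupan2025, Thm. 1.4 (p. 2) and §7 (pp. 25–26); Lemma 5.4, Prop. 5.5 (§5); Lemma 2.7 (p. 7)] [cite: MeierSchirmerZupan2016, Thm. 1.2] -/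
theorem arandaZupan_dependentTriple_genusThree_homotopySphere_of_facts_of_fiveChainCase
    (hWR : arandaZupan_weaklyReducible_genusThree_homotopySphere)
    (hMSZ : Literature.Barriers.SmoothPoincare4.msz_homotopySphere_gk.{0})
    (hsep : Trisection.isConnectedSum_of_reducing_separating.{0})
    (hns : Trisection.isConnectedSum_circleProd_of_reducing_nonseparating.{0})
    (h5 : ∀ (M : Type) [TopologicalSpace M] [T2Space M] [SecondCountableTopology M]
      [ChartedSpace (𝔼 4) M] [IsManifold (𝓡 4) ∞ M],
      M ≃ₕ 𝕊 4 → ∀ T : Fin 3 → Set M, IsGKTrisection M 3 (fun _ => 1) T →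
        Trisection.HasDependentTriple T → ¬ Trisection.IsWeaklyReducible T →
        ¬ Trisection.IsReducible T → Nonempty (M ≃ₘ⟮𝓡 4, 𝓡 4⟯ 𝕊 4)) :
    arandaZupan_dependentTriple_genusThree_homotopySphere := by
  refine arandaZupan_dependentTriple_genusThree_homotopySphere_of_msz_of_splitting_of_irreducible
    hMSZ hsep hns fun M _ _ _ _ _ e T hT hdt hred => ?_
  by_cases hwr : Trisection.IsWeaklyReducible T
  · exact hWR M e _ T hT hwr
  · exact h5 M e T hT hdt hwr hred

/-! ### Catalogue: the reductions from the TRACKED forms of the named facts, universe-free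

The Thm. 1.3 fact is vendored three times — the route-shaped `Type 0` statement
`arandaZupan_weaklyReducible_genusThree_homotopySphere` used above (verbatim the route item
`GenusThreeBase`), the barrier-catalogue entry
`Literature.Barriers.SmoothPoincare4.az2025_weaklyReducible_genusThree_homotopySphere_gk` (the
vendoring that carries the proof-status record of Thm. 1.3 and on which its provefact seats work)
and the topic fact `arandaZupan_genus_three_weaklyReducible_homotopySphere_gk` — and the three are
ONE statement (PROVED: `az2025_weaklyReducible_genusThree_homotopySphere_gk_iff_routeShape_univ`,
`…_iff_topic_univ`).  Likewise `msz_homotopySphere_gk` and the two splitting facts do not depend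
on their universe (`msz_homotopySphere_gk_of_univ`,
`Trisection.isConnectedSum_of_reducing_separating_of_univ`,
`Trisection.isConnectedSum_circleProd_of_reducing_nonseparating_of_univ`).  Hence the reductions
above hold with the four named facts taken at ANY universes and with Thm. 1.3 in its catalogue
form — the forms in which the prerequisites of this fact are tracked — and, these granted, the
fact is EQUIVALENT to its five-chain case `h5`.
-/

section Catalogue

universe u₁ u₂ u₃ u₄

/-- **GIVEN the catalogue form of the Thm. 1.3 fact (any universe), the fact reduces to dependent
triples of trisections that are NOT weakly reducible** (PROVED glue:
`az2025_weaklyReducible_genusThree_homotopySphere_gk_iff_routeShape_univ` and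
`…_of_weaklyReducible_of_notWeaklyReducible`). [cite: ArandaZupan2025, Thm. 1.3, Thm. 1.4 (p. 2) and §7 (p. 25)] -/
theorem arandaZupan_dependentTriple_genusThree_homotopySphere_of_az2025_of_notWeaklyReducible
    (hAZ : Literature.Barriers.SmoothPoincare4.az2025_weaklyReducible_genusThree_homotopySphere_gk.{u₁})
    (hcore : ∀ (M : Type) [TopologicalSpace M] [T2Space M] [SecondCountableTopology M]
      [ChartedSpace (𝔼 4) M] [IsManifold (𝓡 4) ∞ M],
      M ≃ₕ 𝕊 4 → ∀ (k : Fin 3 → ℕ) (T : Fin 3 → Set M), IsGKTrisection M 3 k T →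
        Trisection.HasDependentTriple T → ¬ Trisection.IsWeaklyReducible T →
        Nonempty (M ≃ₘ⟮𝓡 4, 𝓡 4⟯ 𝕊 4)) :
    arandaZupan_dependentTriple_genusThree_homotopySphere :=
  arandaZupan_dependentTriple_genusThree_homotopySphere_of_weaklyReducible_of_notWeaklyReducible
    (Literature.Barriers.SmoothPoincare4.az2025_weaklyReducible_genusThree_homotopySphere_gk_iff_routeShape_univ.mp
      hAZ) hcore

/-- **GIVEN MSZ and the two splitting facts at any universes, the fact reduces to IRREDUCIBLE
balanced trisections with a dependent triple** (PROVED glue: the universe transfers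
`msz_homotopySphere_gk_of_univ`, `Trisection.isConnectedSum_of_reducing_separating_of_univ`,
`Trisection.isConnectedSum_circleProd_of_reducing_nonseparating_of_univ` and
`…_of_msz_of_splitting_of_irreducible`).  This decomposition does not pass through Thm. 1.3: its
named-fact inputs are exactly Meier–Schirmer–Zupan's fact and the two splitting facts, its
residue `hirr` is Thm. 1.4 for irreducible `(3; 1,1,1)`-trisections of homotopy spheres ("`𝒯`
contains a five-chain", §§3–5 and [MZ17b]).
[cite: ArandaZupan2025, Thm. 1.4 (p. 2), §2 (p. 6) and §7 (pp. 25–26)] [cite: MeierSchirmerZupan2016, Thm. 1.2] -/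
theorem arandaZupan_dependentTriple_genusThree_homotopySphere_of_msz_of_splitting_of_irreducible_univ
    (hMSZ : Literature.Barriers.SmoothPoincare4.msz_homotopySphere_gk.{u₂})
    (hsep : Trisection.isConnectedSum_of_reducing_separating.{u₃})
    (hns : Trisection.isConnectedSum_circleProd_of_reducing_nonseparating.{u₄})
    (hirr : ∀ (M : Type) [TopologicalSpace M] [T2Space M] [SecondCountableTopology M]
      [ChartedSpace (𝔼 4) M] [IsManifold (𝓡 4) ∞ M],
      M ≃ₕ 𝕊 4 → ∀ T : Fin 3 → Set M, IsGKTrisection M 3 (fun _ => 1) T →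
        Trisection.HasDependentTriple T → ¬ Trisection.IsReducible T →
        Nonempty (M ≃ₘ⟮𝓡 4, 𝓡 4⟯ 𝕊 4)) :
    arandaZupan_dependentTriple_genusThree_homotopySphere :=
  arandaZupan_dependentTriple_genusThree_homotopySphere_of_msz_of_splitting_of_irreducible
    (Literature.Barriers.SmoothPoincare4.msz_homotopySphere_gk_of_univ hMSZ)
    (Trisection.isConnectedSum_of_reducing_separating_of_univ hsep)
    (Trisection.isConnectedSum_circleProd_of_reducing_nonseparating_of_univ hns) hirr

/-- **Where the fact stands, in the tracked forms (PROVED glue): GIVEN the catalogue form of the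
Thm. 1.3 fact, Meier–Schirmer–Zupan's fact and the two splitting facts, each at any universe, the
fact follows from its five-chain case `h5`** — a smooth `M ≃ₕ S⁴` with a `(3; 1,1,1)`-trisection
admitting a dependent triple, neither weakly reducible nor reducible, is `S⁴` (§7 case (3),
pp. 25–26). [cite: ArandaZupan2025, Thm. 1.3, Thm. 1.4 (p. 2) and §7 (pp. 25–26)] [cite: MeierSchirmerZupan2016, Thm. 1.2] -/
theorem arandaZupan_dependentTriple_genusThree_homotopySphere_of_az2025_facts_of_fiveChainCase
    (hAZ : Literature.Barriers.SmoothPoincare4.az2025_weaklyReducible_genusThree_homotopySphere_gk.{u₁})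
    (hMSZ : Literature.Barriers.SmoothPoincare4.msz_homotopySphere_gk.{u₂})
    (hsep : Trisection.isConnectedSum_of_reducing_separating.{u₃})
    (hns : Trisection.isConnectedSum_circleProd_of_reducing_nonseparating.{u₄})
    (h5 : ∀ (M : Type) [TopologicalSpace M] [T2Space M] [SecondCountableTopology M]
      [ChartedSpace (𝔼 4) M] [IsManifold (𝓡 4) ∞ M],
      M ≃ₕ 𝕊 4 → ∀ T : Fin 3 → Set M, IsGKTrisection M 3 (fun _ => 1) T →
        Trisection.HasDependentTriple T → ¬ Trisection.IsWeaklyReducible T →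
        ¬ Trisection.IsReducible T → Nonempty (M ≃ₘ⟮𝓡 4, 𝓡 4⟯ 𝕊 4)) :
    arandaZupan_dependentTriple_genusThree_homotopySphere :=
  arandaZupan_dependentTriple_genusThree_homotopySphere_of_facts_of_fiveChainCase
    (Literature.Barriers.SmoothPoincare4.az2025_weaklyReducible_genusThree_homotopySphere_gk_iff_routeShape_univ.mp
      hAZ)
    (Literature.Barriers.SmoothPoincare4.msz_homotopySphere_gk_of_univ hMSZ)
    (Trisection.isConnectedSum_of_reducing_separating_of_univ hsep)
    (Trisection.isConnectedSum_circleProd_of_reducing_nonseparating_of_univ hns) h5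

/-- The trivial converse: the fact contains its five-chain case `h5` (drop the two negative
hypotheses and specialise to `k = (1,1,1)`). [cite: ArandaZupan2025, Thm. 1.4 (p. 2)] -/
theorem arandaZupan_dependentTriple_genusThree_homotopySphere.fiveChainCase
    (h : arandaZupan_dependentTriple_genusThree_homotopySphere)
    (M : Type) [TopologicalSpace M] [T2Space M] [SecondCountableTopology M]
    [ChartedSpace (𝔼 4) M] [IsManifold (𝓡 4) ∞ M] (e : M ≃ₕ 𝕊 4) (T : Fin 3 → Set M)
    (hT : IsGKTrisection M 3 (fun _ => 1) T) (hdt : Trisection.HasDependentTriple T)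
    (_hwr : ¬ Trisection.IsWeaklyReducible T) (_hred : ¬ Trisection.IsReducible T) :
    Nonempty (M ≃ₘ⟮𝓡 4, 𝓡 4⟯ 𝕊 4) :=
  h M e _ T hT hdt

/-- **The four tracked facts granted (any universes), the fact is EQUIVALENT to its five-chain
case `h5`** (PROVED bookkeeping: `…_of_az2025_facts_of_fiveChainCase` and `….fiveChainCase`).
So the outstanding content of the discharge `…_holds` is exactly `h5` — §7 case (3) of the
printed proof (Lemma 3.7 twice, handle slides, the five-chain of Fig. 19, Lemma 5.4, Prop. 5.5,
[MZ17b], Lemma 2.7), none of which has a declaration in the tree.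
[cite: ArandaZupan2025, Thm. 1.3, Thm. 1.4 (p. 2) and §7 (pp. 25–26)] [cite: MeierSchirmerZupan2016, Thm. 1.2] -/
theorem arandaZupan_dependentTriple_genusThree_homotopySphere_iff_fiveChainCase_of_facts
    (hAZ : Literature.Barriers.SmoothPoincare4.az2025_weaklyReducible_genusThree_homotopySphere_gk.{u₁})
    (hMSZ : Literature.Barriers.SmoothPoincare4.msz_homotopySphere_gk.{u₂})
    (hsep : Trisection.isConnectedSum_of_reducing_separating.{u₃})
    (hns : Trisection.isConnectedSum_circleProd_of_reducing_nonseparating.{u₄}) :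
    arandaZupan_dependentTriple_genusThree_homotopySphere ↔
      ∀ (M : Type) [TopologicalSpace M] [T2Space M] [SecondCountableTopology M]
        [ChartedSpace (𝔼 4) M] [IsManifold (𝓡 4) ∞ M],
        M ≃ₕ 𝕊 4 → ∀ T : Fin 3 → Set M, IsGKTrisection M 3 (fun _ => 1) T →
          Trisection.HasDependentTriple T → ¬ Trisection.IsWeaklyReducible T →
          ¬ Trisection.IsReducible T → Nonempty (M ≃ₘ⟮𝓡 4, 𝓡 4⟯ 𝕊 4) :=
  ⟨fun h M _ _ _ _ _ e T hT hdt hwr hred => h.fiveChainCase M e T hT hdt hwr hred,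
    arandaZupan_dependentTriple_genusThree_homotopySphere_of_az2025_facts_of_fiveChainCase
      hAZ hMSZ hsep hns⟩

end Catalogue

/-! ### The case split of §7 at set level (PROVED glue): a separating pair — Lemma 3.8 and the
### parallel case — versus the pants case; and the reducible branch on the `π₁`-shadow

In the printed proof of Thm. 1.4 (§7, p. 25) a dependent triple `(α₁, β₁, γ₁)` on the genus-`3`
surface `Σ` falls into three configurations (p. 24, Fig. 18): (1) two of the curves are
homotopic; (2) two are homologous but not homotopic ("the two curves cut `Σ` into two
twice-punctured tori"); (3) no two are homologous ("`Σ ∖ (α₁ ∪ β₁ ∪ γ₁)` has two components,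
where one component is a thrice-punctured torus and the other component is a pair of pants").
For pairwise disjoint, individually non-separating curves on the closed connected orientable
genus-`3` surface the three configurations are told apart by WHICH SUB-UNIONS SEPARATE `Σ`:
in (1) and (2) some two of the curves already separate `Σ` — and conversely two disjoint
non-separating curves `x, y` with `Σ ∖ (x ∪ y)` disconnected are parallel or cut `Σ` into two
twice-punctured tori (cut `Σ` along `x`: a genus-`2` surface with two scars, which `y` must
separate into two pieces containing one scar each, of genera `g₁ + g₂ = 2`; `{g₁, g₂} = {0, 2}`
is an annulus between `x` and `y`, `g₁ = g₂ = 1` is (2)) — while in (3) no two of them do (and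
conversely "no pair separates, the triple separates" forces the pants/thrice-punctured-torus
picture by the same count).  So AT SET LEVEL the trichotomy is the dichotomy "some pair of the
triple separates `Σ`" / "no pair does", which is pure logic, and the printed treatment of (1)
and (2) is ONE statement about a separating pair `x ⊂ H_i`, `y ⊂ H_j` (`i ≠ j`) of disjoint
non-separating compressing curves of a `(3; 1,1,1)`-trisection: *one of the two compresses in
the other handlebody as well* (hypothesis `hL38` below).  For (2) this is **Lemma 3.8**
verbatim (p. 10: "Suppose `H₁ ∪_Σ H₂` is a genus-three Heegaard splitting of `Y = S³` or
`S¹ × S²`, and let `c₁` and `c₂` be a weak-reducing pair of non-separating but mutually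
separating curves. Then either `c₁` is a reducing curve or `c₂` is a reducing curve"), applied
as on p. 25 to the genus-`3` Heegaard splitting `H_i ∪ H_j` of `∂X_l ≅ S¹ × S²` (`k_l = 1`);
for (1) it is the sentence "In case (1), `𝒯` is weakly reducible" (p. 25: parallel curves bound
parallel discs — `x` bounds in `H_j` the annulus between `x` and `y` capped off by the disc of
`y` and pushed into `H_j`).  Either way that curve compresses in two handlebodies, the third
curve of the triple is disjoint from it, and `Trisection.isWeaklyReducible_of_triple_of_boundsDisc_other`
makes `𝒯` weakly reducible — which the five-chain case `h5` excludes.  What is left of `h5` is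
configuration (3) proper (hypothesis `hPants`: p. 25 from "The third case requires more work"
on — Lemma 3.7 twice, handle slides, the five-chain `{γ₁, β₂, α₁, γ₂*, β₁}` of Fig. 19,
Lemma 5.4, Prop. 5.5, [MZ17b], Lemma 7.1 / Lemma 2.7).  Both inputs are INLINE hypotheses
(D-0026: neither is restated as a named fact), in the vocabulary of
`WeaklyReducibleTrisections.lean`; `hL38` is moreover the first step of the printed proof of
Prop. 3.9 (p. 10: "suppose that `α₁` and `β₃` are mutually separating … By Lemma 3.8, either
`α₁` bounds a disk in `H_β` or `β₃` bounds a disk in `H_α`"), i.e. an input shared with the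
irreducible core of the Thm. 1.3 fact
(`Literature.Barriers.SmoothPoincare4.az2025_weaklyReducible_genusThree_homotopySphere_gk`).

The last two theorems of the section re-run the reducible branch of the reductions on the
`π₁`-SHADOW of the non-separating splitting record (a non-separating reducing curve forces
`π₁ ≠ 1`; inline hypothesis `hπ`, binder shape of
`Trisection.not_simplyConnectedSpace_of_reducing_nonseparating_of_fact` minus its fact argument,
exactly as `Literature.Barriers.SmoothPoincare4.az2025_weaklyReducible_genusThree_homotopySphere_gk_of_msz_of_sep_of_pi1_of_irreducible`
does for Thm. 1.3), so that this fact and the Thm. 1.3 fact are tracked against the SAME inputs: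
the Thm. 1.3 fact, `msz_homotopySphere_gk`, the separating splitting fact, the `π₁`-shadow,
`hL38`, and their respective cores (`hPants` here).
-/

section CaseSplit

open Trisection

universe u₁ u₂ u₃ u₄ u₅ u₆ u₇

/-- **The five-chain case `h5` from a separating-pair lemma and the pants case (PROVED glue:
the case split of §7, p. 25, at set level).**  Hypothesis `hL38` — *in a `(3; 1,1,1)`-trisection,
if `x ⊂ H_i` and `y ⊂ H_j` (`i ≠ j`) are disjoint non-separating compressing curves whose union
separates the central surface, then `x` compresses in `H_j` or `y` compresses in `H_i`* — is
Lemma 3.8 (configuration (2)) together with the parallel-discs remark of configuration (1);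
hypothesis `hPants` is configuration (3) of a dependent triple (no two of the three curves
separate `Σ`) on a `(3; 1,1,1)`-trisected homotopy 4-sphere that is neither weakly reducible nor
reducible.  Given a dependent triple `(a, b, c)` with `𝒯` not weakly reducible: if some pair
separates `Σ`, `hL38` puts one of its curves in a second handlebody and
`isWeaklyReducible_of_triple_of_boundsDisc_other` contradicts `¬ IsWeaklyReducible`; otherwise
`hPants` applies (the pair complements contain `Σ ∖ (a ∪ b ∪ c) ≠ ∅`, so they are connected,
not merely preconnected).
[cite: ArandaZupan2025, §7 (p. 24, the three configurations; p. 25, proof of Thm. 1.4) and Lemma 3.8 (p. 10)] -/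
theorem fiveChainCase_of_separatingPair_of_pantsCase
    (hL38 : ∀ (M : Type) [TopologicalSpace M] [T2Space M] [SecondCountableTopology M]
      [ChartedSpace (𝔼 4) M] [IsManifold (𝓡 4) ∞ M] (T : Fin 3 → Set M),
      IsGKTrisection M 3 (fun _ => 1) T → ∀ i j : Fin 3, i ≠ j → ∀ x y : Set M,
      IsCurve T x → IsCurve T y → Disjoint x y → IsNonSeparating T x → IsNonSeparating T y →
      ¬ IsPreconnected (centralSurfaceSet T \ (x ∪ y)) →
      BoundsDisc T (spineHandlebody T i) x → BoundsDisc T (spineHandlebody T j) y →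
      BoundsDisc T (spineHandlebody T j) x ∨ BoundsDisc T (spineHandlebody T i) y)
    (hPants : ∀ (M : Type) [TopologicalSpace M] [T2Space M] [SecondCountableTopology M]
      [ChartedSpace (𝔼 4) M] [IsManifold (𝓡 4) ∞ M],
      M ≃ₕ 𝕊 4 → ∀ T : Fin 3 → Set M, IsGKTrisection M 3 (fun _ => 1) T →
      ∀ a b c : Set M, IsCurve T a → IsCurve T b → IsCurve T c →
      Disjoint a b → Disjoint b c → Disjoint a c →
      IsNonSeparating T a → IsNonSeparating T b → IsNonSeparating T c →
      BoundsDisc T (spineHandlebody T 0) a → BoundsDisc T (spineHandlebody T 1) b →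
      BoundsDisc T (spineHandlebody T 2) c →
      ¬ IsPreconnected (centralSurfaceSet T \ (a ∪ b ∪ c)) →
      IsConnected (centralSurfaceSet T \ (a ∪ b)) → IsConnected (centralSurfaceSet T \ (b ∪ c)) →
      IsConnected (centralSurfaceSet T \ (a ∪ c)) →
      ¬ IsWeaklyReducible T → ¬ IsReducible T → Nonempty (M ≃ₘ⟮𝓡 4, 𝓡 4⟯ 𝕊 4)) :
    ∀ (M : Type) [TopologicalSpace M] [T2Space M] [SecondCountableTopology M]
      [ChartedSpace (𝔼 4) M] [IsManifold (𝓡 4) ∞ M],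
      M ≃ₕ 𝕊 4 → ∀ T : Fin 3 → Set M, IsGKTrisection M 3 (fun _ => 1) T →
        HasDependentTriple T → ¬ IsWeaklyReducible T → ¬ IsReducible T →
        Nonempty (M ≃ₘ⟮𝓡 4, 𝓡 4⟯ 𝕊 4) := by
  intro M _ _ _ _ _ e T hT hdt hwr hred
  obtain ⟨a, b, c, ha, hb, hc, hab, hbc, hac, hna, hnb, hnc, hda, hdb, hdc, hdep⟩ := hdt
  -- the complement of the three curves is non-empty (the empty set is preconnected)
  have hne : (centralSurfaceSet T \ (a ∪ b ∪ c)).Nonempty :=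
    Set.nonempty_iff_ne_empty.2 fun h => hdep (h ▸ isPreconnected_empty)
  by_cases hpab : IsPreconnected (centralSurfaceSet T \ (a ∪ b))
  · by_cases hpbc : IsPreconnected (centralSurfaceSet T \ (b ∪ c))
    · by_cases hpac : IsPreconnected (centralSurfaceSet T \ (a ∪ c))
      · -- configuration (3): no pair separates
        exact hPants M e T hT a b c ha hb hc hab hbc hac hna hnb hnc hda hdb hdc hdep
          ⟨hne.mono (Set.sdiff_subset_sdiff_right subset_union_left), hpab⟩
          ⟨hne.mono (Set.sdiff_subset_sdiff_right
            (union_subset (subset_union_right.trans subset_union_left) subset_union_right)), hpbc⟩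
          ⟨hne.mono (Set.sdiff_subset_sdiff_right
            (union_subset (subset_union_left.trans subset_union_left) subset_union_right)), hpac⟩
          hwr hred
      · -- the pair `a ⊂ H_0`, `c ⊂ H_2` separates
        refine absurd ?_ hwr
        rcases hL38 M T hT 0 2 (by decide) a c ha hc hac hna hnc hpac hda hdc with h | h
        · exact isWeaklyReducible_of_triple_of_boundsDisc_other ha hb hc hab hbc hac hna hnb hnc
            hda hdb hdc (Or.inl ⟨2, by decide, h⟩)
        · exact isWeaklyReducible_of_triple_of_boundsDisc_other ha hb hc hab hbc hac hna hnb hnc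
            hda hdb hdc (Or.inr (Or.inr ⟨0, by decide, h⟩))
    · -- the pair `b ⊂ H_1`, `c ⊂ H_2` separates
      refine absurd ?_ hwr
      rcases hL38 M T hT 1 2 (by decide) b c hb hc hbc hnb hnc hpbc hdb hdc with h | h
      · exact isWeaklyReducible_of_triple_of_boundsDisc_other ha hb hc hab hbc hac hna hnb hnc
          hda hdb hdc (Or.inr (Or.inl ⟨2, by decide, h⟩))
      · exact isWeaklyReducible_of_triple_of_boundsDisc_other ha hb hc hab hbc hac hna hnb hnc
          hda hdb hdc (Or.inr (Or.inr ⟨1, by decide, h⟩))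
  · -- the pair `a ⊂ H_0`, `b ⊂ H_1` separates
    refine absurd ?_ hwr
    rcases hL38 M T hT 0 1 (by decide) a b ha hb hab hna hnb hpab hda hdb with h | h
    · exact isWeaklyReducible_of_triple_of_boundsDisc_other ha hb hc hab hbc hac hna hnb hnc
        hda hdb hdc (Or.inl ⟨1, by decide, h⟩)
    · exact isWeaklyReducible_of_triple_of_boundsDisc_other ha hb hc hab hbc hac hna hnb hnc
        hda hdb hdc (Or.inr (Or.inl ⟨0, by decide, h⟩))

/-- The trivial converse: the fact contains its pants case `hPants` (drop the negative and the
configuration hypotheses, specialise to `k = (1,1,1)`). [cite: ArandaZupan2025, Thm. 1.4 (p. 2) and §7 (p. 25)] -/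
theorem arandaZupan_dependentTriple_genusThree_homotopySphere.pantsCase
    (h : arandaZupan_dependentTriple_genusThree_homotopySphere)
    (M : Type) [TopologicalSpace M] [T2Space M] [SecondCountableTopology M]
    [ChartedSpace (𝔼 4) M] [IsManifold (𝓡 4) ∞ M] (e : M ≃ₕ 𝕊 4) (T : Fin 3 → Set M)
    (hT : IsGKTrisection M 3 (fun _ => 1) T) (a b c : Set M) (ha : IsCurve T a)
    (hb : IsCurve T b) (hc : IsCurve T c) (hab : Disjoint a b) (hbc : Disjoint b c)
    (hac : Disjoint a c) (hna : IsNonSeparating T a) (hnb : IsNonSeparating T b)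
    (hnc : IsNonSeparating T c) (hda : BoundsDisc T (spineHandlebody T 0) a)
    (hdb : BoundsDisc T (spineHandlebody T 1) b) (hdc : BoundsDisc T (spineHandlebody T 2) c)
    (hdep : ¬ IsPreconnected (centralSurfaceSet T \ (a ∪ b ∪ c)))
    (_hab' : IsConnected (centralSurfaceSet T \ (a ∪ b)))
    (_hbc' : IsConnected (centralSurfaceSet T \ (b ∪ c)))
    (_hac' : IsConnected (centralSurfaceSet T \ (a ∪ c)))
    (_hwr : ¬ IsWeaklyReducible T) (_hred : ¬ IsReducible T) :
    Nonempty (M ≃ₘ⟮𝓡 4, 𝓡 4⟯ 𝕊 4) :=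
  h M e _ T hT ⟨a, b, c, ha, hb, hc, hab, hbc, hac, hna, hnb, hnc, hda, hdb, hdc, hdep⟩

/-- **Where the fact stands after the case split (PROVED glue): GIVEN the four tracked facts
(any universes), the fact follows from the separating-pair lemma `hL38` (Lemma 3.8 +
configuration (1)) and the pants case `hPants` (configuration (3) of §7).**
[cite: ArandaZupan2025, Thm. 1.3, Thm. 1.4 (p. 2), Lemma 3.8 (p. 10) and §7 (pp. 24–26)] [cite: MeierSchirmerZupan2016, Thm. 1.2] -/
theorem arandaZupan_dependentTriple_genusThree_homotopySphere_of_az2025_facts_of_separatingPair_of_pantsCase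
    (hAZ : Literature.Barriers.SmoothPoincare4.az2025_weaklyReducible_genusThree_homotopySphere_gk.{u₁})
    (hMSZ : Literature.Barriers.SmoothPoincare4.msz_homotopySphere_gk.{u₂})
    (hsep : isConnectedSum_of_reducing_separating.{u₃})
    (hns : isConnectedSum_circleProd_of_reducing_nonseparating.{u₄})
    (hL38 : ∀ (M : Type) [TopologicalSpace M] [T2Space M] [SecondCountableTopology M]
      [ChartedSpace (𝔼 4) M] [IsManifold (𝓡 4) ∞ M] (T : Fin 3 → Set M),
      IsGKTrisection M 3 (fun _ => 1) T → ∀ i j : Fin 3, i ≠ j → ∀ x y : Set M,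
      IsCurve T x → IsCurve T y → Disjoint x y → IsNonSeparating T x → IsNonSeparating T y →
      ¬ IsPreconnected (centralSurfaceSet T \ (x ∪ y)) →
      BoundsDisc T (spineHandlebody T i) x → BoundsDisc T (spineHandlebody T j) y →
      BoundsDisc T (spineHandlebody T j) x ∨ BoundsDisc T (spineHandlebody T i) y)
    (hPants : ∀ (M : Type) [TopologicalSpace M] [T2Space M] [SecondCountableTopology M]
      [ChartedSpace (𝔼 4) M] [IsManifold (𝓡 4) ∞ M],
      M ≃ₕ 𝕊 4 → ∀ T : Fin 3 → Set M, IsGKTrisection M 3 (fun _ => 1) T →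
      ∀ a b c : Set M, IsCurve T a → IsCurve T b → IsCurve T c →
      Disjoint a b → Disjoint b c → Disjoint a c →
      IsNonSeparating T a → IsNonSeparating T b → IsNonSeparating T c →
      BoundsDisc T (spineHandlebody T 0) a → BoundsDisc T (spineHandlebody T 1) b →
      BoundsDisc T (spineHandlebody T 2) c →
      ¬ IsPreconnected (centralSurfaceSet T \ (a ∪ b ∪ c)) →
      IsConnected (centralSurfaceSet T \ (a ∪ b)) → IsConnected (centralSurfaceSet T \ (b ∪ c)) →
      IsConnected (centralSurfaceSet T \ (a ∪ c)) →
      ¬ IsWeaklyReducible T → ¬ IsReducible T → Nonempty (M ≃ₘ⟮𝓡 4, 𝓡 4⟯ 𝕊 4)) :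
    arandaZupan_dependentTriple_genusThree_homotopySphere :=
  arandaZupan_dependentTriple_genusThree_homotopySphere_of_az2025_facts_of_fiveChainCase hAZ hMSZ
    hsep hns (fiveChainCase_of_separatingPair_of_pantsCase hL38 hPants)

/-- **The four tracked facts and `hL38` granted, the fact is EQUIVALENT to its pants case**
(PROVED bookkeeping: the previous theorem and `….pantsCase`).  So, modulo Lemma 3.8 (with the
parallel case), the outstanding content of `…_holds` is configuration (3) of §7 alone.
[cite: ArandaZupan2025, Thm. 1.4 (p. 2), Lemma 3.8 (p. 10) and §7 (pp. 24–26)] -/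
theorem arandaZupan_dependentTriple_genusThree_homotopySphere_iff_pantsCase_of_facts
    (hAZ : Literature.Barriers.SmoothPoincare4.az2025_weaklyReducible_genusThree_homotopySphere_gk.{u₁})
    (hMSZ : Literature.Barriers.SmoothPoincare4.msz_homotopySphere_gk.{u₂})
    (hsep : isConnectedSum_of_reducing_separating.{u₃})
    (hns : isConnectedSum_circleProd_of_reducing_nonseparating.{u₄})
    (hL38 : ∀ (M : Type) [TopologicalSpace M] [T2Space M] [SecondCountableTopology M]
      [ChartedSpace (𝔼 4) M] [IsManifold (𝓡 4) ∞ M] (T : Fin 3 → Set M),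
      IsGKTrisection M 3 (fun _ => 1) T → ∀ i j : Fin 3, i ≠ j → ∀ x y : Set M,
      IsCurve T x → IsCurve T y → Disjoint x y → IsNonSeparating T x → IsNonSeparating T y →
      ¬ IsPreconnected (centralSurfaceSet T \ (x ∪ y)) →
      BoundsDisc T (spineHandlebody T i) x → BoundsDisc T (spineHandlebody T j) y →
      BoundsDisc T (spineHandlebody T j) x ∨ BoundsDisc T (spineHandlebody T i) y) :
    arandaZupan_dependentTriple_genusThree_homotopySphere ↔
      ∀ (M : Type) [TopologicalSpace M] [T2Space M] [SecondCountableTopology M]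
        [ChartedSpace (𝔼 4) M] [IsManifold (𝓡 4) ∞ M],
        M ≃ₕ 𝕊 4 → ∀ T : Fin 3 → Set M, IsGKTrisection M 3 (fun _ => 1) T →
        ∀ a b c : Set M, IsCurve T a → IsCurve T b → IsCurve T c →
        Disjoint a b → Disjoint b c → Disjoint a c →
        IsNonSeparating T a → IsNonSeparating T b → IsNonSeparating T c →
        BoundsDisc T (spineHandlebody T 0) a → BoundsDisc T (spineHandlebody T 1) b →
        BoundsDisc T (spineHandlebody T 2) c →
        ¬ IsPreconnected (centralSurfaceSet T \ (a ∪ b ∪ c)) →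
        IsConnected (centralSurfaceSet T \ (a ∪ b)) → IsConnected (centralSurfaceSet T \ (b ∪ c)) →
        IsConnected (centralSurfaceSet T \ (a ∪ c)) →
        ¬ IsWeaklyReducible T → ¬ IsReducible T → Nonempty (M ≃ₘ⟮𝓡 4, 𝓡 4⟯ 𝕊 4) :=
  ⟨fun h M _ _ _ _ _ e T hT => h.pantsCase M e T hT,
    arandaZupan_dependentTriple_genusThree_homotopySphere_of_az2025_facts_of_separatingPair_of_pantsCase
      hAZ hMSZ hsep hns hL38⟩

/-- **The reductions on the `π₁`-shadow (PROVED glue).**  GIVEN the Thm. 1.3 fact (catalogue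
form, any universe), `msz_homotopySphere_gk` (any universe), the SEPARATING splitting fact (any
universe) and — instead of the non-separating splitting record — its `π₁`-shadow `hπ` at
universe `0` ("a closed connected oriented GK-trisected 4-manifold with a non-separating
reducing curve is not simply connected", the binder shape of
`Trisection.not_simplyConnectedSpace_of_reducing_nonseparating_of_fact` without its fact
argument), the fact follows from its five-chain case `h5`.  On the homotopy sphere `M` every
reducing curve separates by `hπ`, and the reducible branch is
`Literature.Barriers.SmoothPoincare4.nonempty_diffeomorph_sphere_of_isReducible_genusThree_of_separates`
(with the genus-`≤ 2` fact from `msz_homotopySphere_gk`,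
`mz_genus_le_two_homotopySphere_gk_of_msz_alone`).
[cite: ArandaZupan2025, Thm. 1.3, Thm. 1.4 (p. 2), §2 (p. 6) and §7 (pp. 25–26)] [cite: MeierSchirmerZupan2016, Thm. 1.2] -/
theorem arandaZupan_dependentTriple_genusThree_homotopySphere_of_az2025_of_msz_of_sep_of_pi1_of_fiveChainCase
    (hAZ : Literature.Barriers.SmoothPoincare4.az2025_weaklyReducible_genusThree_homotopySphere_gk.{u₅})
    (hMSZ : Literature.Barriers.SmoothPoincare4.msz_homotopySphere_gk.{u₆})
    (hsep : isConnectedSum_of_reducing_separating.{u₇})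
    (hπ : ∀ (X : Type) [TopologicalSpace X] [T2Space X] [SecondCountableTopology X]
      [ChartedSpace (𝔼 4) X] [IsManifold (𝓡 4) ∞ X] [CompactSpace X] [ConnectedSpace X]
      (_ : SmoothOrientation (𝓡 4) X) (g : ℕ) (k : Fin 3 → ℕ) (S : Fin 3 → Set X) (δ : Set X),
      IsGKTrisection X g k S → IsCurve S δ →
      (¬ ∃ d : 𝔻 2 → X, Manifold.IsSmoothEmbedding (𝓡∂ 2) (𝓡 4) ∞ d ∧
          range d ⊆ centralSurfaceSet S ∧ d '' (𝓡∂ 2).boundary (𝔻 2) = δ) →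
      (∀ q : Fin 3, BoundsDisc S (spineHandlebody S q) δ) → IsNonSeparating S δ →
      ¬ SimplyConnectedSpace X)
    (h5 : ∀ (M : Type) [TopologicalSpace M] [T2Space M] [SecondCountableTopology M]
      [ChartedSpace (𝔼 4) M] [IsManifold (𝓡 4) ∞ M],
      M ≃ₕ 𝕊 4 → ∀ T : Fin 3 → Set M, IsGKTrisection M 3 (fun _ => 1) T →
        HasDependentTriple T → ¬ IsWeaklyReducible T → ¬ IsReducible T →
        Nonempty (M ≃ₘ⟮𝓡 4, 𝓡 4⟯ 𝕊 4)) :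
    arandaZupan_dependentTriple_genusThree_homotopySphere := by
  refine arandaZupan_dependentTriple_genusThree_homotopySphere_of_msz_of_balanced
    (Literature.Barriers.SmoothPoincare4.msz_homotopySphere_gk_of_univ hMSZ)
    fun M _ _ _ _ _ e T hT hdt => ?_
  by_cases hwr : IsWeaklyReducible T
  · exact (Literature.Barriers.SmoothPoincare4.az2025_weaklyReducible_genusThree_homotopySphere_gk_iff_routeShape_univ.mp
      hAZ) M e _ T hT hwr
  · by_cases hred : IsReducible T
    · haveI : CompactSpace M := hT.compactSpace
      haveI : SimplyConnectedSpace (𝕊 4) := simplyConnectedSpace_sphere_four_holds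
      haveI : SimplyConnectedSpace M := e.simplyConnectedSpace
      obtain ⟨o⟩ := isOrientable_of_homotopyEquiv_sphere_four_holds M e
      exact Literature.Barriers.SmoothPoincare4.nonempty_diffeomorph_sphere_of_isReducible_genusThree_of_separates
        (isConnectedSum_of_reducing_separating_of_univ hsep)
        (Literature.Barriers.SmoothPoincare4.mz_genus_le_two_homotopySphere_gk_of_msz_alone
          (Literature.Barriers.SmoothPoincare4.msz_homotopySphere_gk_of_univ hMSZ))
        M o (fun _ => 1) T hT hred
        (fun δ hc hess hd hn => hπ M o 3 (fun _ => 1) T δ hT hc hess hd hn ‹_›) e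
    · exact h5 M e T hT hdt hwr hred

/-- **All inputs aligned with the Thm. 1.3 fact's tracking (PROVED glue):** GIVEN the Thm. 1.3
fact, `msz_homotopySphere_gk`, the separating splitting fact (each at any universe), the
`π₁`-shadow `hπ` and the separating-pair lemma `hL38` (both at universe `0`), the fact follows
from its pants case `hPants` — configuration (3) of §7, the one input of Thm. 1.4 beyond those
of Thm. 1.3 that has no counterpart in the tree.
[cite: ArandaZupan2025, Thm. 1.3, Thm. 1.4 (p. 2), Lemma 3.8 (p. 10), §2 (p. 6) and §7 (pp. 24–26)] [cite: MeierSchirmerZupan2016, Thm. 1.2] -/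
theorem arandaZupan_dependentTriple_genusThree_homotopySphere_of_az2025_of_msz_of_sep_of_pi1_of_separatingPair_of_pantsCase
    (hAZ : Literature.Barriers.SmoothPoincare4.az2025_weaklyReducible_genusThree_homotopySphere_gk.{u₅})
    (hMSZ : Literature.Barriers.SmoothPoincare4.msz_homotopySphere_gk.{u₆})
    (hsep : isConnectedSum_of_reducing_separating.{u₇})
    (hπ : ∀ (X : Type) [TopologicalSpace X] [T2Space X] [SecondCountableTopology X]
      [ChartedSpace (𝔼 4) X] [IsManifold (𝓡 4) ∞ X] [CompactSpace X] [ConnectedSpace X]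
      (_ : SmoothOrientation (𝓡 4) X) (g : ℕ) (k : Fin 3 → ℕ) (S : Fin 3 → Set X) (δ : Set X),
      IsGKTrisection X g k S → IsCurve S δ →
      (¬ ∃ d : 𝔻 2 → X, Manifold.IsSmoothEmbedding (𝓡∂ 2) (𝓡 4) ∞ d ∧
          range d ⊆ centralSurfaceSet S ∧ d '' (𝓡∂ 2).boundary (𝔻 2) = δ) →
      (∀ q : Fin 3, BoundsDisc S (spineHandlebody S q) δ) → IsNonSeparating S δ →
      ¬ SimplyConnectedSpace X)
    (hL38 : ∀ (M : Type) [TopologicalSpace M] [T2Space M] [SecondCountableTopology M]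
      [ChartedSpace (𝔼 4) M] [IsManifold (𝓡 4) ∞ M] (T : Fin 3 → Set M),
      IsGKTrisection M 3 (fun _ => 1) T → ∀ i j : Fin 3, i ≠ j → ∀ x y : Set M,
      IsCurve T x → IsCurve T y → Disjoint x y → IsNonSeparating T x → IsNonSeparating T y →
      ¬ IsPreconnected (centralSurfaceSet T \ (x ∪ y)) →
      BoundsDisc T (spineHandlebody T i) x → BoundsDisc T (spineHandlebody T j) y →
      BoundsDisc T (spineHandlebody T j) x ∨ BoundsDisc T (spineHandlebody T i) y)
    (hPants : ∀ (M : Type) [TopologicalSpace M] [T2Space M] [SecondCountableTopology M]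
      [ChartedSpace (𝔼 4) M] [IsManifold (𝓡 4) ∞ M],
      M ≃ₕ 𝕊 4 → ∀ T : Fin 3 → Set M, IsGKTrisection M 3 (fun _ => 1) T →
      ∀ a b c : Set M, IsCurve T a → IsCurve T b → IsCurve T c →
      Disjoint a b → Disjoint b c → Disjoint a c →
      IsNonSeparating T a → IsNonSeparating T b → IsNonSeparating T c →
      BoundsDisc T (spineHandlebody T 0) a → BoundsDisc T (spineHandlebody T 1) b →
      BoundsDisc T (spineHandlebody T 2) c →
      ¬ IsPreconnected (centralSurfaceSet T \ (a ∪ b ∪ c)) →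
      IsConnected (centralSurfaceSet T \ (a ∪ b)) → IsConnected (centralSurfaceSet T \ (b ∪ c)) →
      IsConnected (centralSurfaceSet T \ (a ∪ c)) →
      ¬ IsWeaklyReducible T → ¬ IsReducible T → Nonempty (M ≃ₘ⟮𝓡 4, 𝓡 4⟯ 𝕊 4)) :
    arandaZupan_dependentTriple_genusThree_homotopySphere :=
  arandaZupan_dependentTriple_genusThree_homotopySphere_of_az2025_of_msz_of_sep_of_pi1_of_fiveChainCase
    hAZ hMSZ hsep hπ (fiveChainCase_of_separatingPair_of_pantsCase hL38 hPants)

end CaseSplit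

/-! ### The case split, indexed form over all types `(3; k)`: the not-weakly-reducible core from a
### separating-pair lemma and a pants-triple statement — and the fact from these two and Thm. 1.3
### ALONE

The same dichotomy as in section "CaseSplit", in the INDEXED vocabulary of
`hasDependentTriple_iff_exists_fun` (one compressing curve `f i ⊂ H_i` per handlebody) and for
every type `(3; k₀, k₁, k₂)`, with both inputs restricted to homotopy 4-spheres (the only
manifolds to which they are applied): `h38` — for a `(3; k)`-trisected `M ≃ₕ S⁴`, a separating
pair `a ⊂ H_i`, `b ⊂ H_j` (`i ≠ j`) of disjoint non-separating compressing curves has `a`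
compressing in `H_j` or `b` in `H_i` (Lemma 3.8 with the parallel case folded in) — and `hp` — a
`(3; k)`-trisected `M ≃ₕ S⁴` with a PANTS-TYPE triple (indexed: every pair mutually
non-separating, the union separating) that is not weakly reducible is `S⁴`.  Output: the
not-weakly-reducible core `hcore` of
`arandaZupan_dependentTriple_genusThree_homotopySphere_of_weaklyReducible_of_notWeaklyReducible`
verbatim (`notWeaklyReducibleCore_of_separatingPair_of_pantsTriple`), hence the fact from the
Thm. 1.3 fact, `h38` and `hp` ALONE (`…_of_az2025_of_separatingPair_of_pantsTriple`: neither
Meier–Schirmer–Zupan's fact nor the splitting facts are needed when the residual is taken in this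
stronger, type-free form without the irreducibility clause), and, the Thm. 1.3 fact and `h38`
granted, the EQUIVALENCE of the fact with `hp` (`…_iff_pantsTriple_of_az2025_of_separatingPair`).
These are the binder shapes in which the Summits-side crux `DependentTripleGenusThreeStandard`
(stmt-SmoothPoincare4-18000) is being split along the printed proof (its idea cards'
`SeparatingPairReducing`, `IsPantsTriple`/`PantsTripleStandard`, `NotWeaklyReducibleCore`), with
the predicates inlined.
-/

section CaseSplitIndexed

open Trisection

universe u₈

/-- **The not-weakly-reducible core from a separating-pair lemma and a pants-triple statement,
all types, indexed (PROVED glue).**  Given a dependent triple `f` (indexed form) on a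
`(3; k)`-trisected homotopy 4-sphere that is not weakly reducible: if some pair `f i ∪ f j`
separates the central surface, `h38` makes one of the two compress in the other handlebody and
`isWeaklyReducible_of_boundsDisc_two` (with the third curve `f l`, `l ≠ i, j`) contradicts
`¬ IsWeaklyReducible`; otherwise `f` is a pants-type triple and `hp` applies.
[cite: ArandaZupan2025, §7 (p. 24, configurations (1)–(3); p. 25, proof of Thm. 1.4) and Lemma 3.8 (p. 10)] -/
theorem notWeaklyReducibleCore_of_separatingPair_of_pantsTriple
    (h38 : ∀ (M : Type) [TopologicalSpace M] [T2Space M] [SecondCountableTopology M]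
      [ChartedSpace (𝔼 4) M] [IsManifold (𝓡 4) ∞ M],
      M ≃ₕ 𝕊 4 → ∀ (k : Fin 3 → ℕ) (T : Fin 3 → Set M), IsGKTrisection M 3 k T →
      ∀ i j : Fin 3, i ≠ j → ∀ a b : Set M, IsCurve T a → IsCurve T b →
      BoundsDisc T (spineHandlebody T i) a → BoundsDisc T (spineHandlebody T j) b →
      Disjoint a b → IsNonSeparating T a → IsNonSeparating T b →
      ¬ IsConnected (centralSurfaceSet T \ (a ∪ b)) →
      BoundsDisc T (spineHandlebody T j) a ∨ BoundsDisc T (spineHandlebody T i) b)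
    (hp : ∀ (M : Type) [TopologicalSpace M] [T2Space M] [SecondCountableTopology M]
      [ChartedSpace (𝔼 4) M] [IsManifold (𝓡 4) ∞ M],
      M ≃ₕ 𝕊 4 → ∀ (k : Fin 3 → ℕ) (T : Fin 3 → Set M), IsGKTrisection M 3 k T →
      ∀ f : Fin 3 → Set M,
      ((∀ i, IsCurve T (f i)) ∧ (Pairwise fun i j => Disjoint (f i) (f j)) ∧
        (∀ i, IsNonSeparating T (f i)) ∧ (∀ i, BoundsDisc T (spineHandlebody T i) (f i)) ∧
        (∀ i j, i ≠ j → IsConnected (centralSurfaceSet T \ (f i ∪ f j))) ∧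
        ¬ IsPreconnected (centralSurfaceSet T \ ⋃ i, f i)) →
      ¬ IsWeaklyReducible T → Nonempty (M ≃ₘ⟮𝓡 4, 𝓡 4⟯ 𝕊 4)) :
    ∀ (M : Type) [TopologicalSpace M] [T2Space M] [SecondCountableTopology M]
      [ChartedSpace (𝔼 4) M] [IsManifold (𝓡 4) ∞ M],
      M ≃ₕ 𝕊 4 → ∀ (k : Fin 3 → ℕ) (T : Fin 3 → Set M), IsGKTrisection M 3 k T →
        HasDependentTriple T → ¬ IsWeaklyReducible T → Nonempty (M ≃ₘ⟮𝓡 4, 𝓡 4⟯ 𝕊 4) := by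
  intro M _ _ _ _ _ e k T hT hdt hwr
  rw [hasDependentTriple_iff_exists_fun] at hdt
  obtain ⟨f, hcur, hdis, hns, hbd, hdep⟩ := hdt
  by_cases hconn : ∀ i j : Fin 3, i ≠ j → IsConnected (centralSurfaceSet T \ (f i ∪ f j))
  · -- configuration (3): a pants-type triple
    exact hp M e k T hT f ⟨hcur, hdis, hns, hbd, hconn, hdep⟩ hwr
  · -- configurations (1)–(2): some pair `f i ∪ f j` separates
    push Not at hconn
    obtain ⟨i, j, hij, hsep⟩ := hconn
    -- the third index
    have third : ∀ i j : Fin 3, i ≠ j → ∃ l : Fin 3, l ≠ i ∧ l ≠ j := by decide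
    obtain ⟨l, hli, hlj⟩ := third i j hij
    refine absurd ?_ hwr
    rcases h38 M e k T hT i j hij (f i) (f j) (hcur i) (hcur j) (hbd i) (hbd j) (hdis hij)
        (hns i) (hns j) hsep with h | h
    · -- `f i` compresses in `H_i` and `H_j`; the third curve is `f l ⊂ H_l`
      exact isWeaklyReducible_of_boundsDisc_two (p := l) (i := i) (j := j) hij hli.symm hlj.symm
        (hcur l) (hcur i) (hdis hli) (hns l) (hns i) (hbd l) (hbd i) h
    · -- `f j` compresses in `H_j` and `H_i`
      exact isWeaklyReducible_of_boundsDisc_two (p := l) (i := i) (j := j) hij hli.symm hlj.symm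
        (hcur l) (hcur j) (hdis hlj) (hns l) (hns j) (hbd l) h (hbd j)

/-- **The fact from the Thm. 1.3 fact (catalogue form, any universe), the separating-pair lemma
`h38` and the pants-triple statement `hp` ALONE (PROVED glue:
`notWeaklyReducibleCore_of_separatingPair_of_pantsTriple` fed into
`…_of_az2025_of_notWeaklyReducible`).**  No Meier–Schirmer–Zupan fact and no splitting fact is
needed on this road: the unbalanced types and the reducible weakly-reducible trisections are
inside the Thm. 1.3 fact, and `hp` is taken for every type `(3; k)` without an irreducibility
clause. [cite: ArandaZupan2025, Thm. 1.3, Thm. 1.4 (p. 2), Lemma 3.8 (p. 10) and §7 (pp. 24–26)] -/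
theorem arandaZupan_dependentTriple_genusThree_homotopySphere_of_az2025_of_separatingPair_of_pantsTriple
    (hAZ : Literature.Barriers.SmoothPoincare4.az2025_weaklyReducible_genusThree_homotopySphere_gk.{u₈})
    (h38 : ∀ (M : Type) [TopologicalSpace M] [T2Space M] [SecondCountableTopology M]
      [ChartedSpace (𝔼 4) M] [IsManifold (𝓡 4) ∞ M],
      M ≃ₕ 𝕊 4 → ∀ (k : Fin 3 → ℕ) (T : Fin 3 → Set M), IsGKTrisection M 3 k T →
      ∀ i j : Fin 3, i ≠ j → ∀ a b : Set M, IsCurve T a → IsCurve T b →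
      BoundsDisc T (spineHandlebody T i) a → BoundsDisc T (spineHandlebody T j) b →
      Disjoint a b → IsNonSeparating T a → IsNonSeparating T b →
      ¬ IsConnected (centralSurfaceSet T \ (a ∪ b)) →
      BoundsDisc T (spineHandlebody T j) a ∨ BoundsDisc T (spineHandlebody T i) b)
    (hp : ∀ (M : Type) [TopologicalSpace M] [T2Space M] [SecondCountableTopology M]
      [ChartedSpace (𝔼 4) M] [IsManifold (𝓡 4) ∞ M],
      M ≃ₕ 𝕊 4 → ∀ (k : Fin 3 → ℕ) (T : Fin 3 → Set M), IsGKTrisection M 3 k T →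
      ∀ f : Fin 3 → Set M,
      ((∀ i, IsCurve T (f i)) ∧ (Pairwise fun i j => Disjoint (f i) (f j)) ∧
        (∀ i, IsNonSeparating T (f i)) ∧ (∀ i, BoundsDisc T (spineHandlebody T i) (f i)) ∧
        (∀ i j, i ≠ j → IsConnected (centralSurfaceSet T \ (f i ∪ f j))) ∧
        ¬ IsPreconnected (centralSurfaceSet T \ ⋃ i, f i)) →
      ¬ IsWeaklyReducible T → Nonempty (M ≃ₘ⟮𝓡 4, 𝓡 4⟯ 𝕊 4)) :
    arandaZupan_dependentTriple_genusThree_homotopySphere :=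
  arandaZupan_dependentTriple_genusThree_homotopySphere_of_az2025_of_notWeaklyReducible hAZ
    (notWeaklyReducibleCore_of_separatingPair_of_pantsTriple h38 hp)

/-- The trivial converse: the fact contains the pants-triple statement `hp` (an indexed
pants-type triple is a dependent triple, `hasDependentTriple_iff_exists_fun`).
[cite: ArandaZupan2025, Thm. 1.4 (p. 2) and §7 (p. 24)] -/
theorem arandaZupan_dependentTriple_genusThree_homotopySphere.pantsTriple
    (h : arandaZupan_dependentTriple_genusThree_homotopySphere)
    (M : Type) [TopologicalSpace M] [T2Space M] [SecondCountableTopology M]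
    [ChartedSpace (𝔼 4) M] [IsManifold (𝓡 4) ∞ M] (e : M ≃ₕ 𝕊 4) (k : Fin 3 → ℕ)
    (T : Fin 3 → Set M) (hT : IsGKTrisection M 3 k T) (f : Fin 3 → Set M)
    (hf : (∀ i, IsCurve T (f i)) ∧ (Pairwise fun i j => Disjoint (f i) (f j)) ∧
      (∀ i, IsNonSeparating T (f i)) ∧ (∀ i, BoundsDisc T (spineHandlebody T i) (f i)) ∧
      (∀ i j, i ≠ j → IsConnected (centralSurfaceSet T \ (f i ∪ f j))) ∧
      ¬ IsPreconnected (centralSurfaceSet T \ ⋃ i, f i))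
    (_hwr : ¬ IsWeaklyReducible T) : Nonempty (M ≃ₘ⟮𝓡 4, 𝓡 4⟯ 𝕊 4) :=
  h M e k T hT ((hasDependentTriple_iff_exists_fun T).2
    ⟨f, hf.1, hf.2.1, hf.2.2.1, hf.2.2.2.1, hf.2.2.2.2.2⟩)

/-- **The Thm. 1.3 fact and `h38` granted, the fact is EQUIVALENT to the pants-triple statement
`hp`** (PROVED bookkeeping). [cite: ArandaZupan2025, Thm. 1.3, Thm. 1.4 (p. 2), Lemma 3.8 (p. 10) and §7 (pp. 24–26)] -/
theorem arandaZupan_dependentTriple_genusThree_homotopySphere_iff_pantsTriple_of_az2025_of_separatingPair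
    (hAZ : Literature.Barriers.SmoothPoincare4.az2025_weaklyReducible_genusThree_homotopySphere_gk.{u₈})
    (h38 : ∀ (M : Type) [TopologicalSpace M] [T2Space M] [SecondCountableTopology M]
      [ChartedSpace (𝔼 4) M] [IsManifold (𝓡 4) ∞ M],
      M ≃ₕ 𝕊 4 → ∀ (k : Fin 3 → ℕ) (T : Fin 3 → Set M), IsGKTrisection M 3 k T →
      ∀ i j : Fin 3, i ≠ j → ∀ a b : Set M, IsCurve T a → IsCurve T b →
      BoundsDisc T (spineHandlebody T i) a → BoundsDisc T (spineHandlebody T j) b →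
      Disjoint a b → IsNonSeparating T a → IsNonSeparating T b →
      ¬ IsConnected (centralSurfaceSet T \ (a ∪ b)) →
      BoundsDisc T (spineHandlebody T j) a ∨ BoundsDisc T (spineHandlebody T i) b) :
    arandaZupan_dependentTriple_genusThree_homotopySphere ↔
      ∀ (M : Type) [TopologicalSpace M] [T2Space M] [SecondCountableTopology M]
        [ChartedSpace (𝔼 4) M] [IsManifold (𝓡 4) ∞ M],
        M ≃ₕ 𝕊 4 → ∀ (k : Fin 3 → ℕ) (T : Fin 3 → Set M), IsGKTrisection M 3 k T →
        ∀ f : Fin 3 → Set M,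
        ((∀ i, IsCurve T (f i)) ∧ (Pairwise fun i j => Disjoint (f i) (f j)) ∧
          (∀ i, IsNonSeparating T (f i)) ∧ (∀ i, BoundsDisc T (spineHandlebody T i) (f i)) ∧
          (∀ i j, i ≠ j → IsConnected (centralSurfaceSet T \ (f i ∪ f j))) ∧
          ¬ IsPreconnected (centralSurfaceSet T \ ⋃ i, f i)) →
        ¬ IsWeaklyReducible T → Nonempty (M ≃ₘ⟮𝓡 4, 𝓡 4⟯ 𝕊 4) :=
  ⟨fun h M _ _ _ _ _ e k T hT f hf hwr => h.pantsTriple M e k T hT f hf hwr,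
    arandaZupan_dependentTriple_genusThree_homotopySphere_of_az2025_of_separatingPair_of_pantsTriple
      hAZ h38⟩

end CaseSplitIndexed

/-! ### The loop-surgery endgame of configuration (3): the pants-triple statement from a LOOP
### PARTNER and the tree's loop-surgery fact — [MZ17b] is not needed for the homotopy-sphere
### corollary — and where the fact stands with no reference to Thm. 1.3

The printed proof ends configuration (3) as follows (§7, pp. 25–26): "It follows from Lemma 5.4
and Proposition 5.5 that `X` is obtained by surgery on a loop `ℓ` in a manifold `X′` admitting
a `(2; k₁, k₂, k₃)` trisection, where `k₁, k₂ ≤ 1`.  By the main theorem from [MZ17b], we have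
that `X′` is `S⁴`, `S² × S²`, or a connected sum of at most two copies of `±ℂP²` and/or
`S¹ × S³` … Otherwise, `[ℓ]` is non-trivial in `π₁(X′)`, from which it follows that `X′` is
either `S¹ × S³` or `S¹ × S³ # ±ℂP²`, and thus `X` can be `S_p`, `S′_p`, `S_p # ±ℂP²`, or
`S′_p # ±ℂP²`", and Lemma 2.7 / §2 p. 7: `S₁ ≅ S′₁ ≅ S⁴`.  Lemma 5.4 (p. 19) is precise about
the type of the loop partner: five-chain surgery turns a `(g; k₁, k₂, k₃)`-trisection diagram
into a `(g − 1; k₁, k₂, k₃ + 1)`-trisection diagram, so `X′` carries a genus-`2` GK-trisection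
ONE OF WHOSE INDICES IS `≥ 1 = g′ − 1` — the Meier–Schirmer–Zupan range `∃ i, g′ ≤ k′ᵢ + 1`
(up to the permutation of `α, β, γ` made on p. 25, "these two possibilities are symmetric up to
permutation").  Hence, for a HOMOTOPY 4-SPHERE `X`, neither [MZ17b] nor Lemma 7.1 is needed:
the tree's named fact `Literature.Topology.FourManifolds.msz_loopSurgery_homotopySphere_gk`
(`LoopSurgeryHomotopySphere.lean`; Meier–Schirmer–Zupan Thm. 1.2, `χ(X_ℓ) = χ(X) + 2`,
`π₁(X_ℓ) = π₁(X)/⟨⟨[ℓ]⟩⟩`, and Pao's `S_{±1} ≅ S′_{±1} ≅ S⁴`) states exactly that a homotopy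
4-sphere which is a loop surgery `IsCircleSurgery (𝓡 4) (𝓡 4) X′ M ℓ` on a GK-trisected `X′`
in the MSZ range is `S⁴`; its side conditions on `X′` (compact, connected, orientable) are
discharged in the tree
(`Literature.Barriers.SmoothPoincare4.nonempty_diffeomorph_sphere_of_isCircleSurgery_of_mszRange`,
the theorem through which the Thm. 1.3 fact is tracked against the same loop-surgery fact).

So the pants-triple statement `hp` of section "CaseSplitIndexed" follows
(`pantsTriple_of_loopSurgery_of_loopPartner`, per type `…_type`) from the loop-surgery fact
and the **loop-partner step** `hP` of the printed proof, in tree vocabulary: *a `(3; k)`-trisected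
`M ≃ₕ S⁴` with a pants-type triple (indexed: `f i` a non-separating curve compressing in `H_i`,
the three pairwise disjoint, every pair mutually non-separating, the union separating) that is
not weakly reducible is a circle surgery on a smoothly embedded loop of some smooth `X′ : Type`
carrying a genus-`2` GK-trisection in the MSZ range* — §7 case (3) up to "It follows from
Lemma 5.4 and Proposition 5.5": Lemma 3.7 twice, handle slides, the five-chain
`{γ₁, β₂, α₁, γ₂*, β₁}` of Fig. 19, Lemma 5.4, Prop. 5.5.  That step is the part of the paper
specific to Thm. 1.4, has no counterpart in the tree and is NOT vendored (D-0026); it is the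
common coarsening of the two decompositions sketched for the Summits-side crux
`DependentTripleGenusThreeStandard` (cap-sphere surgery on a doubly primitive cuff; five-chain
hub), both of which also end in `msz_loopSurgery_homotopySphere_gk`.  Assemblies: the
not-weakly-reducible core from `h38`, the loop-surgery fact and `hP`
(`notWeaklyReducibleCore_of_separatingPair_of_loopSurgery_of_loopPartner`, per type `…_type`);
the fact from the Thm. 1.3 fact, `h38`, the loop-surgery fact and `hP`
(`…_of_az2025_of_separatingPair_of_loopSurgery_of_loopPartner`), also with `h38` and `hP` for
balanced `(3; 1,1,1)` homotopy spheres only, GIVEN `msz_homotopySphere_gk`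
(`…_of_az2025_of_msz_of_separatingPair_of_loopSurgery_of_loopPartner_balanced`: Aranda–Zupan's
standing assumption `kᵢ ≤ 1`, §2 p. 6, through `…_of_facts_of_notWeaklyReducible`); and,
substituting for the Thm. 1.3 fact its own standing reduction
`Literature.Barriers.SmoothPoincare4.az2025_weaklyReducible_genusThree_homotopySphere_gk_of_msz_zero_of_sep_of_pi1_of_loopSurgery_of_fiveChainSurgery`,
**where the fact stands with no reference to Thm. 1.3**
(`…_of_msz_zero_of_sep_of_pi1_of_loopSurgery_of_fiveChainSurgery_of_separatingPair_of_loopPartner`):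
it follows from three tracked named facts — `msz_homotopySphere_gk.{0}`,
`Trisection.isConnectedSum_of_reducing_separating.{0}`, `msz_loopSurgery_homotopySphere_gk` —
the `π₁`-shadow `hπ` of the non-separating reducible case, and three Aranda–Zupan-specific
inline steps: the five-chain surgery step `h5` for weak reductions (Thm. 1.3 first part +
Lemma 5.4 + Prop. 5.5, verbatim the hypothesis of the Thm. 1.3 fact's reduction), the
separating-pair lemma `h38` (Lemma 3.8 + the parallel case) and the loop-partner step `hP`.
-/

section LoopSurgeryEndgame

open Trisection

universe u₉ u₁₀

/-- **The pants-triple statement for one type `(3; k)` from the loop-surgery fact and the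
loop-partner step (PROVED glue).**  GIVEN `msz_loopSurgery_homotopySphere_gk` and the
loop-partner step `hP` at type `k`, a `(3; k)`-trisected `M ≃ₕ S⁴` with a pants-type triple
that is not weakly reducible is `S⁴`: `hP` presents `M` as a circle surgery on a genus-`2`
GK-trisected `X′` in the MSZ range, and
`Literature.Barriers.SmoothPoincare4.nonempty_diffeomorph_sphere_of_isCircleSurgery_of_mszRange`
(the loop-surgery fact with the compactness, connectedness and orientability of `X′`
discharged) concludes.
[cite: ArandaZupan2025, §7 (pp. 25–26), Lemma 5.4 and Prop. 5.5 (pp. 19–20), §2 p. 7] [cite: MeierSchirmerZupan2016, Thm. 1.2] -/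
theorem pantsTriple_of_loopSurgery_of_loopPartner_type
    (hL : msz_loopSurgery_homotopySphere_gk) (k : Fin 3 → ℕ)
    (hP : ∀ (M : Type) [TopologicalSpace M] [T2Space M] [SecondCountableTopology M]
      [ChartedSpace (𝔼 4) M] [IsManifold (𝓡 4) ∞ M],
      M ≃ₕ 𝕊 4 → ∀ T : Fin 3 → Set M, IsGKTrisection M 3 k T →
      ∀ f : Fin 3 → Set M,
      ((∀ i, IsCurve T (f i)) ∧ (Pairwise fun i j => Disjoint (f i) (f j)) ∧
        (∀ i, IsNonSeparating T (f i)) ∧ (∀ i, BoundsDisc T (spineHandlebody T i) (f i)) ∧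
        (∀ i j, i ≠ j → IsConnected (centralSurfaceSet T \ (f i ∪ f j))) ∧
        ¬ IsPreconnected (centralSurfaceSet T \ ⋃ i, f i)) →
      ¬ IsWeaklyReducible T →
      ∃ (X' : Type) (_ : TopologicalSpace X') (_ : T2Space X') (_ : SecondCountableTopology X')
        (_ : ChartedSpace (𝔼 4) X') (_ : IsManifold (𝓡 4) ∞ X')
        (k' : Fin 3 → ℕ) (T' : Fin 3 → Set X')
        (ℓ : Metric.sphere (0 : EuclideanSpace ℝ (Fin 2)) 1 → X'),
        IsGKTrisection X' 2 k' T' ∧ (∃ i, 2 ≤ k' i + 1) ∧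
          Manifold.IsSmoothEmbedding (𝓡 1) (𝓡 4) ∞ ℓ ∧ IsCircleSurgery (𝓡 4) (𝓡 4) X' M ℓ)
    (M : Type) [TopologicalSpace M] [T2Space M] [SecondCountableTopology M]
    [ChartedSpace (𝔼 4) M] [IsManifold (𝓡 4) ∞ M] (e : M ≃ₕ 𝕊 4) (T : Fin 3 → Set M)
    (hT : IsGKTrisection M 3 k T) (f : Fin 3 → Set M)
    (hf : (∀ i, IsCurve T (f i)) ∧ (Pairwise fun i j => Disjoint (f i) (f j)) ∧
      (∀ i, IsNonSeparating T (f i)) ∧ (∀ i, BoundsDisc T (spineHandlebody T i) (f i)) ∧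
      (∀ i j, i ≠ j → IsConnected (centralSurfaceSet T \ (f i ∪ f j))) ∧
      ¬ IsPreconnected (centralSurfaceSet T \ ⋃ i, f i))
    (hwr : ¬ IsWeaklyReducible T) : Nonempty (M ≃ₘ⟮𝓡 4, 𝓡 4⟯ 𝕊 4) := by
  obtain ⟨X', _, _, _, _, _, k', T', ℓ, hT', hk', hℓ, hs⟩ := hP M e T hT f hf hwr
  exact Literature.Barriers.SmoothPoincare4.nonempty_diffeomorph_sphere_of_isCircleSurgery_of_mszRange
    hL hT' hk' hℓ hs e

/-- **The pants-triple statement `hp` (all types) from the loop-surgery fact and the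
loop-partner step `hP` (all types)** — PROVED glue, `pantsTriple_of_loopSurgery_of_loopPartner_type`
at each `k`.  Output: verbatim the hypothesis `hp` of
`notWeaklyReducibleCore_of_separatingPair_of_pantsTriple`.
[cite: ArandaZupan2025, §7 (pp. 25–26), Lemma 5.4 and Prop. 5.5 (pp. 19–20), §2 p. 7] [cite: MeierSchirmerZupan2016, Thm. 1.2] -/
theorem pantsTriple_of_loopSurgery_of_loopPartner
    (hL : msz_loopSurgery_homotopySphere_gk)
    (hP : ∀ (M : Type) [TopologicalSpace M] [T2Space M] [SecondCountableTopology M]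
      [ChartedSpace (𝔼 4) M] [IsManifold (𝓡 4) ∞ M],
      M ≃ₕ 𝕊 4 → ∀ (k : Fin 3 → ℕ) (T : Fin 3 → Set M), IsGKTrisection M 3 k T →
      ∀ f : Fin 3 → Set M,
      ((∀ i, IsCurve T (f i)) ∧ (Pairwise fun i j => Disjoint (f i) (f j)) ∧
        (∀ i, IsNonSeparating T (f i)) ∧ (∀ i, BoundsDisc T (spineHandlebody T i) (f i)) ∧
        (∀ i j, i ≠ j → IsConnected (centralSurfaceSet T \ (f i ∪ f j))) ∧
        ¬ IsPreconnected (centralSurfaceSet T \ ⋃ i, f i)) →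
      ¬ IsWeaklyReducible T →
      ∃ (X' : Type) (_ : TopologicalSpace X') (_ : T2Space X') (_ : SecondCountableTopology X')
        (_ : ChartedSpace (𝔼 4) X') (_ : IsManifold (𝓡 4) ∞ X')
        (k' : Fin 3 → ℕ) (T' : Fin 3 → Set X')
        (ℓ : Metric.sphere (0 : EuclideanSpace ℝ (Fin 2)) 1 → X'),
        IsGKTrisection X' 2 k' T' ∧ (∃ i, 2 ≤ k' i + 1) ∧
          Manifold.IsSmoothEmbedding (𝓡 1) (𝓡 4) ∞ ℓ ∧ IsCircleSurgery (𝓡 4) (𝓡 4) X' M ℓ) :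
    ∀ (M : Type) [TopologicalSpace M] [T2Space M] [SecondCountableTopology M]
      [ChartedSpace (𝔼 4) M] [IsManifold (𝓡 4) ∞ M],
      M ≃ₕ 𝕊 4 → ∀ (k : Fin 3 → ℕ) (T : Fin 3 → Set M), IsGKTrisection M 3 k T →
      ∀ f : Fin 3 → Set M,
      ((∀ i, IsCurve T (f i)) ∧ (Pairwise fun i j => Disjoint (f i) (f j)) ∧
        (∀ i, IsNonSeparating T (f i)) ∧ (∀ i, BoundsDisc T (spineHandlebody T i) (f i)) ∧
        (∀ i j, i ≠ j → IsConnected (centralSurfaceSet T \ (f i ∪ f j))) ∧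
        ¬ IsPreconnected (centralSurfaceSet T \ ⋃ i, f i)) →
      ¬ IsWeaklyReducible T → Nonempty (M ≃ₘ⟮𝓡 4, 𝓡 4⟯ 𝕊 4) :=
  fun M _ _ _ _ _ e k T hT f hf hwr =>
    pantsTriple_of_loopSurgery_of_loopPartner_type hL k (fun M _ _ _ _ _ e T => hP M e k T)
      M e T hT f hf hwr

/-- **The not-weakly-reducible core for one type `(3; k)` from the separating-pair lemma and
the pants-triple statement at that type (PROVED glue)** — the proof of
`notWeaklyReducibleCore_of_separatingPair_of_pantsTriple` never changes the type, so it runs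
type by type: a separating pair of the triple is disposed of by `h38` and
`isWeaklyReducible_of_boundsDisc_two` (configurations (1)–(2) of p. 24), otherwise the triple
is of pants type and `hp` applies (configuration (3)).
[cite: ArandaZupan2025, §7 (p. 24, configurations (1)–(3); p. 25, proof of Thm. 1.4) and Lemma 3.8 (p. 10)] -/
theorem notWeaklyReducibleCore_of_separatingPair_of_pantsTriple_type (k : Fin 3 → ℕ)
    (h38 : ∀ (M : Type) [TopologicalSpace M] [T2Space M] [SecondCountableTopology M]
      [ChartedSpace (𝔼 4) M] [IsManifold (𝓡 4) ∞ M],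
      M ≃ₕ 𝕊 4 → ∀ T : Fin 3 → Set M, IsGKTrisection M 3 k T →
      ∀ i j : Fin 3, i ≠ j → ∀ a b : Set M, IsCurve T a → IsCurve T b →
      BoundsDisc T (spineHandlebody T i) a → BoundsDisc T (spineHandlebody T j) b →
      Disjoint a b → IsNonSeparating T a → IsNonSeparating T b →
      ¬ IsConnected (centralSurfaceSet T \ (a ∪ b)) →
      BoundsDisc T (spineHandlebody T j) a ∨ BoundsDisc T (spineHandlebody T i) b)
    (hp : ∀ (M : Type) [TopologicalSpace M] [T2Space M] [SecondCountableTopology M]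
      [ChartedSpace (𝔼 4) M] [IsManifold (𝓡 4) ∞ M],
      M ≃ₕ 𝕊 4 → ∀ T : Fin 3 → Set M, IsGKTrisection M 3 k T →
      ∀ f : Fin 3 → Set M,
      ((∀ i, IsCurve T (f i)) ∧ (Pairwise fun i j => Disjoint (f i) (f j)) ∧
        (∀ i, IsNonSeparating T (f i)) ∧ (∀ i, BoundsDisc T (spineHandlebody T i) (f i)) ∧
        (∀ i j, i ≠ j → IsConnected (centralSurfaceSet T \ (f i ∪ f j))) ∧
        ¬ IsPreconnected (centralSurfaceSet T \ ⋃ i, f i)) →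
      ¬ IsWeaklyReducible T → Nonempty (M ≃ₘ⟮𝓡 4, 𝓡 4⟯ 𝕊 4)) :
    ∀ (M : Type) [TopologicalSpace M] [T2Space M] [SecondCountableTopology M]
      [ChartedSpace (𝔼 4) M] [IsManifold (𝓡 4) ∞ M],
      M ≃ₕ 𝕊 4 → ∀ T : Fin 3 → Set M, IsGKTrisection M 3 k T →
        HasDependentTriple T → ¬ IsWeaklyReducible T → Nonempty (M ≃ₘ⟮𝓡 4, 𝓡 4⟯ 𝕊 4) := by
  intro M _ _ _ _ _ e T hT hdt hwr
  rw [hasDependentTriple_iff_exists_fun] at hdt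
  obtain ⟨f, hcur, hdis, hns, hbd, hdep⟩ := hdt
  by_cases hconn : ∀ i j : Fin 3, i ≠ j → IsConnected (centralSurfaceSet T \ (f i ∪ f j))
  · -- configuration (3): a pants-type triple
    exact hp M e T hT f ⟨hcur, hdis, hns, hbd, hconn, hdep⟩ hwr
  · -- configurations (1)–(2): some pair `f i ∪ f j` separates
    push Not at hconn
    obtain ⟨i, j, hij, hsep⟩ := hconn
    have third : ∀ i j : Fin 3, i ≠ j → ∃ l : Fin 3, l ≠ i ∧ l ≠ j := by decide
    obtain ⟨l, hli, hlj⟩ := third i j hij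
    refine absurd ?_ hwr
    rcases h38 M e T hT i j hij (f i) (f j) (hcur i) (hcur j) (hbd i) (hbd j) (hdis hij)
        (hns i) (hns j) hsep with h | h
    · exact isWeaklyReducible_of_boundsDisc_two (p := l) (i := i) (j := j) hij hli.symm hlj.symm
        (hcur l) (hcur i) (hdis hli) (hns l) (hns i) (hbd l) (hbd i) h
    · exact isWeaklyReducible_of_boundsDisc_two (p := l) (i := i) (j := j) hij hli.symm hlj.symm
        (hcur l) (hcur j) (hdis hlj) (hns l) (hns j) (hbd l) h (hbd j)

/-- **The not-weakly-reducible core for one type `(3; k)` from the separating-pair lemma, the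
loop-surgery fact and the loop-partner step at that type** (PROVED glue:
`notWeaklyReducibleCore_of_separatingPair_of_pantsTriple_type` fed with
`pantsTriple_of_loopSurgery_of_loopPartner_type`).
[cite: ArandaZupan2025, §7 (pp. 24–26), Lemma 3.8 (p. 10), Lemma 5.4 and Prop. 5.5 (pp. 19–20)] [cite: MeierSchirmerZupan2016, Thm. 1.2] -/
theorem notWeaklyReducibleCore_of_separatingPair_of_loopSurgery_of_loopPartner_type
    (k : Fin 3 → ℕ)
    (h38 : ∀ (M : Type) [TopologicalSpace M] [T2Space M] [SecondCountableTopology M]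
      [ChartedSpace (𝔼 4) M] [IsManifold (𝓡 4) ∞ M],
      M ≃ₕ 𝕊 4 → ∀ T : Fin 3 → Set M, IsGKTrisection M 3 k T →
      ∀ i j : Fin 3, i ≠ j → ∀ a b : Set M, IsCurve T a → IsCurve T b →
      BoundsDisc T (spineHandlebody T i) a → BoundsDisc T (spineHandlebody T j) b →
      Disjoint a b → IsNonSeparating T a → IsNonSeparating T b →
      ¬ IsConnected (centralSurfaceSet T \ (a ∪ b)) →
      BoundsDisc T (spineHandlebody T j) a ∨ BoundsDisc T (spineHandlebody T i) b)
    (hL : msz_loopSurgery_homotopySphere_gk)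
    (hP : ∀ (M : Type) [TopologicalSpace M] [T2Space M] [SecondCountableTopology M]
      [ChartedSpace (𝔼 4) M] [IsManifold (𝓡 4) ∞ M],
      M ≃ₕ 𝕊 4 → ∀ T : Fin 3 → Set M, IsGKTrisection M 3 k T →
      ∀ f : Fin 3 → Set M,
      ((∀ i, IsCurve T (f i)) ∧ (Pairwise fun i j => Disjoint (f i) (f j)) ∧
        (∀ i, IsNonSeparating T (f i)) ∧ (∀ i, BoundsDisc T (spineHandlebody T i) (f i)) ∧
        (∀ i j, i ≠ j → IsConnected (centralSurfaceSet T \ (f i ∪ f j))) ∧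
        ¬ IsPreconnected (centralSurfaceSet T \ ⋃ i, f i)) →
      ¬ IsWeaklyReducible T →
      ∃ (X' : Type) (_ : TopologicalSpace X') (_ : T2Space X') (_ : SecondCountableTopology X')
        (_ : ChartedSpace (𝔼 4) X') (_ : IsManifold (𝓡 4) ∞ X')
        (k' : Fin 3 → ℕ) (T' : Fin 3 → Set X')
        (ℓ : Metric.sphere (0 : EuclideanSpace ℝ (Fin 2)) 1 → X'),
        IsGKTrisection X' 2 k' T' ∧ (∃ i, 2 ≤ k' i + 1) ∧
          Manifold.IsSmoothEmbedding (𝓡 1) (𝓡 4) ∞ ℓ ∧ IsCircleSurgery (𝓡 4) (𝓡 4) X' M ℓ) :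
    ∀ (M : Type) [TopologicalSpace M] [T2Space M] [SecondCountableTopology M]
      [ChartedSpace (𝔼 4) M] [IsManifold (𝓡 4) ∞ M],
      M ≃ₕ 𝕊 4 → ∀ T : Fin 3 → Set M, IsGKTrisection M 3 k T →
        HasDependentTriple T → ¬ IsWeaklyReducible T → Nonempty (M ≃ₘ⟮𝓡 4, 𝓡 4⟯ 𝕊 4) :=
  notWeaklyReducibleCore_of_separatingPair_of_pantsTriple_type k h38
    (pantsTriple_of_loopSurgery_of_loopPartner_type hL k hP)

/-- **The not-weakly-reducible core (all types) from the separating-pair lemma `h38`, the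
loop-surgery fact and the loop-partner step `hP`** (PROVED glue:
`notWeaklyReducibleCore_of_separatingPair_of_pantsTriple` fed with
`pantsTriple_of_loopSurgery_of_loopPartner`).  Output: verbatim the hypothesis `hcore` of
`arandaZupan_dependentTriple_genusThree_homotopySphere_of_weaklyReducible_of_notWeaklyReducible`
(and the Summits-side `NotWeaklyReducibleCore`).
[cite: ArandaZupan2025, §7 (pp. 24–26), Lemma 3.8 (p. 10), Lemma 5.4 and Prop. 5.5 (pp. 19–20)] [cite: MeierSchirmerZupan2016, Thm. 1.2] -/
theorem notWeaklyReducibleCore_of_separatingPair_of_loopSurgery_of_loopPartner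
    (h38 : ∀ (M : Type) [TopologicalSpace M] [T2Space M] [SecondCountableTopology M]
      [ChartedSpace (𝔼 4) M] [IsManifold (𝓡 4) ∞ M],
      M ≃ₕ 𝕊 4 → ∀ (k : Fin 3 → ℕ) (T : Fin 3 → Set M), IsGKTrisection M 3 k T →
      ∀ i j : Fin 3, i ≠ j → ∀ a b : Set M, IsCurve T a → IsCurve T b →
      BoundsDisc T (spineHandlebody T i) a → BoundsDisc T (spineHandlebody T j) b →
      Disjoint a b → IsNonSeparating T a → IsNonSeparating T b →
      ¬ IsConnected (centralSurfaceSet T \ (a ∪ b)) →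
      BoundsDisc T (spineHandlebody T j) a ∨ BoundsDisc T (spineHandlebody T i) b)
    (hL : msz_loopSurgery_homotopySphere_gk)
    (hP : ∀ (M : Type) [TopologicalSpace M] [T2Space M] [SecondCountableTopology M]
      [ChartedSpace (𝔼 4) M] [IsManifold (𝓡 4) ∞ M],
      M ≃ₕ 𝕊 4 → ∀ (k : Fin 3 → ℕ) (T : Fin 3 → Set M), IsGKTrisection M 3 k T →
      ∀ f : Fin 3 → Set M,
      ((∀ i, IsCurve T (f i)) ∧ (Pairwise fun i j => Disjoint (f i) (f j)) ∧
        (∀ i, IsNonSeparating T (f i)) ∧ (∀ i, BoundsDisc T (spineHandlebody T i) (f i)) ∧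
        (∀ i j, i ≠ j → IsConnected (centralSurfaceSet T \ (f i ∪ f j))) ∧
        ¬ IsPreconnected (centralSurfaceSet T \ ⋃ i, f i)) →
      ¬ IsWeaklyReducible T →
      ∃ (X' : Type) (_ : TopologicalSpace X') (_ : T2Space X') (_ : SecondCountableTopology X')
        (_ : ChartedSpace (𝔼 4) X') (_ : IsManifold (𝓡 4) ∞ X')
        (k' : Fin 3 → ℕ) (T' : Fin 3 → Set X')
        (ℓ : Metric.sphere (0 : EuclideanSpace ℝ (Fin 2)) 1 → X'),
        IsGKTrisection X' 2 k' T' ∧ (∃ i, 2 ≤ k' i + 1) ∧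
          Manifold.IsSmoothEmbedding (𝓡 1) (𝓡 4) ∞ ℓ ∧ IsCircleSurgery (𝓡 4) (𝓡 4) X' M ℓ) :
    ∀ (M : Type) [TopologicalSpace M] [T2Space M] [SecondCountableTopology M]
      [ChartedSpace (𝔼 4) M] [IsManifold (𝓡 4) ∞ M],
      M ≃ₕ 𝕊 4 → ∀ (k : Fin 3 → ℕ) (T : Fin 3 → Set M), IsGKTrisection M 3 k T →
        HasDependentTriple T → ¬ IsWeaklyReducible T → Nonempty (M ≃ₘ⟮𝓡 4, 𝓡 4⟯ 𝕊 4) :=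
  notWeaklyReducibleCore_of_separatingPair_of_pantsTriple h38
    (pantsTriple_of_loopSurgery_of_loopPartner hL hP)

/-- **The fact from the Thm. 1.3 fact (catalogue form, any universe), the separating-pair lemma
`h38`, the loop-surgery fact and the loop-partner step `hP`** (PROVED glue:
`…_of_az2025_of_notWeaklyReducible` fed with
`notWeaklyReducibleCore_of_separatingPair_of_loopSurgery_of_loopPartner`).  Compared with
`…_of_az2025_of_separatingPair_of_pantsTriple`, the pants-triple statement `hp` is now split
into its Aranda–Zupan-specific part `hP` (§7 case (3) up to Prop. 5.5) and the tree's
loop-surgery fact (the [MZ17b]/Pao endgame, here Meier–Schirmer–Zupan + Pao).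
[cite: ArandaZupan2025, Thm. 1.3, Thm. 1.4 (p. 2), Lemma 3.8 (p. 10), Lemma 5.4, Prop. 5.5 (pp. 19–20) and §7 (pp. 24–26)] [cite: MeierSchirmerZupan2016, Thm. 1.2] -/
theorem arandaZupan_dependentTriple_genusThree_homotopySphere_of_az2025_of_separatingPair_of_loopSurgery_of_loopPartner
    (hAZ : Literature.Barriers.SmoothPoincare4.az2025_weaklyReducible_genusThree_homotopySphere_gk.{u₉})
    (h38 : ∀ (M : Type) [TopologicalSpace M] [T2Space M] [SecondCountableTopology M]
      [ChartedSpace (𝔼 4) M] [IsManifold (𝓡 4) ∞ M],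
      M ≃ₕ 𝕊 4 → ∀ (k : Fin 3 → ℕ) (T : Fin 3 → Set M), IsGKTrisection M 3 k T →
      ∀ i j : Fin 3, i ≠ j → ∀ a b : Set M, IsCurve T a → IsCurve T b →
      BoundsDisc T (spineHandlebody T i) a → BoundsDisc T (spineHandlebody T j) b →
      Disjoint a b → IsNonSeparating T a → IsNonSeparating T b →
      ¬ IsConnected (centralSurfaceSet T \ (a ∪ b)) →
      BoundsDisc T (spineHandlebody T j) a ∨ BoundsDisc T (spineHandlebody T i) b)
    (hL : msz_loopSurgery_homotopySphere_gk)
    (hP : ∀ (M : Type) [TopologicalSpace M] [T2Space M] [SecondCountableTopology M]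
      [ChartedSpace (𝔼 4) M] [IsManifold (𝓡 4) ∞ M],
      M ≃ₕ 𝕊 4 → ∀ (k : Fin 3 → ℕ) (T : Fin 3 → Set M), IsGKTrisection M 3 k T →
      ∀ f : Fin 3 → Set M,
      ((∀ i, IsCurve T (f i)) ∧ (Pairwise fun i j => Disjoint (f i) (f j)) ∧
        (∀ i, IsNonSeparating T (f i)) ∧ (∀ i, BoundsDisc T (spineHandlebody T i) (f i)) ∧
        (∀ i j, i ≠ j → IsConnected (centralSurfaceSet T \ (f i ∪ f j))) ∧
        ¬ IsPreconnected (centralSurfaceSet T \ ⋃ i, f i)) →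
      ¬ IsWeaklyReducible T →
      ∃ (X' : Type) (_ : TopologicalSpace X') (_ : T2Space X') (_ : SecondCountableTopology X')
        (_ : ChartedSpace (𝔼 4) X') (_ : IsManifold (𝓡 4) ∞ X')
        (k' : Fin 3 → ℕ) (T' : Fin 3 → Set X')
        (ℓ : Metric.sphere (0 : EuclideanSpace ℝ (Fin 2)) 1 → X'),
        IsGKTrisection X' 2 k' T' ∧ (∃ i, 2 ≤ k' i + 1) ∧
          Manifold.IsSmoothEmbedding (𝓡 1) (𝓡 4) ∞ ℓ ∧ IsCircleSurgery (𝓡 4) (𝓡 4) X' M ℓ) :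
    arandaZupan_dependentTriple_genusThree_homotopySphere :=
  arandaZupan_dependentTriple_genusThree_homotopySphere_of_az2025_of_notWeaklyReducible hAZ
    (notWeaklyReducibleCore_of_separatingPair_of_loopSurgery_of_loopPartner h38 hL hP)

/-- **Balanced form (PROVED glue): the fact from the Thm. 1.3 fact and `msz_homotopySphere_gk`
(catalogue forms, any universes), the loop-surgery fact, and the separating-pair lemma `h38`
and the loop-partner step `hP` for BALANCED `(3; 1,1,1)` homotopy spheres only** — Aranda–Zupan's
standing assumption `kᵢ ≤ 1` (§2 p. 6, after Prop. 2.6 = [MSZ16]), which for a homotopy sphere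
means `k = (1,1,1)` (`…_of_msz_of_balanced`): `…_of_facts_of_notWeaklyReducible` fed with
`notWeaklyReducibleCore_of_separatingPair_of_loopSurgery_of_loopPartner_type` at `k = (1,1,1)`.
[cite: ArandaZupan2025, Thm. 1.3, Thm. 1.4 (p. 2), §2 (p. 6), Lemma 3.8 (p. 10), Lemma 5.4, Prop. 5.5 (pp. 19–20) and §7 (pp. 24–26)] [cite: MeierSchirmerZupan2016, Thm. 1.2] -/
theorem arandaZupan_dependentTriple_genusThree_homotopySphere_of_az2025_of_msz_of_separatingPair_of_loopSurgery_of_loopPartner_balanced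
    (hAZ : Literature.Barriers.SmoothPoincare4.az2025_weaklyReducible_genusThree_homotopySphere_gk.{u₉})
    (hMSZ : Literature.Barriers.SmoothPoincare4.msz_homotopySphere_gk.{u₁₀})
    (h38 : ∀ (M : Type) [TopologicalSpace M] [T2Space M] [SecondCountableTopology M]
      [ChartedSpace (𝔼 4) M] [IsManifold (𝓡 4) ∞ M],
      M ≃ₕ 𝕊 4 → ∀ T : Fin 3 → Set M, IsGKTrisection M 3 (fun _ => 1) T →
      ∀ i j : Fin 3, i ≠ j → ∀ a b : Set M, IsCurve T a → IsCurve T b →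
      BoundsDisc T (spineHandlebody T i) a → BoundsDisc T (spineHandlebody T j) b →
      Disjoint a b → IsNonSeparating T a → IsNonSeparating T b →
      ¬ IsConnected (centralSurfaceSet T \ (a ∪ b)) →
      BoundsDisc T (spineHandlebody T j) a ∨ BoundsDisc T (spineHandlebody T i) b)
    (hL : msz_loopSurgery_homotopySphere_gk)
    (hP : ∀ (M : Type) [TopologicalSpace M] [T2Space M] [SecondCountableTopology M]
      [ChartedSpace (𝔼 4) M] [IsManifold (𝓡 4) ∞ M],
      M ≃ₕ 𝕊 4 → ∀ T : Fin 3 → Set M, IsGKTrisection M 3 (fun _ => 1) T →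
      ∀ f : Fin 3 → Set M,
      ((∀ i, IsCurve T (f i)) ∧ (Pairwise fun i j => Disjoint (f i) (f j)) ∧
        (∀ i, IsNonSeparating T (f i)) ∧ (∀ i, BoundsDisc T (spineHandlebody T i) (f i)) ∧
        (∀ i j, i ≠ j → IsConnected (centralSurfaceSet T \ (f i ∪ f j))) ∧
        ¬ IsPreconnected (centralSurfaceSet T \ ⋃ i, f i)) →
      ¬ IsWeaklyReducible T →
      ∃ (X' : Type) (_ : TopologicalSpace X') (_ : T2Space X') (_ : SecondCountableTopology X')
        (_ : ChartedSpace (𝔼 4) X') (_ : IsManifold (𝓡 4) ∞ X')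
        (k' : Fin 3 → ℕ) (T' : Fin 3 → Set X')
        (ℓ : Metric.sphere (0 : EuclideanSpace ℝ (Fin 2)) 1 → X'),
        IsGKTrisection X' 2 k' T' ∧ (∃ i, 2 ≤ k' i + 1) ∧
          Manifold.IsSmoothEmbedding (𝓡 1) (𝓡 4) ∞ ℓ ∧ IsCircleSurgery (𝓡 4) (𝓡 4) X' M ℓ) :
    arandaZupan_dependentTriple_genusThree_homotopySphere :=
  arandaZupan_dependentTriple_genusThree_homotopySphere_of_facts_of_notWeaklyReducible
    (Literature.Barriers.SmoothPoincare4.az2025_weaklyReducible_genusThree_homotopySphere_gk_iff_routeShape_univ.mp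
      hAZ)
    (Literature.Barriers.SmoothPoincare4.msz_homotopySphere_gk_of_univ hMSZ)
    (notWeaklyReducibleCore_of_separatingPair_of_loopSurgery_of_loopPartner_type (fun _ => 1)
      h38 hL hP)

/-- **Where the fact stands with NO reference to Thm. 1.3 (PROVED glue).**  The fact follows
from three tracked named facts of the tree — Meier–Schirmer–Zupan's homotopy-sphere fact
`msz_homotopySphere_gk.{0}`, the separating splitting fact
`Trisection.isConnectedSum_of_reducing_separating.{0}` and the loop-surgery fact
`msz_loopSurgery_homotopySphere_gk` — the `π₁`-shadow `hπ` of the non-separating reducible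
case ("a closed connected oriented GK-trisected 4-manifold with a non-separating reducing
curve is not simply connected", universe `0`), and THREE Aranda–Zupan-specific steps, inline
(none has a counterpart in the tree; none is vendored, D-0026): the FIVE-CHAIN SURGERY STEP
`h5` for weak reductions (Thm. 1.3 first part "either `𝒯` is reducible or `𝒯` contains a
five-chain" + Lemma 5.4 + Prop. 5.5 — verbatim the hypothesis of
`Literature.Barriers.SmoothPoincare4.az2025_weaklyReducible_genusThree_homotopySphere_gk_of_msz_zero_of_sep_of_pi1_of_loopSurgery_of_fiveChainSurgery`,
which supplies the Thm. 1.3 fact), the SEPARATING-PAIR LEMMA `h38` (Lemma 3.8 + the parallel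
case, configurations (1)–(2) of §7) and the LOOP-PARTNER STEP `hP` (configuration (3) of §7 up
to Prop. 5.5), the last two for balanced `(3; 1,1,1)` homotopy spheres.  Proof:
`…_of_az2025_of_msz_of_separatingPair_of_loopSurgery_of_loopPartner_balanced` over the Thm. 1.3
fact so obtained.
[cite: ArandaZupan2025, Thm. 1.3, Thm. 1.4 (p. 2), §2 (p. 6), Lemma 3.8 (p. 10), Lemma 5.4, Prop. 5.5 (pp. 19–20), §6 (pp. 20–24) and §7 (pp. 24–26)] [cite: MeierSchirmerZupan2016, Thm. 1.2] -/
theorem arandaZupan_dependentTriple_genusThree_homotopySphere_of_msz_zero_of_sep_of_pi1_of_loopSurgery_of_fiveChainSurgery_of_separatingPair_of_loopPartner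
    (hMSZ₀ : Literature.Barriers.SmoothPoincare4.msz_homotopySphere_gk.{0})
    (hsep₀ : isConnectedSum_of_reducing_separating.{0})
    (hπ : ∀ (X : Type) [TopologicalSpace X] [T2Space X] [SecondCountableTopology X]
      [ChartedSpace (𝔼 4) X] [IsManifold (𝓡 4) ∞ X] [CompactSpace X] [ConnectedSpace X]
      (_ : SmoothOrientation (𝓡 4) X) (g : ℕ) (k : Fin 3 → ℕ) (S : Fin 3 → Set X) (δ : Set X),
      IsGKTrisection X g k S → IsCurve S δ →
      (¬ ∃ d : 𝔻 2 → X, Manifold.IsSmoothEmbedding (𝓡∂ 2) (𝓡 4) ∞ d ∧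
          range d ⊆ centralSurfaceSet S ∧ d '' (𝓡∂ 2).boundary (𝔻 2) = δ) →
      (∀ q : Fin 3, BoundsDisc S (spineHandlebody S q) δ) → IsNonSeparating S δ →
      ¬ SimplyConnectedSpace X)
    (hL : msz_loopSurgery_homotopySphere_gk)
    (h5 : ∀ (X : Type) [TopologicalSpace X] [T2Space X] [SecondCountableTopology X]
      [ChartedSpace (𝔼 4) X] [IsManifold (𝓡 4) ∞ X] [CompactSpace X]
      [ConnectedSpace X] (_ : SmoothOrientation (𝓡 4) X) (S : Fin 3 → Set X),
      IsBalancedGKTrisection X 3 1 S →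
      (∃ c c' : Set X, IsCurve S c ∧ IsCurve S c' ∧ Disjoint c c' ∧
        IsNonSeparating S c ∧ IsNonSeparating S c' ∧
        BoundsDisc S (spineHandlebody S 0) c ∧ BoundsDisc S (spineHandlebody S 1) c' ∧
        BoundsDisc S (spineHandlebody S 2) c') →
      ¬ IsReducible S →
      ∃ (X' : Type) (_ : TopologicalSpace X') (_ : T2Space X') (_ : SecondCountableTopology X')
        (_ : ChartedSpace (𝔼 4) X') (_ : IsManifold (𝓡 4) ∞ X')
        (k' : Fin 3 → ℕ) (S' : Fin 3 → Set X')
        (ℓ : Metric.sphere (0 : EuclideanSpace ℝ (Fin 2)) 1 → X'),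
        IsGKTrisection X' 2 k' S' ∧ (∃ i, 2 ≤ k' i + 1) ∧
          Manifold.IsSmoothEmbedding (𝓡 1) (𝓡 4) ∞ ℓ ∧ IsCircleSurgery (𝓡 4) (𝓡 4) X' X ℓ)
    (h38 : ∀ (M : Type) [TopologicalSpace M] [T2Space M] [SecondCountableTopology M]
      [ChartedSpace (𝔼 4) M] [IsManifold (𝓡 4) ∞ M],
      M ≃ₕ 𝕊 4 → ∀ T : Fin 3 → Set M, IsGKTrisection M 3 (fun _ => 1) T →
      ∀ i j : Fin 3, i ≠ j → ∀ a b : Set M, IsCurve T a → IsCurve T b →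
      BoundsDisc T (spineHandlebody T i) a → BoundsDisc T (spineHandlebody T j) b →
      Disjoint a b → IsNonSeparating T a → IsNonSeparating T b →
      ¬ IsConnected (centralSurfaceSet T \ (a ∪ b)) →
      BoundsDisc T (spineHandlebody T j) a ∨ BoundsDisc T (spineHandlebody T i) b)
    (hP : ∀ (M : Type) [TopologicalSpace M] [T2Space M] [SecondCountableTopology M]
      [ChartedSpace (𝔼 4) M] [IsManifold (𝓡 4) ∞ M],
      M ≃ₕ 𝕊 4 → ∀ T : Fin 3 → Set M, IsGKTrisection M 3 (fun _ => 1) T →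
      ∀ f : Fin 3 → Set M,
      ((∀ i, IsCurve T (f i)) ∧ (Pairwise fun i j => Disjoint (f i) (f j)) ∧
        (∀ i, IsNonSeparating T (f i)) ∧ (∀ i, BoundsDisc T (spineHandlebody T i) (f i)) ∧
        (∀ i j, i ≠ j → IsConnected (centralSurfaceSet T \ (f i ∪ f j))) ∧
        ¬ IsPreconnected (centralSurfaceSet T \ ⋃ i, f i)) →
      ¬ IsWeaklyReducible T →
      ∃ (X' : Type) (_ : TopologicalSpace X') (_ : T2Space X') (_ : SecondCountableTopology X')
        (_ : ChartedSpace (𝔼 4) X') (_ : IsManifold (𝓡 4) ∞ X')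
        (k' : Fin 3 → ℕ) (T' : Fin 3 → Set X')
        (ℓ : Metric.sphere (0 : EuclideanSpace ℝ (Fin 2)) 1 → X'),
        IsGKTrisection X' 2 k' T' ∧ (∃ i, 2 ≤ k' i + 1) ∧
          Manifold.IsSmoothEmbedding (𝓡 1) (𝓡 4) ∞ ℓ ∧ IsCircleSurgery (𝓡 4) (𝓡 4) X' M ℓ) :
    arandaZupan_dependentTriple_genusThree_homotopySphere :=
  arandaZupan_dependentTriple_genusThree_homotopySphere_of_az2025_of_msz_of_separatingPair_of_loopSurgery_of_loopPartner_balanced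
    (Literature.Barriers.SmoothPoincare4.az2025_weaklyReducible_genusThree_homotopySphere_gk_of_msz_zero_of_sep_of_pi1_of_loopSurgery_of_fiveChainSurgery.{0}
      hMSZ₀ hsep₀ hπ hL h5)
    hMSZ₀ h38 hL hP

end LoopSurgeryEndgame

/-! ### The `π₁`-shadow discharged: the standing of the fact over three tracked named facts and
### three Aranda–Zupan-specific steps, nothing else

The `π₁`-shadow of the non-separating reducible case — *a GK-trisected closed 4-manifold with a
non-separating curve of the central surface bounding a disc in each handlebody of the spine is
not simply connected* (Aranda–Zupan §2 p. 6: such a trisection splits off the genus-one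
trisection of `S¹ × S³`) — was carried above as the inline hypothesis `hπ`.  It is now the
tree's theorem `Trisection.not_simplyConnectedSpace_of_reducing_nonseparating`
(`ReducibleTrisectionNotSimplyConnected.lean`; van Kampen over the trisection), available in
exactly the binder shape of `hπ` as
`Literature.Barriers.SmoothPoincare4.not_simplyConnectedSpace_of_reducing_nonseparating_binderShape`
(`WeaklyReducibleGenusThreeStandardOfSeparatingSplitting.lean`, where the Thm. 1.3 fact's own
assemblies lose the hypothesis:
`az2025_weaklyReducible_genusThree_homotopySphere_gk_of_msz_zero_of_sep_of_loopSurgery_of_fiveChainSurgery'`).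
This section feeds it in.
-/

section ShadowDischarged

open Trisection

universe u₁₁ u₁₂ u₁₃ u₁₄

/-- **`…_of_az2025_of_msz_of_sep_of_pi1_of_fiveChainCase` without the `π₁`-shadow** (PROVED
glue; the shadow is the tree's theorem
`Trisection.not_simplyConnectedSpace_of_reducing_nonseparating`): GIVEN the Thm. 1.3 fact,
`msz_homotopySphere_gk` and the separating splitting fact (each at any universe), the fact follows
from its five-chain case `h5`.
[cite: ArandaZupan2025, Thm. 1.3, Thm. 1.4 (p. 2), §2 (p. 6) and §7 (pp. 25–26)] [cite: MeierSchirmerZupan2016, Thm. 1.2] -/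
theorem arandaZupan_dependentTriple_genusThree_homotopySphere_of_az2025_of_msz_of_sep_of_fiveChainCase
    (hAZ : Literature.Barriers.SmoothPoincare4.az2025_weaklyReducible_genusThree_homotopySphere_gk.{u₁₁})
    (hMSZ : Literature.Barriers.SmoothPoincare4.msz_homotopySphere_gk.{u₁₂})
    (hsep : isConnectedSum_of_reducing_separating.{u₁₃})
    (h5 : ∀ (M : Type) [TopologicalSpace M] [T2Space M] [SecondCountableTopology M]
      [ChartedSpace (𝔼 4) M] [IsManifold (𝓡 4) ∞ M],
      M ≃ₕ 𝕊 4 → ∀ T : Fin 3 → Set M, IsGKTrisection M 3 (fun _ => 1) T →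
        HasDependentTriple T → ¬ IsWeaklyReducible T → ¬ IsReducible T →
        Nonempty (M ≃ₘ⟮𝓡 4, 𝓡 4⟯ 𝕊 4)) :
    arandaZupan_dependentTriple_genusThree_homotopySphere :=
  arandaZupan_dependentTriple_genusThree_homotopySphere_of_az2025_of_msz_of_sep_of_pi1_of_fiveChainCase
    hAZ hMSZ hsep
    Literature.Barriers.SmoothPoincare4.not_simplyConnectedSpace_of_reducing_nonseparating_binderShape
    h5

/-- **`…_of_az2025_of_msz_of_sep_of_pi1_of_separatingPair_of_pantsCase` without the
`π₁`-shadow** (PROVED glue): GIVEN the Thm. 1.3 fact, `msz_homotopySphere_gk`, the separating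
splitting fact (each at any universe) and the separating-pair lemma `hL38`, the fact follows from
its pants case `hPants`.
[cite: ArandaZupan2025, Thm. 1.3, Thm. 1.4 (p. 2), Lemma 3.8 (p. 10), §2 (p. 6) and §7 (pp. 24–26)] [cite: MeierSchirmerZupan2016, Thm. 1.2] -/
theorem arandaZupan_dependentTriple_genusThree_homotopySphere_of_az2025_of_msz_of_sep_of_separatingPair_of_pantsCase
    (hAZ : Literature.Barriers.SmoothPoincare4.az2025_weaklyReducible_genusThree_homotopySphere_gk.{u₁₁})
    (hMSZ : Literature.Barriers.SmoothPoincare4.msz_homotopySphere_gk.{u₁₂})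
    (hsep : isConnectedSum_of_reducing_separating.{u₁₃})
    (hL38 : ∀ (M : Type) [TopologicalSpace M] [T2Space M] [SecondCountableTopology M]
      [ChartedSpace (𝔼 4) M] [IsManifold (𝓡 4) ∞ M] (T : Fin 3 → Set M),
      IsGKTrisection M 3 (fun _ => 1) T → ∀ i j : Fin 3, i ≠ j → ∀ x y : Set M,
      IsCurve T x → IsCurve T y → Disjoint x y → IsNonSeparating T x → IsNonSeparating T y →
      ¬ IsPreconnected (centralSurfaceSet T \ (x ∪ y)) →
      BoundsDisc T (spineHandlebody T i) x → BoundsDisc T (spineHandlebody T j) y →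
      BoundsDisc T (spineHandlebody T j) x ∨ BoundsDisc T (spineHandlebody T i) y)
    (hPants : ∀ (M : Type) [TopologicalSpace M] [T2Space M] [SecondCountableTopology M]
      [ChartedSpace (𝔼 4) M] [IsManifold (𝓡 4) ∞ M],
      M ≃ₕ 𝕊 4 → ∀ T : Fin 3 → Set M, IsGKTrisection M 3 (fun _ => 1) T →
      ∀ a b c : Set M, IsCurve T a → IsCurve T b → IsCurve T c →
      Disjoint a b → Disjoint b c → Disjoint a c →
      IsNonSeparating T a → IsNonSeparating T b → IsNonSeparating T c →
      BoundsDisc T (spineHandlebody T 0) a → BoundsDisc T (spineHandlebody T 1) b →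
      BoundsDisc T (spineHandlebody T 2) c →
      ¬ IsPreconnected (centralSurfaceSet T \ (a ∪ b ∪ c)) →
      IsConnected (centralSurfaceSet T \ (a ∪ b)) → IsConnected (centralSurfaceSet T \ (b ∪ c)) →
      IsConnected (centralSurfaceSet T \ (a ∪ c)) →
      ¬ IsWeaklyReducible T → ¬ IsReducible T → Nonempty (M ≃ₘ⟮𝓡 4, 𝓡 4⟯ 𝕊 4)) :
    arandaZupan_dependentTriple_genusThree_homotopySphere :=
  arandaZupan_dependentTriple_genusThree_homotopySphere_of_az2025_of_msz_of_sep_of_pi1_of_separatingPair_of_pantsCase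
    hAZ hMSZ hsep
    Literature.Barriers.SmoothPoincare4.not_simplyConnectedSpace_of_reducing_nonseparating_binderShape
    hL38 hPants

/-- **The standing of the fact (PROVED glue): three tracked named facts and three
Aranda–Zupan-specific steps, nothing else.**  The fact follows from Meier–Schirmer–Zupan's
homotopy-sphere fact `msz_homotopySphere_gk.{0}`, the separating splitting fact
`Trisection.isConnectedSum_of_reducing_separating.{0}`, the loop-surgery fact
`msz_loopSurgery_homotopySphere_gk`, and — inline, none with a counterpart in the tree, none
vendored (D-0026) — the FIVE-CHAIN SURGERY STEP `h5` for weak reductions (Thm. 1.3 first part +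
Lemma 5.4 + Prop. 5.5; it supplies the Thm. 1.3 fact through
`az2025_weaklyReducible_genusThree_homotopySphere_gk_of_msz_zero_of_sep_of_loopSurgery_of_fiveChainSurgery'`),
the SEPARATING-PAIR LEMMA `h38` (Lemma 3.8 + the parallel case) and the LOOP-PARTNER STEP `hP`
(§7 configuration (3) through Prop. 5.5), the last two for balanced `(3; 1,1,1)` homotopy spheres.
[cite: ArandaZupan2025, Thm. 1.3, Thm. 1.4 (p. 2), §2 (p. 6), Lemma 3.8 (p. 10), Lemma 5.4, Prop. 5.5 (pp. 19–20), §6 (pp. 20–24) and §7 (pp. 24–26)] [cite: MeierSchirmerZupan2016, Thm. 1.2] -/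
theorem arandaZupan_dependentTriple_genusThree_homotopySphere_of_msz_zero_of_sep_of_loopSurgery_of_fiveChainSurgery_of_separatingPair_of_loopPartner
    (hMSZ₀ : Literature.Barriers.SmoothPoincare4.msz_homotopySphere_gk.{0})
    (hsep₀ : isConnectedSum_of_reducing_separating.{0})
    (hL : msz_loopSurgery_homotopySphere_gk)
    (h5 : ∀ (X : Type) [TopologicalSpace X] [T2Space X] [SecondCountableTopology X]
      [ChartedSpace (𝔼 4) X] [IsManifold (𝓡 4) ∞ X] [CompactSpace X]
      [ConnectedSpace X] (_ : SmoothOrientation (𝓡 4) X) (S : Fin 3 → Set X),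
      IsBalancedGKTrisection X 3 1 S →
      (∃ c c' : Set X, IsCurve S c ∧ IsCurve S c' ∧ Disjoint c c' ∧
        IsNonSeparating S c ∧ IsNonSeparating S c' ∧
        BoundsDisc S (spineHandlebody S 0) c ∧ BoundsDisc S (spineHandlebody S 1) c' ∧
        BoundsDisc S (spineHandlebody S 2) c') →
      ¬ IsReducible S →
      ∃ (X' : Type) (_ : TopologicalSpace X') (_ : T2Space X') (_ : SecondCountableTopology X')
        (_ : ChartedSpace (𝔼 4) X') (_ : IsManifold (𝓡 4) ∞ X')
        (k' : Fin 3 → ℕ) (S' : Fin 3 → Set X')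
        (ℓ : Metric.sphere (0 : EuclideanSpace ℝ (Fin 2)) 1 → X'),
        IsGKTrisection X' 2 k' S' ∧ (∃ i, 2 ≤ k' i + 1) ∧
          Manifold.IsSmoothEmbedding (𝓡 1) (𝓡 4) ∞ ℓ ∧ IsCircleSurgery (𝓡 4) (𝓡 4) X' X ℓ)
    (h38 : ∀ (M : Type) [TopologicalSpace M] [T2Space M] [SecondCountableTopology M]
      [ChartedSpace (𝔼 4) M] [IsManifold (𝓡 4) ∞ M],
      M ≃ₕ 𝕊 4 → ∀ T : Fin 3 → Set M, IsGKTrisection M 3 (fun _ => 1) T →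
      ∀ i j : Fin 3, i ≠ j → ∀ a b : Set M, IsCurve T a → IsCurve T b →
      BoundsDisc T (spineHandlebody T i) a → BoundsDisc T (spineHandlebody T j) b →
      Disjoint a b → IsNonSeparating T a → IsNonSeparating T b →
      ¬ IsConnected (centralSurfaceSet T \ (a ∪ b)) →
      BoundsDisc T (spineHandlebody T j) a ∨ BoundsDisc T (spineHandlebody T i) b)
    (hP : ∀ (M : Type) [TopologicalSpace M] [T2Space M] [SecondCountableTopology M]
      [ChartedSpace (𝔼 4) M] [IsManifold (𝓡 4) ∞ M],
      M ≃ₕ 𝕊 4 → ∀ T : Fin 3 → Set M, IsGKTrisection M 3 (fun _ => 1) T →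
      ∀ f : Fin 3 → Set M,
      ((∀ i, IsCurve T (f i)) ∧ (Pairwise fun i j => Disjoint (f i) (f j)) ∧
        (∀ i, IsNonSeparating T (f i)) ∧ (∀ i, BoundsDisc T (spineHandlebody T i) (f i)) ∧
        (∀ i j, i ≠ j → IsConnected (centralSurfaceSet T \ (f i ∪ f j))) ∧
        ¬ IsPreconnected (centralSurfaceSet T \ ⋃ i, f i)) →
      ¬ IsWeaklyReducible T →
      ∃ (X' : Type) (_ : TopologicalSpace X') (_ : T2Space X') (_ : SecondCountableTopology X')
        (_ : ChartedSpace (𝔼 4) X') (_ : IsManifold (𝓡 4) ∞ X')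
        (k' : Fin 3 → ℕ) (T' : Fin 3 → Set X')
        (ℓ : Metric.sphere (0 : EuclideanSpace ℝ (Fin 2)) 1 → X'),
        IsGKTrisection X' 2 k' T' ∧ (∃ i, 2 ≤ k' i + 1) ∧
          Manifold.IsSmoothEmbedding (𝓡 1) (𝓡 4) ∞ ℓ ∧ IsCircleSurgery (𝓡 4) (𝓡 4) X' M ℓ) :
    arandaZupan_dependentTriple_genusThree_homotopySphere :=
  arandaZupan_dependentTriple_genusThree_homotopySphere_of_az2025_of_msz_of_separatingPair_of_loopSurgery_of_loopPartner_balanced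
    (Literature.Barriers.SmoothPoincare4.az2025_weaklyReducible_genusThree_homotopySphere_gk_of_msz_zero_of_sep_of_loopSurgery_of_fiveChainSurgery'
      hMSZ₀ hsep₀ hL h5 :
      Literature.Barriers.SmoothPoincare4.az2025_weaklyReducible_genusThree_homotopySphere_gk.{0})
    hMSZ₀ h38 hL hP

/-- **The same standing over the Meier–Schirmer–Zupan CLASSIFICATION at any universe** (PROVED
glue): `msz_trisection_classification_gk.{u}` in place of `msz_homotopySphere_gk.{0}` (the
latter follows from the former by the tree's `msz_homotopySphere_gk_of_classification_univ`).
[cite: ArandaZupan2025, Thm. 1.3, Thm. 1.4 (p. 2), §2 (p. 6), Lemma 3.8 (p. 10), Lemma 5.4, Prop. 5.5 (pp. 19–20), §6 (pp. 20–24) and §7 (pp. 24–26)] [cite: MeierSchirmerZupan2016, Thm. 1.2] -/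
theorem arandaZupan_dependentTriple_genusThree_homotopySphere_of_classification_of_sep_of_loopSurgery_of_fiveChainSurgery_of_separatingPair_of_loopPartner
    (hC : msz_trisection_classification_gk.{u₁₄})
    (hsep₀ : isConnectedSum_of_reducing_separating.{0})
    (hL : msz_loopSurgery_homotopySphere_gk)
    (h5 : ∀ (X : Type) [TopologicalSpace X] [T2Space X] [SecondCountableTopology X]
      [ChartedSpace (𝔼 4) X] [IsManifold (𝓡 4) ∞ X] [CompactSpace X]
      [ConnectedSpace X] (_ : SmoothOrientation (𝓡 4) X) (S : Fin 3 → Set X),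
      IsBalancedGKTrisection X 3 1 S →
      (∃ c c' : Set X, IsCurve S c ∧ IsCurve S c' ∧ Disjoint c c' ∧
        IsNonSeparating S c ∧ IsNonSeparating S c' ∧
        BoundsDisc S (spineHandlebody S 0) c ∧ BoundsDisc S (spineHandlebody S 1) c' ∧
        BoundsDisc S (spineHandlebody S 2) c') →
      ¬ IsReducible S →
      ∃ (X' : Type) (_ : TopologicalSpace X') (_ : T2Space X') (_ : SecondCountableTopology X')
        (_ : ChartedSpace (𝔼 4) X') (_ : IsManifold (𝓡 4) ∞ X')
        (k' : Fin 3 → ℕ) (S' : Fin 3 → Set X')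
        (ℓ : Metric.sphere (0 : EuclideanSpace ℝ (Fin 2)) 1 → X'),
        IsGKTrisection X' 2 k' S' ∧ (∃ i, 2 ≤ k' i + 1) ∧
          Manifold.IsSmoothEmbedding (𝓡 1) (𝓡 4) ∞ ℓ ∧ IsCircleSurgery (𝓡 4) (𝓡 4) X' X ℓ)
    (h38 : ∀ (M : Type) [TopologicalSpace M] [T2Space M] [SecondCountableTopology M]
      [ChartedSpace (𝔼 4) M] [IsManifold (𝓡 4) ∞ M],
      M ≃ₕ 𝕊 4 → ∀ T : Fin 3 → Set M, IsGKTrisection M 3 (fun _ => 1) T →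
      ∀ i j : Fin 3, i ≠ j → ∀ a b : Set M, IsCurve T a → IsCurve T b →
      BoundsDisc T (spineHandlebody T i) a → BoundsDisc T (spineHandlebody T j) b →
      Disjoint a b → IsNonSeparating T a → IsNonSeparating T b →
      ¬ IsConnected (centralSurfaceSet T \ (a ∪ b)) →
      BoundsDisc T (spineHandlebody T j) a ∨ BoundsDisc T (spineHandlebody T i) b)
    (hP : ∀ (M : Type) [TopologicalSpace M] [T2Space M] [SecondCountableTopology M]
      [ChartedSpace (𝔼 4) M] [IsManifold (𝓡 4) ∞ M],
      M ≃ₕ 𝕊 4 → ∀ T : Fin 3 → Set M, IsGKTrisection M 3 (fun _ => 1) T →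
      ∀ f : Fin 3 → Set M,
      ((∀ i, IsCurve T (f i)) ∧ (Pairwise fun i j => Disjoint (f i) (f j)) ∧
        (∀ i, IsNonSeparating T (f i)) ∧ (∀ i, BoundsDisc T (spineHandlebody T i) (f i)) ∧
        (∀ i j, i ≠ j → IsConnected (centralSurfaceSet T \ (f i ∪ f j))) ∧
        ¬ IsPreconnected (centralSurfaceSet T \ ⋃ i, f i)) →
      ¬ IsWeaklyReducible T →
      ∃ (X' : Type) (_ : TopologicalSpace X') (_ : T2Space X') (_ : SecondCountableTopology X')
        (_ : ChartedSpace (𝔼 4) X') (_ : IsManifold (𝓡 4) ∞ X')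
        (k' : Fin 3 → ℕ) (T' : Fin 3 → Set X')
        (ℓ : Metric.sphere (0 : EuclideanSpace ℝ (Fin 2)) 1 → X'),
        IsGKTrisection X' 2 k' T' ∧ (∃ i, 2 ≤ k' i + 1) ∧
          Manifold.IsSmoothEmbedding (𝓡 1) (𝓡 4) ∞ ℓ ∧ IsCircleSurgery (𝓡 4) (𝓡 4) X' M ℓ) :
    arandaZupan_dependentTriple_genusThree_homotopySphere :=
  arandaZupan_dependentTriple_genusThree_homotopySphere_of_az2025_of_msz_of_separatingPair_of_loopSurgery_of_loopPartner_balanced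
    (Literature.Barriers.SmoothPoincare4.az2025_weaklyReducible_genusThree_homotopySphere_gk_of_classification_of_sep_of_loopSurgery_of_fiveChainSurgery'
      hC hsep₀ hL h5 :
      Literature.Barriers.SmoothPoincare4.az2025_weaklyReducible_genusThree_homotopySphere_gk.{0})
    (Literature.Barriers.SmoothPoincare4.msz_homotopySphere_gk_of_classification_univ hC :
      Literature.Barriers.SmoothPoincare4.msz_homotopySphere_gk.{0})
    h38 hL hP

end ShadowDischarged

/-! ### The loop-surgery fact discharged through the classification: the standing of the fact
### over TWO tracked named facts and the three Aranda–Zupan-specific steps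

The loop-surgery fact `msz_loopSurgery_homotopySphere_gk` (the hypothesis `hL` of sections
"LoopSurgeryEndgame" and "ShadowDischarged") is now REDUCED in the tree to the
Meier–Schirmer–Zupan classification itself — `msz_loopSurgery_homotopySphere_gk_of_classification`
(`LoopSurgeryHomotopySphereGKProofs.lean`: `χ(X_ℓ) = χ(X′) + 2`, the classification,
`χ(#ᵏ(S¹ × S³) # εℂP²)`, winding number `±1` of the surgered loop by Seifert–van Kampen, and
both surgeries on the fibre circle of `S¹ × S³` are `S⁴`) — the classification being
universe-free (`msz_trisection_classification_gk_of_univ`, `LargeKTrisectionClassificationUniv.lean`);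
the Thm. 1.3 fact's own assemblies lose `hL` accordingly
(`Literature.Barriers.SmoothPoincare4.az2025_weaklyReducible_genusThree_homotopySphere_gk_of_classification_of_sep_of_fiveChainSurgery`,
`WeaklyReducibleGenusThreeStandardOfClassification.lean`).  This section feeds the reduction in
on the Thm. 1.4 side: the pants-triple statement `hp` and the not-weakly-reducible core `hcore`
from the classification and the loop-partner step (`pantsTriple_of_classification_of_loopPartner`,
`notWeaklyReducibleCore_of_separatingPair_of_classification_of_loopPartner`); the fact from the
Thm. 1.3 fact, the separating-pair lemma `h38`, the classification and the loop-partner step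
`hP` (`…_of_az2025_of_separatingPair_of_classification_of_loopPartner`); and **the standing of
the fact** (`…_of_classification_of_sep_of_fiveChainSurgery_of_separatingPair_of_loopPartner`):
it follows from TWO tracked named facts of the tree — `msz_trisection_classification_gk` at any
universe [MSZ16, Thm. 1.2] and `Trisection.isConnectedSum_of_reducing_separating.{0}`
[AZ25 §2 p. 6] — and the three Aranda–Zupan-specific inline steps `h5` (five-chain surgery
step for weak reductions: Thm. 1.3 first part + Lemma 5.4 + Prop. 5.5), `h38` (Lemma 3.8 + the
parallel case) and `hP` (loop-partner step of §7 configuration (3)), nothing else.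
-/

section LoopSurgeryDischarged

open Trisection

universe u₁₅ u₁₆

/-- **The pants-triple statement `hp` (all types) from the CLASSIFICATION and the loop-partner
step `hP`** (PROVED glue): `pantsTriple_of_loopSurgery_of_loopPartner` with the loop-surgery
fact supplied by `msz_loopSurgery_homotopySphere_gk_of_classification`.
[cite: ArandaZupan2025, §7 (pp. 25–26), Lemma 5.4 and Prop. 5.5 (pp. 19–20), §2 p. 7] [cite: MeierSchirmerZupan2016, Thm. 1.2] -/
theorem pantsTriple_of_classification_of_loopPartner
    (hC : msz_trisection_classification_gk.{u₁₅})
    (hP : ∀ (M : Type) [TopologicalSpace M] [T2Space M] [SecondCountableTopology M]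
      [ChartedSpace (𝔼 4) M] [IsManifold (𝓡 4) ∞ M],
      M ≃ₕ 𝕊 4 → ∀ (k : Fin 3 → ℕ) (T : Fin 3 → Set M), IsGKTrisection M 3 k T →
      ∀ f : Fin 3 → Set M,
      ((∀ i, IsCurve T (f i)) ∧ (Pairwise fun i j => Disjoint (f i) (f j)) ∧
        (∀ i, IsNonSeparating T (f i)) ∧ (∀ i, BoundsDisc T (spineHandlebody T i) (f i)) ∧
        (∀ i j, i ≠ j → IsConnected (centralSurfaceSet T \ (f i ∪ f j))) ∧
        ¬ IsPreconnected (centralSurfaceSet T \ ⋃ i, f i)) →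
      ¬ IsWeaklyReducible T →
      ∃ (X' : Type) (_ : TopologicalSpace X') (_ : T2Space X') (_ : SecondCountableTopology X')
        (_ : ChartedSpace (𝔼 4) X') (_ : IsManifold (𝓡 4) ∞ X')
        (k' : Fin 3 → ℕ) (T' : Fin 3 → Set X')
        (ℓ : Metric.sphere (0 : EuclideanSpace ℝ (Fin 2)) 1 → X'),
        IsGKTrisection X' 2 k' T' ∧ (∃ i, 2 ≤ k' i + 1) ∧
          Manifold.IsSmoothEmbedding (𝓡 1) (𝓡 4) ∞ ℓ ∧ IsCircleSurgery (𝓡 4) (𝓡 4) X' M ℓ) :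
    ∀ (M : Type) [TopologicalSpace M] [T2Space M] [SecondCountableTopology M]
      [ChartedSpace (𝔼 4) M] [IsManifold (𝓡 4) ∞ M],
      M ≃ₕ 𝕊 4 → ∀ (k : Fin 3 → ℕ) (T : Fin 3 → Set M), IsGKTrisection M 3 k T →
      ∀ f : Fin 3 → Set M,
      ((∀ i, IsCurve T (f i)) ∧ (Pairwise fun i j => Disjoint (f i) (f j)) ∧
        (∀ i, IsNonSeparating T (f i)) ∧ (∀ i, BoundsDisc T (spineHandlebody T i) (f i)) ∧
        (∀ i j, i ≠ j → IsConnected (centralSurfaceSet T \ (f i ∪ f j))) ∧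
        ¬ IsPreconnected (centralSurfaceSet T \ ⋃ i, f i)) →
      ¬ IsWeaklyReducible T → Nonempty (M ≃ₘ⟮𝓡 4, 𝓡 4⟯ 𝕊 4) :=
  pantsTriple_of_loopSurgery_of_loopPartner
    (msz_loopSurgery_homotopySphere_gk_of_classification
      (msz_trisection_classification_gk_of_univ hC)) hP

/-- **The not-weakly-reducible core `hcore` (all types) from the separating-pair lemma `h38`,
the CLASSIFICATION and the loop-partner step `hP`** (PROVED glue):
`notWeaklyReducibleCore_of_separatingPair_of_loopSurgery_of_loopPartner` with the loop-surgery
fact supplied by `msz_loopSurgery_homotopySphere_gk_of_classification`.  Output: verbatim the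
hypothesis `hcore` of `…_of_weaklyReducible_of_notWeaklyReducible` (and the Summits-side
`NotWeaklyReducibleCore`).
[cite: ArandaZupan2025, §7 (pp. 24–26), Lemma 3.8 (p. 10), Lemma 5.4 and Prop. 5.5 (pp. 19–20)] [cite: MeierSchirmerZupan2016, Thm. 1.2] -/
theorem notWeaklyReducibleCore_of_separatingPair_of_classification_of_loopPartner
    (h38 : ∀ (M : Type) [TopologicalSpace M] [T2Space M] [SecondCountableTopology M]
      [ChartedSpace (𝔼 4) M] [IsManifold (𝓡 4) ∞ M],
      M ≃ₕ 𝕊 4 → ∀ (k : Fin 3 → ℕ) (T : Fin 3 → Set M), IsGKTrisection M 3 k T →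
      ∀ i j : Fin 3, i ≠ j → ∀ a b : Set M, IsCurve T a → IsCurve T b →
      BoundsDisc T (spineHandlebody T i) a → BoundsDisc T (spineHandlebody T j) b →
      Disjoint a b → IsNonSeparating T a → IsNonSeparating T b →
      ¬ IsConnected (centralSurfaceSet T \ (a ∪ b)) →
      BoundsDisc T (spineHandlebody T j) a ∨ BoundsDisc T (spineHandlebody T i) b)
    (hC : msz_trisection_classification_gk.{u₁₅})
    (hP : ∀ (M : Type) [TopologicalSpace M] [T2Space M] [SecondCountableTopology M]
      [ChartedSpace (𝔼 4) M] [IsManifold (𝓡 4) ∞ M],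
      M ≃ₕ 𝕊 4 → ∀ (k : Fin 3 → ℕ) (T : Fin 3 → Set M), IsGKTrisection M 3 k T →
      ∀ f : Fin 3 → Set M,
      ((∀ i, IsCurve T (f i)) ∧ (Pairwise fun i j => Disjoint (f i) (f j)) ∧
        (∀ i, IsNonSeparating T (f i)) ∧ (∀ i, BoundsDisc T (spineHandlebody T i) (f i)) ∧
        (∀ i j, i ≠ j → IsConnected (centralSurfaceSet T \ (f i ∪ f j))) ∧
        ¬ IsPreconnected (centralSurfaceSet T \ ⋃ i, f i)) →
      ¬ IsWeaklyReducible T →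
      ∃ (X' : Type) (_ : TopologicalSpace X') (_ : T2Space X') (_ : SecondCountableTopology X')
        (_ : ChartedSpace (𝔼 4) X') (_ : IsManifold (𝓡 4) ∞ X')
        (k' : Fin 3 → ℕ) (T' : Fin 3 → Set X')
        (ℓ : Metric.sphere (0 : EuclideanSpace ℝ (Fin 2)) 1 → X'),
        IsGKTrisection X' 2 k' T' ∧ (∃ i, 2 ≤ k' i + 1) ∧
          Manifold.IsSmoothEmbedding (𝓡 1) (𝓡 4) ∞ ℓ ∧ IsCircleSurgery (𝓡 4) (𝓡 4) X' M ℓ) :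
    ∀ (M : Type) [TopologicalSpace M] [T2Space M] [SecondCountableTopology M]
      [ChartedSpace (𝔼 4) M] [IsManifold (𝓡 4) ∞ M],
      M ≃ₕ 𝕊 4 → ∀ (k : Fin 3 → ℕ) (T : Fin 3 → Set M), IsGKTrisection M 3 k T →
        HasDependentTriple T → ¬ IsWeaklyReducible T → Nonempty (M ≃ₘ⟮𝓡 4, 𝓡 4⟯ 𝕊 4) :=
  notWeaklyReducibleCore_of_separatingPair_of_loopSurgery_of_loopPartner h38
    (msz_loopSurgery_homotopySphere_gk_of_classification
      (msz_trisection_classification_gk_of_univ hC)) hP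

/-- **The fact from the Thm. 1.3 fact (catalogue form, any universe), the separating-pair lemma
`h38`, the CLASSIFICATION (any universe) and the loop-partner step `hP`** (PROVED glue):
`…_of_az2025_of_separatingPair_of_loopSurgery_of_loopPartner` with the loop-surgery fact supplied
by `msz_loopSurgery_homotopySphere_gk_of_classification`.  On this road the named inputs of the
fact beyond Thm. 1.3 are `msz_trisection_classification_gk` and nothing else; `h38` and `hP`
are the two Aranda–Zupan-specific steps of the printed proof of Thm. 1.4 (configurations
(1)–(2), resp. (3), of §7).
[cite: ArandaZupan2025, Thm. 1.3, Thm. 1.4 (p. 2), Lemma 3.8 (p. 10), Lemma 5.4, Prop. 5.5 (pp. 19–20) and §7 (pp. 24–26)] [cite: MeierSchirmerZupan2016, Thm. 1.2] -/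
theorem arandaZupan_dependentTriple_genusThree_homotopySphere_of_az2025_of_separatingPair_of_classification_of_loopPartner
    (hAZ : Literature.Barriers.SmoothPoincare4.az2025_weaklyReducible_genusThree_homotopySphere_gk.{u₁₆})
    (h38 : ∀ (M : Type) [TopologicalSpace M] [T2Space M] [SecondCountableTopology M]
      [ChartedSpace (𝔼 4) M] [IsManifold (𝓡 4) ∞ M],
      M ≃ₕ 𝕊 4 → ∀ (k : Fin 3 → ℕ) (T : Fin 3 → Set M), IsGKTrisection M 3 k T →
      ∀ i j : Fin 3, i ≠ j → ∀ a b : Set M, IsCurve T a → IsCurve T b →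
      BoundsDisc T (spineHandlebody T i) a → BoundsDisc T (spineHandlebody T j) b →
      Disjoint a b → IsNonSeparating T a → IsNonSeparating T b →
      ¬ IsConnected (centralSurfaceSet T \ (a ∪ b)) →
      BoundsDisc T (spineHandlebody T j) a ∨ BoundsDisc T (spineHandlebody T i) b)
    (hC : msz_trisection_classification_gk.{u₁₅})
    (hP : ∀ (M : Type) [TopologicalSpace M] [T2Space M] [SecondCountableTopology M]
      [ChartedSpace (𝔼 4) M] [IsManifold (𝓡 4) ∞ M],
      M ≃ₕ 𝕊 4 → ∀ (k : Fin 3 → ℕ) (T : Fin 3 → Set M), IsGKTrisection M 3 k T →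
      ∀ f : Fin 3 → Set M,
      ((∀ i, IsCurve T (f i)) ∧ (Pairwise fun i j => Disjoint (f i) (f j)) ∧
        (∀ i, IsNonSeparating T (f i)) ∧ (∀ i, BoundsDisc T (spineHandlebody T i) (f i)) ∧
        (∀ i j, i ≠ j → IsConnected (centralSurfaceSet T \ (f i ∪ f j))) ∧
        ¬ IsPreconnected (centralSurfaceSet T \ ⋃ i, f i)) →
      ¬ IsWeaklyReducible T →
      ∃ (X' : Type) (_ : TopologicalSpace X') (_ : T2Space X') (_ : SecondCountableTopology X')
        (_ : ChartedSpace (𝔼 4) X') (_ : IsManifold (𝓡 4) ∞ X')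
        (k' : Fin 3 → ℕ) (T' : Fin 3 → Set X')
        (ℓ : Metric.sphere (0 : EuclideanSpace ℝ (Fin 2)) 1 → X'),
        IsGKTrisection X' 2 k' T' ∧ (∃ i, 2 ≤ k' i + 1) ∧
          Manifold.IsSmoothEmbedding (𝓡 1) (𝓡 4) ∞ ℓ ∧ IsCircleSurgery (𝓡 4) (𝓡 4) X' M ℓ) :
    arandaZupan_dependentTriple_genusThree_homotopySphere :=
  arandaZupan_dependentTriple_genusThree_homotopySphere_of_az2025_of_separatingPair_of_loopSurgery_of_loopPartner
    hAZ h38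
    (msz_loopSurgery_homotopySphere_gk_of_classification
      (msz_trisection_classification_gk_of_univ hC)) hP

/-- **The standing of the fact (PROVED glue): TWO tracked named facts and three
Aranda–Zupan-specific steps, nothing else.**  The fact follows from the Meier–Schirmer–Zupan
classification `msz_trisection_classification_gk` (any universe), the separating splitting fact
`Trisection.isConnectedSum_of_reducing_separating.{0}`, and — inline, none with a counterpart in
the tree, none vendored (D-0026) — the FIVE-CHAIN SURGERY STEP `h5` for weak reductions
(Thm. 1.3 first part + Lemma 5.4 + Prop. 5.5; through
`Literature.Barriers.SmoothPoincare4.az2025_weaklyReducible_genusThree_homotopySphere_gk_of_classification_of_sep_of_fiveChainSurgery`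
it supplies the Thm. 1.3 fact), the SEPARATING-PAIR LEMMA `h38` (Lemma 3.8 + the parallel case)
and the LOOP-PARTNER STEP `hP` (§7 configuration (3) through Prop. 5.5), the last two for balanced
`(3; 1,1,1)` homotopy spheres.  This is
`…_of_classification_of_sep_of_loopSurgery_of_fiveChainSurgery_of_separatingPair_of_loopPartner`
with its loop-surgery hypothesis `hL` supplied by
`msz_loopSurgery_homotopySphere_gk_of_classification (msz_trisection_classification_gk_of_univ hC)`:
the [MSZ16]/Pao endgames of BOTH Thm. 1.3 (§6 p. 24) and Thm. 1.4 (§7 p. 26) are now consequences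
of the classification in the tree.
[cite: ArandaZupan2025, Thm. 1.3, Thm. 1.4 (p. 2), §2 (p. 6), Lemma 3.8 (p. 10), Lemma 5.4, Prop. 5.5 (pp. 19–20), §6 (pp. 20–24) and §7 (pp. 24–26)] [cite: MeierSchirmerZupan2016, Thm. 1.2] [cite: Pao1977, Thm. (S_1 ≅ S'_1 ≅ S⁴)] -/
theorem arandaZupan_dependentTriple_genusThree_homotopySphere_of_classification_of_sep_of_fiveChainSurgery_of_separatingPair_of_loopPartner
    (hC : msz_trisection_classification_gk.{u₁₅})
    (hsep₀ : isConnectedSum_of_reducing_separating.{0})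
    (h5 : ∀ (X : Type) [TopologicalSpace X] [T2Space X] [SecondCountableTopology X]
      [ChartedSpace (𝔼 4) X] [IsManifold (𝓡 4) ∞ X] [CompactSpace X]
      [ConnectedSpace X] (_ : SmoothOrientation (𝓡 4) X) (S : Fin 3 → Set X),
      IsBalancedGKTrisection X 3 1 S →
      (∃ c c' : Set X, IsCurve S c ∧ IsCurve S c' ∧ Disjoint c c' ∧
        IsNonSeparating S c ∧ IsNonSeparating S c' ∧
        BoundsDisc S (spineHandlebody S 0) c ∧ BoundsDisc S (spineHandlebody S 1) c' ∧
        BoundsDisc S (spineHandlebody S 2) c') →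
      ¬ IsReducible S →
      ∃ (X' : Type) (_ : TopologicalSpace X') (_ : T2Space X') (_ : SecondCountableTopology X')
        (_ : ChartedSpace (𝔼 4) X') (_ : IsManifold (𝓡 4) ∞ X')
        (k' : Fin 3 → ℕ) (S' : Fin 3 → Set X')
        (ℓ : Metric.sphere (0 : EuclideanSpace ℝ (Fin 2)) 1 → X'),
        IsGKTrisection X' 2 k' S' ∧ (∃ i, 2 ≤ k' i + 1) ∧
          Manifold.IsSmoothEmbedding (𝓡 1) (𝓡 4) ∞ ℓ ∧ IsCircleSurgery (𝓡 4) (𝓡 4) X' X ℓ)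
    (h38 : ∀ (M : Type) [TopologicalSpace M] [T2Space M] [SecondCountableTopology M]
      [ChartedSpace (𝔼 4) M] [IsManifold (𝓡 4) ∞ M],
      M ≃ₕ 𝕊 4 → ∀ T : Fin 3 → Set M, IsGKTrisection M 3 (fun _ => 1) T →
      ∀ i j : Fin 3, i ≠ j → ∀ a b : Set M, IsCurve T a → IsCurve T b →
      BoundsDisc T (spineHandlebody T i) a → BoundsDisc T (spineHandlebody T j) b →
      Disjoint a b → IsNonSeparating T a → IsNonSeparating T b →
      ¬ IsConnected (centralSurfaceSet T \ (a ∪ b)) →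
      BoundsDisc T (spineHandlebody T j) a ∨ BoundsDisc T (spineHandlebody T i) b)
    (hP : ∀ (M : Type) [TopologicalSpace M] [T2Space M] [SecondCountableTopology M]
      [ChartedSpace (𝔼 4) M] [IsManifold (𝓡 4) ∞ M],
      M ≃ₕ 𝕊 4 → ∀ T : Fin 3 → Set M, IsGKTrisection M 3 (fun _ => 1) T →
      ∀ f : Fin 3 → Set M,
      ((∀ i, IsCurve T (f i)) ∧ (Pairwise fun i j => Disjoint (f i) (f j)) ∧
        (∀ i, IsNonSeparating T (f i)) ∧ (∀ i, BoundsDisc T (spineHandlebody T i) (f i)) ∧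
        (∀ i j, i ≠ j → IsConnected (centralSurfaceSet T \ (f i ∪ f j))) ∧
        ¬ IsPreconnected (centralSurfaceSet T \ ⋃ i, f i)) →
      ¬ IsWeaklyReducible T →
      ∃ (X' : Type) (_ : TopologicalSpace X') (_ : T2Space X') (_ : SecondCountableTopology X')
        (_ : ChartedSpace (𝔼 4) X') (_ : IsManifold (𝓡 4) ∞ X')
        (k' : Fin 3 → ℕ) (T' : Fin 3 → Set X')
        (ℓ : Metric.sphere (0 : EuclideanSpace ℝ (Fin 2)) 1 → X'),
        IsGKTrisection X' 2 k' T' ∧ (∃ i, 2 ≤ k' i + 1) ∧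
          Manifold.IsSmoothEmbedding (𝓡 1) (𝓡 4) ∞ ℓ ∧ IsCircleSurgery (𝓡 4) (𝓡 4) X' M ℓ) :
    arandaZupan_dependentTriple_genusThree_homotopySphere :=
  arandaZupan_dependentTriple_genusThree_homotopySphere_of_classification_of_sep_of_loopSurgery_of_fiveChainSurgery_of_separatingPair_of_loopPartner
    hC hsep₀
    (msz_loopSurgery_homotopySphere_gk_of_classification
      (msz_trisection_classification_gk_of_univ hC)) h5 h38 hP

end LoopSurgeryDischarged

/-! ### The two loop-partner inputs in their weakest form: a loop partner of genus `≤ 2`, with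
### no Meier–Schirmer–Zupan range clause and no smoothness of the loop

Both the five-chain surgery step `h5` (the inline input of the Thm. 1.3 fact) and the
loop-partner step `hP` (configuration (3) of §7) conclude, as printed (Lemma 5.4, p. 19:
"`(Σ_{α₁}; α′, β′, γ′)` is a `(g − 1; k₁, k₂, k₃ + 1)`-trisection diagram for a `4`-manifold
`X′`"; Prop. 5.5, p. 20), with a loop partner `X′` carrying a genus-`2` GK-trisection IN THE MSZ
RANGE `∃ i, 2 ≤ k′ᵢ + 1` and a SMOOTHLY EMBEDDED loop `ℓ`, because that is what the loop-surgery
fact consumes.  For a HOMOTOPY 4-SPHERE `M` this bookkeeping is free once `X′` carries SOME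
GK-trisection of genus `g′ ≤ 2` (`mszRange_of_genus_le_two_of_isCircleSurgery_homotopySphere`):
`ℓ` is the core of the surgery's tubular neighbourhood, hence a smooth embedding
(`CircleNbhd.isSmoothEmbedding_core`); `X′` is compact and connected, being trisected
(`IsGKTrisection.compactSpace` / `.connectedSpace`), and orientable
(`isOrientable_of_isCircleSurgery_four_holds`, `M` being orientable by
`isOrientable_of_homotopyEquiv_sphere_four_holds`); so `k′₀ + k′₁ + k′₂ = g′ + 2`
(`gkTrisection_sum_eq_add_two_of_loopSurgery_homotopySphere_holds`: `χ(X′) = χ(M) − 2 = 0`,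
Gay–Kirby Remark 2, Meier–Schirmer–Zupan Remark 3.12), and a sum `g′ + 2 ≤ 4` of three naturals
has a term `≥ g′ − 1`.  (The Summits-side line
`Cruxes/DependentTripleGenusThreeStandard/Lines/Sketch.lean` registered its apex stub in this
weakened shape, `stub_loopPartnerNoRange`, by the same derivation; this section records the
weakening Literature-side, for all types `k`, and for `h5` as well.)  Contents: the endgame for a
genus-`≤ 2` loop partner (`nonempty_diffeomorph_sphere_of_isCircleSurgery_of_genus_le_two`); the
pants-triple statement `hp` at each type from the UNRANGED loop-partner step `hP♭`
(`pantsTriple_of_loopSurgery_of_loopPartnerNoRange_type`); the Thm. 1.3 fact's irreducible core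
from the UNRANGED five-chain surgery step `h5♭`, asked for homotopy spheres only
(`irreducibleCore_zero_of_loopSurgery_of_fiveChainSurgeryNoRange`); the two implications "ranged
⇒ unranged" (`loopPartnerNoRange_of_loopPartner_type`, `fiveChainSurgeryNoRange_of_fiveChainSurgery`);
the balanced Thm.-1.3-road assembly
(`…_of_az2025_of_msz_of_separatingPair_of_loopSurgery_of_loopPartnerNoRange_balanced` — the
composition of the registered Summits skeleton — and its classification form); and **the
standing of the fact with both loop-partner inputs unranged**
(`…_of_classification_of_sep_of_fiveChainSurgeryNoRange_of_separatingPair_of_loopPartnerNoRange`):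
`msz_trisection_classification_gk` (any universe),
`Trisection.isConnectedSum_of_reducing_separating.{0}`, and inline `h5♭`, `h38`, `hP♭`.
-/

section NoRange

open Trisection

universe u₁₇ u₁₈ u₁₉

/-- **The Meier–Schirmer–Zupan range of a genus-`≤ 2` loop partner of a homotopy 4-sphere is
automatic** (PROVED; the type half of Aranda–Zupan's Lemma 5.4 for free).  If `M ≃ₕ S⁴` is a
circle surgery on a loop `ℓ` of `X′` and `X′` carries a `(g′; k′)`-GK-trisection with `g′ ≤ 2`,
then `∃ i, g′ ≤ k′ i + 1`: `k′₀ + k′₁ + k′₂ = g′ + 2`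
(`gkTrisection_sum_eq_add_two_of_loopSurgery_homotopySphere_holds`, with `X′` compact and
connected — trisected —, orientable — `isOrientable_of_isCircleSurgery_four_holds` over
`isOrientable_of_homotopyEquiv_sphere_four_holds` —, and `ℓ` smooth as the core of the surgery's
tubular neighbourhood, `CircleNbhd.isSmoothEmbedding_core`), then pigeonhole.
[cite: GayKirby2016, Remark 2] [cite: MeierSchirmerZupan2016, Remark 3.12] [cite: ArandaZupan2025, Lemma 5.4 (p. 19)] -/
theorem mszRange_of_genus_le_two_of_isCircleSurgery_homotopySphere
    {X' : Type} [TopologicalSpace X'] [T2Space X'] [SecondCountableTopology X']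
    [ChartedSpace (𝔼 4) X'] [IsManifold (𝓡 4) ∞ X']
    {g' : ℕ} {k' : Fin 3 → ℕ} {T' : Fin 3 → Set X'} (hg' : g' ≤ 2)
    (hT' : IsGKTrisection X' g' k' T')
    {ℓ : Metric.sphere (0 : EuclideanSpace ℝ (Fin 2)) 1 → X'}
    {M : Type} [TopologicalSpace M] [T2Space M] [SecondCountableTopology M]
    [ChartedSpace (𝔼 4) M] [IsManifold (𝓡 4) ∞ M] (e : M ≃ₕ 𝕊 4)
    (hs : IsCircleSurgery (𝓡 4) (𝓡 4) X' M ℓ) : ∃ i, g' ≤ k' i + 1 := by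
  have hℓ : Manifold.IsSmoothEmbedding (𝓡 1) (𝓡 4) ∞ ℓ := by
    obtain ⟨ν, -⟩ := hs
    exact ν.isSmoothEmbedding_core
  haveI : CompactSpace X' := hT'.compactSpace
  haveI : ConnectedSpace X' := hT'.connectedSpace
  have hM : IsOrientable (𝓡 4) M := isOrientable_of_homotopyEquiv_sphere_four_holds M e
  have hX' : IsOrientable (𝓡 4) X' := isOrientable_of_isCircleSurgery_four_holds X' ℓ M hs hM
  have hsum : k' 0 + k' 1 + k' 2 = g' + 2 :=
    gkTrisection_sum_eq_add_two_of_loopSurgery_homotopySphere_holds X' hX' g' k' T' hT' ℓ hℓ M e hs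
  by_contra h
  push Not at h
  have h0 := h 0
  have h1 := h 1
  have h2 := h 2
  omega

/-- **The loop-surgery endgame for a genus-`≤ 2` loop partner (PROVED glue).**  GIVEN the
loop-surgery fact, a homotopy 4-sphere `M` which is a circle surgery on a loop of some `X′`
carrying a GK-trisection of genus `g′ ≤ 2` (any type) is `≅ S⁴`:
`Literature.Barriers.SmoothPoincare4.nonempty_diffeomorph_sphere_of_isCircleSurgery_of_mszRange`
with the range supplied by `mszRange_of_genus_le_two_of_isCircleSurgery_homotopySphere` and the
smoothness of `ℓ` by `CircleNbhd.isSmoothEmbedding_core`.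
[cite: MeierSchirmerZupan2016, Thm. 1.2] [cite: ArandaZupan2025, §2 p. 7, Lemma 5.4 and Prop. 5.5 (pp. 19–20)] -/
theorem nonempty_diffeomorph_sphere_of_isCircleSurgery_of_genus_le_two
    (hL : msz_loopSurgery_homotopySphere_gk)
    {X' : Type} [TopologicalSpace X'] [T2Space X'] [SecondCountableTopology X']
    [ChartedSpace (𝔼 4) X'] [IsManifold (𝓡 4) ∞ X']
    {g' : ℕ} {k' : Fin 3 → ℕ} {T' : Fin 3 → Set X'} (hg' : g' ≤ 2)
    (hT' : IsGKTrisection X' g' k' T')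
    {ℓ : Metric.sphere (0 : EuclideanSpace ℝ (Fin 2)) 1 → X'}
    {M : Type} [TopologicalSpace M] [T2Space M] [SecondCountableTopology M]
    [ChartedSpace (𝔼 4) M] [IsManifold (𝓡 4) ∞ M]
    (hs : IsCircleSurgery (𝓡 4) (𝓡 4) X' M ℓ) (e : M ≃ₕ 𝕊 4) :
    Nonempty (M ≃ₘ⟮𝓡 4, 𝓡 4⟯ 𝕊 4) := by
  have hℓ : Manifold.IsSmoothEmbedding (𝓡 1) (𝓡 4) ∞ ℓ := by
    obtain ⟨ν, -⟩ := hs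
    exact ν.isSmoothEmbedding_core
  exact Literature.Barriers.SmoothPoincare4.nonempty_diffeomorph_sphere_of_isCircleSurgery_of_mszRange
    hL hT' (mszRange_of_genus_le_two_of_isCircleSurgery_homotopySphere hg' hT' e hs) hℓ hs e

/-- **The pants-triple statement for one type `(3; k)` from the loop-surgery fact and the
UNRANGED loop-partner step `hP♭` (PROVED glue).**  `hP♭` at type `k`: a `(3; k)`-trisected
`M ≃ₕ S⁴` with a pants-type triple that is not weakly reducible is a circle surgery on a loop of
some smooth `X′ : Type` carrying a GK-trisection of genus `g′ ≤ 2` — ANY type `k′`, no range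
clause, no smoothness of `ℓ` (at `k = (1,1,1)` verbatim the registered Summits stub
`stub_loopPartnerNoRange`).  It yields the same `hp` as the ranged step `hP` of
`pantsTriple_of_loopSurgery_of_loopPartner_type`, by
`nonempty_diffeomorph_sphere_of_isCircleSurgery_of_genus_le_two`.
[cite: ArandaZupan2025, §7 (pp. 25–26), Lemma 5.4 and Prop. 5.5 (pp. 19–20)] [cite: MeierSchirmerZupan2016, Thm. 1.2] -/
theorem pantsTriple_of_loopSurgery_of_loopPartnerNoRange_type
    (hL : msz_loopSurgery_homotopySphere_gk) (k : Fin 3 → ℕ)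
    (hP : ∀ (M : Type) [TopologicalSpace M] [T2Space M] [SecondCountableTopology M]
      [ChartedSpace (𝔼 4) M] [IsManifold (𝓡 4) ∞ M],
      M ≃ₕ 𝕊 4 → ∀ T : Fin 3 → Set M, IsGKTrisection M 3 k T →
      ∀ f : Fin 3 → Set M,
      ((∀ i, IsCurve T (f i)) ∧ (Pairwise fun i j => Disjoint (f i) (f j)) ∧
        (∀ i, IsNonSeparating T (f i)) ∧ (∀ i, BoundsDisc T (spineHandlebody T i) (f i)) ∧
        (∀ i j, i ≠ j → IsConnected (centralSurfaceSet T \ (f i ∪ f j))) ∧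
        ¬ IsPreconnected (centralSurfaceSet T \ ⋃ i, f i)) →
      ¬ IsWeaklyReducible T →
      ∃ (X' : Type) (_ : TopologicalSpace X') (_ : T2Space X') (_ : SecondCountableTopology X')
        (_ : ChartedSpace (𝔼 4) X') (_ : IsManifold (𝓡 4) ∞ X')
        (g' : ℕ) (k' : Fin 3 → ℕ) (T' : Fin 3 → Set X')
        (ℓ : Metric.sphere (0 : EuclideanSpace ℝ (Fin 2)) 1 → X'),
        g' ≤ 2 ∧ IsGKTrisection X' g' k' T' ∧ IsCircleSurgery (𝓡 4) (𝓡 4) X' M ℓ)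
    (M : Type) [TopologicalSpace M] [T2Space M] [SecondCountableTopology M]
    [ChartedSpace (𝔼 4) M] [IsManifold (𝓡 4) ∞ M] (e : M ≃ₕ 𝕊 4) (T : Fin 3 → Set M)
    (hT : IsGKTrisection M 3 k T) (f : Fin 3 → Set M)
    (hf : (∀ i, IsCurve T (f i)) ∧ (Pairwise fun i j => Disjoint (f i) (f j)) ∧
      (∀ i, IsNonSeparating T (f i)) ∧ (∀ i, BoundsDisc T (spineHandlebody T i) (f i)) ∧
      (∀ i j, i ≠ j → IsConnected (centralSurfaceSet T \ (f i ∪ f j))) ∧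
      ¬ IsPreconnected (centralSurfaceSet T \ ⋃ i, f i))
    (hwr : ¬ IsWeaklyReducible T) : Nonempty (M ≃ₘ⟮𝓡 4, 𝓡 4⟯ 𝕊 4) := by
  obtain ⟨X', _, _, _, _, _, g', k', T', ℓ, hg', hT', hs⟩ := hP M e T hT f hf hwr
  exact nonempty_diffeomorph_sphere_of_isCircleSurgery_of_genus_le_two hL hg' hT' hs e

/-- **The ranged loop-partner step implies the unranged one**, for each type `k` (PROVED,
trivially: take `g′ = 2`, forget the range clause and the smoothness of `ℓ`) — so each assembly
over `hP♭` below is at least as strong as its counterpart over `hP`.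
[cite: ArandaZupan2025, §7 (pp. 25–26), Lemma 5.4 and Prop. 5.5 (pp. 19–20)] -/
theorem loopPartnerNoRange_of_loopPartner_type (k : Fin 3 → ℕ)
    (hP : ∀ (M : Type) [TopologicalSpace M] [T2Space M] [SecondCountableTopology M]
      [ChartedSpace (𝔼 4) M] [IsManifold (𝓡 4) ∞ M],
      M ≃ₕ 𝕊 4 → ∀ T : Fin 3 → Set M, IsGKTrisection M 3 k T →
      ∀ f : Fin 3 → Set M,
      ((∀ i, IsCurve T (f i)) ∧ (Pairwise fun i j => Disjoint (f i) (f j)) ∧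
        (∀ i, IsNonSeparating T (f i)) ∧ (∀ i, BoundsDisc T (spineHandlebody T i) (f i)) ∧
        (∀ i j, i ≠ j → IsConnected (centralSurfaceSet T \ (f i ∪ f j))) ∧
        ¬ IsPreconnected (centralSurfaceSet T \ ⋃ i, f i)) →
      ¬ IsWeaklyReducible T →
      ∃ (X' : Type) (_ : TopologicalSpace X') (_ : T2Space X') (_ : SecondCountableTopology X')
        (_ : ChartedSpace (𝔼 4) X') (_ : IsManifold (𝓡 4) ∞ X')
        (k' : Fin 3 → ℕ) (T' : Fin 3 → Set X')
        (ℓ : Metric.sphere (0 : EuclideanSpace ℝ (Fin 2)) 1 → X'),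
        IsGKTrisection X' 2 k' T' ∧ (∃ i, 2 ≤ k' i + 1) ∧
          Manifold.IsSmoothEmbedding (𝓡 1) (𝓡 4) ∞ ℓ ∧ IsCircleSurgery (𝓡 4) (𝓡 4) X' M ℓ) :
    ∀ (M : Type) [TopologicalSpace M] [T2Space M] [SecondCountableTopology M]
      [ChartedSpace (𝔼 4) M] [IsManifold (𝓡 4) ∞ M],
      M ≃ₕ 𝕊 4 → ∀ T : Fin 3 → Set M, IsGKTrisection M 3 k T →
      ∀ f : Fin 3 → Set M,
      ((∀ i, IsCurve T (f i)) ∧ (Pairwise fun i j => Disjoint (f i) (f j)) ∧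
        (∀ i, IsNonSeparating T (f i)) ∧ (∀ i, BoundsDisc T (spineHandlebody T i) (f i)) ∧
        (∀ i j, i ≠ j → IsConnected (centralSurfaceSet T \ (f i ∪ f j))) ∧
        ¬ IsPreconnected (centralSurfaceSet T \ ⋃ i, f i)) →
      ¬ IsWeaklyReducible T →
      ∃ (X' : Type) (_ : TopologicalSpace X') (_ : T2Space X') (_ : SecondCountableTopology X')
        (_ : ChartedSpace (𝔼 4) X') (_ : IsManifold (𝓡 4) ∞ X')
        (g' : ℕ) (k' : Fin 3 → ℕ) (T' : Fin 3 → Set X')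
        (ℓ : Metric.sphere (0 : EuclideanSpace ℝ (Fin 2)) 1 → X'),
        g' ≤ 2 ∧ IsGKTrisection X' g' k' T' ∧ IsCircleSurgery (𝓡 4) (𝓡 4) X' M ℓ := by
  intro M _ _ _ _ _ e T hT f hf hwr
  obtain ⟨X', _, _, _, _, _, k', T', ℓ, hT', -, -, hs⟩ := hP M e T hT f hf hwr
  exact ⟨X', ‹_›, ‹_›, ‹_›, ‹_›, ‹_›, 2, k', T', ℓ, le_rfl, hT', hs⟩

/-- **The Thm. 1.3 fact's irreducible core at universe `0` from the loop-surgery fact and the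
UNRANGED five-chain surgery step `h5♭`, asked for homotopy spheres only (PROVED glue).**  `h5♭`:
a closed connected oriented `X : Type` with a balanced `(3; 1)`-trisection carrying a weak
reduction (`c ⊂ H_0`-disc; `c′ ⊂ H_1`- and `H_2`-discs, fixed labels) and no reducing curve,
which is HOMOTOPY EQUIVALENT TO `S⁴`, is a circle surgery on a loop of some smooth `X′ : Type`
with a GK-trisection of genus `g′ ≤ 2` (Thm. 1.3 first part "either `𝒯` is reducible or `𝒯`
contains a five-chain" + Lemma 5.4 + Prop. 5.5, type bookkeeping dropped, specialised to
homotopy spheres).  Output: verbatim the hypothesis `hirr₀` of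
`Literature.Barriers.SmoothPoincare4.az2025_weaklyReducible_genusThree_homotopySphere_gk_of_classification_of_sep_zero_of_irreducible_zero`
(as produced from the ranged `h5` by
`Literature.Barriers.SmoothPoincare4.az2025_irreducibleCore_zero_of_loopSurgery_of_fiveChainSurgery`).
[cite: ArandaZupan2025, Thm. 1.3 (p. 2), Lemma 5.4 and Prop. 5.5 (pp. 19–20), §6 (p. 24)] [cite: MeierSchirmerZupan2016, Thm. 1.2] -/
theorem irreducibleCore_zero_of_loopSurgery_of_fiveChainSurgeryNoRange
    (hL : msz_loopSurgery_homotopySphere_gk)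
    (h5 : ∀ (X : Type) [TopologicalSpace X] [T2Space X] [SecondCountableTopology X]
      [ChartedSpace (𝔼 4) X] [IsManifold (𝓡 4) ∞ X] [CompactSpace X]
      [ConnectedSpace X] (_ : SmoothOrientation (𝓡 4) X) (S : Fin 3 → Set X),
      IsBalancedGKTrisection X 3 1 S →
      (∃ c c' : Set X, IsCurve S c ∧ IsCurve S c' ∧ Disjoint c c' ∧
        IsNonSeparating S c ∧ IsNonSeparating S c' ∧
        BoundsDisc S (spineHandlebody S 0) c ∧ BoundsDisc S (spineHandlebody S 1) c' ∧
        BoundsDisc S (spineHandlebody S 2) c') →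
      ¬ IsReducible S → X ≃ₕ 𝕊 4 →
      ∃ (X' : Type) (_ : TopologicalSpace X') (_ : T2Space X') (_ : SecondCountableTopology X')
        (_ : ChartedSpace (𝔼 4) X') (_ : IsManifold (𝓡 4) ∞ X')
        (g' : ℕ) (k' : Fin 3 → ℕ) (S' : Fin 3 → Set X')
        (ℓ : Metric.sphere (0 : EuclideanSpace ℝ (Fin 2)) 1 → X'),
        g' ≤ 2 ∧ IsGKTrisection X' g' k' S' ∧ IsCircleSurgery (𝓡 4) (𝓡 4) X' X ℓ) :
    ∀ (X : Type) [TopologicalSpace X] [T2Space X] [SecondCountableTopology X]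
      [ChartedSpace (𝔼 4) X] [IsManifold (𝓡 4) ∞ X] [CompactSpace X]
      [ConnectedSpace X] (_ : SmoothOrientation (𝓡 4) X) (S : Fin 3 → Set X),
      IsBalancedGKTrisection X 3 1 S →
      (∃ c c' : Set X, IsCurve S c ∧ IsCurve S c' ∧ Disjoint c c' ∧
        IsNonSeparating S c ∧ IsNonSeparating S c' ∧
        BoundsDisc S (spineHandlebody S 0) c ∧ BoundsDisc S (spineHandlebody S 1) c' ∧
        BoundsDisc S (spineHandlebody S 2) c') →
      ¬ IsReducible S → X ≃ₕ 𝕊 4 → Nonempty (X ≃ₘ⟮𝓡 4, 𝓡 4⟯ 𝕊 4) := by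
  intro X _ _ _ _ _ _ _ o S hT hwr hirr e
  obtain ⟨X', _, _, _, _, _, g', k', S', ℓ, hg', hT', hs⟩ := h5 X o S hT hwr hirr e
  exact nonempty_diffeomorph_sphere_of_isCircleSurgery_of_genus_le_two hL hg' hT' hs e

/-- **The ranged five-chain surgery step implies the unranged one** (PROVED, trivially: take
`g′ = 2`, forget the range clause, the smoothness of `ℓ` and the homotopy equivalence) — so the
standing of the fact over `h5♭` below is at least as strong as the one over `h5`.
[cite: ArandaZupan2025, Thm. 1.3 (p. 2), Lemma 5.4 and Prop. 5.5 (pp. 19–20)] -/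
theorem fiveChainSurgeryNoRange_of_fiveChainSurgery
    (h5 : ∀ (X : Type) [TopologicalSpace X] [T2Space X] [SecondCountableTopology X]
      [ChartedSpace (𝔼 4) X] [IsManifold (𝓡 4) ∞ X] [CompactSpace X]
      [ConnectedSpace X] (_ : SmoothOrientation (𝓡 4) X) (S : Fin 3 → Set X),
      IsBalancedGKTrisection X 3 1 S →
      (∃ c c' : Set X, IsCurve S c ∧ IsCurve S c' ∧ Disjoint c c' ∧
        IsNonSeparating S c ∧ IsNonSeparating S c' ∧
        BoundsDisc S (spineHandlebody S 0) c ∧ BoundsDisc S (spineHandlebody S 1) c' ∧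
        BoundsDisc S (spineHandlebody S 2) c') →
      ¬ IsReducible S →
      ∃ (X' : Type) (_ : TopologicalSpace X') (_ : T2Space X') (_ : SecondCountableTopology X')
        (_ : ChartedSpace (𝔼 4) X') (_ : IsManifold (𝓡 4) ∞ X')
        (k' : Fin 3 → ℕ) (S' : Fin 3 → Set X')
        (ℓ : Metric.sphere (0 : EuclideanSpace ℝ (Fin 2)) 1 → X'),
        IsGKTrisection X' 2 k' S' ∧ (∃ i, 2 ≤ k' i + 1) ∧
          Manifold.IsSmoothEmbedding (𝓡 1) (𝓡 4) ∞ ℓ ∧ IsCircleSurgery (𝓡 4) (𝓡 4) X' X ℓ) :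
    ∀ (X : Type) [TopologicalSpace X] [T2Space X] [SecondCountableTopology X]
      [ChartedSpace (𝔼 4) X] [IsManifold (𝓡 4) ∞ X] [CompactSpace X]
      [ConnectedSpace X] (_ : SmoothOrientation (𝓡 4) X) (S : Fin 3 → Set X),
      IsBalancedGKTrisection X 3 1 S →
      (∃ c c' : Set X, IsCurve S c ∧ IsCurve S c' ∧ Disjoint c c' ∧
        IsNonSeparating S c ∧ IsNonSeparating S c' ∧
        BoundsDisc S (spineHandlebody S 0) c ∧ BoundsDisc S (spineHandlebody S 1) c' ∧
        BoundsDisc S (spineHandlebody S 2) c') →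
      ¬ IsReducible S → X ≃ₕ 𝕊 4 →
      ∃ (X' : Type) (_ : TopologicalSpace X') (_ : T2Space X') (_ : SecondCountableTopology X')
        (_ : ChartedSpace (𝔼 4) X') (_ : IsManifold (𝓡 4) ∞ X')
        (g' : ℕ) (k' : Fin 3 → ℕ) (S' : Fin 3 → Set X')
        (ℓ : Metric.sphere (0 : EuclideanSpace ℝ (Fin 2)) 1 → X'),
        g' ≤ 2 ∧ IsGKTrisection X' g' k' S' ∧ IsCircleSurgery (𝓡 4) (𝓡 4) X' X ℓ := by
  intro X _ _ _ _ _ _ _ o S hT hwr hirr _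
  obtain ⟨X', _, _, _, _, _, k', S', ℓ, hT', -, -, hs⟩ := h5 X o S hT hwr hirr
  exact ⟨X', ‹_›, ‹_›, ‹_›, ‹_›, ‹_›, 2, k', S', ℓ, le_rfl, hT', hs⟩

/-- **Balanced Thm.-1.3-road form over the UNRANGED loop-partner step (PROVED glue): the fact
from the Thm. 1.3 fact and `msz_homotopySphere_gk` (catalogue forms, any universes), the
loop-surgery fact, the separating-pair lemma `h38` and `hP♭`, both for balanced `(3; 1,1,1)`
homotopy spheres** — `…_of_facts_of_notWeaklyReducible` fed with
`notWeaklyReducibleCore_of_separatingPair_of_pantsTriple_type (fun _ => 1)` over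
`pantsTriple_of_loopSurgery_of_loopPartnerNoRange_type`; this is, Literature-side, the composition
`arandaZupan_dependentTriple_of_stubs` of the registered Summits skeleton (stubs: the Thm. 1.3
fact, the classification — feeding `msz_homotopySphere_gk` and the loop-surgery fact —, `h38`,
`hP♭`).
[cite: ArandaZupan2025, Thm. 1.3, Thm. 1.4 (p. 2), §2 (p. 6), Lemma 3.8 (p. 10), Lemma 5.4, Prop. 5.5 (pp. 19–20) and §7 (pp. 24–26)] [cite: MeierSchirmerZupan2016, Thm. 1.2] -/
theorem arandaZupan_dependentTriple_genusThree_homotopySphere_of_az2025_of_msz_of_separatingPair_of_loopSurgery_of_loopPartnerNoRange_balanced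
    (hAZ : Literature.Barriers.SmoothPoincare4.az2025_weaklyReducible_genusThree_homotopySphere_gk.{u₁₇})
    (hMSZ : Literature.Barriers.SmoothPoincare4.msz_homotopySphere_gk.{u₁₈})
    (h38 : ∀ (M : Type) [TopologicalSpace M] [T2Space M] [SecondCountableTopology M]
      [ChartedSpace (𝔼 4) M] [IsManifold (𝓡 4) ∞ M],
      M ≃ₕ 𝕊 4 → ∀ T : Fin 3 → Set M, IsGKTrisection M 3 (fun _ => 1) T →
      ∀ i j : Fin 3, i ≠ j → ∀ a b : Set M, IsCurve T a → IsCurve T b →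
      BoundsDisc T (spineHandlebody T i) a → BoundsDisc T (spineHandlebody T j) b →
      Disjoint a b → IsNonSeparating T a → IsNonSeparating T b →
      ¬ IsConnected (centralSurfaceSet T \ (a ∪ b)) →
      BoundsDisc T (spineHandlebody T j) a ∨ BoundsDisc T (spineHandlebody T i) b)
    (hL : msz_loopSurgery_homotopySphere_gk)
    (hP : ∀ (M : Type) [TopologicalSpace M] [T2Space M] [SecondCountableTopology M]
      [ChartedSpace (𝔼 4) M] [IsManifold (𝓡 4) ∞ M],
      M ≃ₕ 𝕊 4 → ∀ T : Fin 3 → Set M, IsGKTrisection M 3 (fun _ => 1) T →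
      ∀ f : Fin 3 → Set M,
      ((∀ i, IsCurve T (f i)) ∧ (Pairwise fun i j => Disjoint (f i) (f j)) ∧
        (∀ i, IsNonSeparating T (f i)) ∧ (∀ i, BoundsDisc T (spineHandlebody T i) (f i)) ∧
        (∀ i j, i ≠ j → IsConnected (centralSurfaceSet T \ (f i ∪ f j))) ∧
        ¬ IsPreconnected (centralSurfaceSet T \ ⋃ i, f i)) →
      ¬ IsWeaklyReducible T →
      ∃ (X' : Type) (_ : TopologicalSpace X') (_ : T2Space X') (_ : SecondCountableTopology X')
        (_ : ChartedSpace (𝔼 4) X') (_ : IsManifold (𝓡 4) ∞ X')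
        (g' : ℕ) (k' : Fin 3 → ℕ) (T' : Fin 3 → Set X')
        (ℓ : Metric.sphere (0 : EuclideanSpace ℝ (Fin 2)) 1 → X'),
        g' ≤ 2 ∧ IsGKTrisection X' g' k' T' ∧ IsCircleSurgery (𝓡 4) (𝓡 4) X' M ℓ) :
    arandaZupan_dependentTriple_genusThree_homotopySphere :=
  arandaZupan_dependentTriple_genusThree_homotopySphere_of_facts_of_notWeaklyReducible
    (Literature.Barriers.SmoothPoincare4.az2025_weaklyReducible_genusThree_homotopySphere_gk_iff_routeShape_univ.mp
      hAZ)
    (Literature.Barriers.SmoothPoincare4.msz_homotopySphere_gk_of_univ hMSZ)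
    (notWeaklyReducibleCore_of_separatingPair_of_pantsTriple_type (fun _ => 1) h38
      (pantsTriple_of_loopSurgery_of_loopPartnerNoRange_type hL (fun _ => 1) hP))

/-- **The same over the Meier–Schirmer–Zupan CLASSIFICATION (any universe) in place of both
`msz_homotopySphere_gk` and the loop-surgery fact** (PROVED glue:
`msz_homotopySphere_gk_of_classification_univ`, `msz_loopSurgery_homotopySphere_gk_of_classification`
over `msz_trisection_classification_gk_of_univ`): the fact from the Thm. 1.3 fact, `h38`, the
classification and `hP♭` — the registered Summits skeleton with its stub 2 fanned out.
[cite: ArandaZupan2025, Thm. 1.3, Thm. 1.4 (p. 2), §2 (p. 6), Lemma 3.8 (p. 10), Lemma 5.4, Prop. 5.5 (pp. 19–20) and §7 (pp. 24–26)] [cite: MeierSchirmerZupan2016, Thm. 1.2] -/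
theorem arandaZupan_dependentTriple_genusThree_homotopySphere_of_az2025_of_separatingPair_of_classification_of_loopPartnerNoRange_balanced
    (hAZ : Literature.Barriers.SmoothPoincare4.az2025_weaklyReducible_genusThree_homotopySphere_gk.{u₁₇})
    (h38 : ∀ (M : Type) [TopologicalSpace M] [T2Space M] [SecondCountableTopology M]
      [ChartedSpace (𝔼 4) M] [IsManifold (𝓡 4) ∞ M],
      M ≃ₕ 𝕊 4 → ∀ T : Fin 3 → Set M, IsGKTrisection M 3 (fun _ => 1) T →
      ∀ i j : Fin 3, i ≠ j → ∀ a b : Set M, IsCurve T a → IsCurve T b →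
      BoundsDisc T (spineHandlebody T i) a → BoundsDisc T (spineHandlebody T j) b →
      Disjoint a b → IsNonSeparating T a → IsNonSeparating T b →
      ¬ IsConnected (centralSurfaceSet T \ (a ∪ b)) →
      BoundsDisc T (spineHandlebody T j) a ∨ BoundsDisc T (spineHandlebody T i) b)
    (hC : msz_trisection_classification_gk.{u₁₉})
    (hP : ∀ (M : Type) [TopologicalSpace M] [T2Space M] [SecondCountableTopology M]
      [ChartedSpace (𝔼 4) M] [IsManifold (𝓡 4) ∞ M],
      M ≃ₕ 𝕊 4 → ∀ T : Fin 3 → Set M, IsGKTrisection M 3 (fun _ => 1) T →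
      ∀ f : Fin 3 → Set M,
      ((∀ i, IsCurve T (f i)) ∧ (Pairwise fun i j => Disjoint (f i) (f j)) ∧
        (∀ i, IsNonSeparating T (f i)) ∧ (∀ i, BoundsDisc T (spineHandlebody T i) (f i)) ∧
        (∀ i j, i ≠ j → IsConnected (centralSurfaceSet T \ (f i ∪ f j))) ∧
        ¬ IsPreconnected (centralSurfaceSet T \ ⋃ i, f i)) →
      ¬ IsWeaklyReducible T →
      ∃ (X' : Type) (_ : TopologicalSpace X') (_ : T2Space X') (_ : SecondCountableTopology X')
        (_ : ChartedSpace (𝔼 4) X') (_ : IsManifold (𝓡 4) ∞ X')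
        (g' : ℕ) (k' : Fin 3 → ℕ) (T' : Fin 3 → Set X')
        (ℓ : Metric.sphere (0 : EuclideanSpace ℝ (Fin 2)) 1 → X'),
        g' ≤ 2 ∧ IsGKTrisection X' g' k' T' ∧ IsCircleSurgery (𝓡 4) (𝓡 4) X' M ℓ) :
    arandaZupan_dependentTriple_genusThree_homotopySphere :=
  arandaZupan_dependentTriple_genusThree_homotopySphere_of_az2025_of_msz_of_separatingPair_of_loopSurgery_of_loopPartnerNoRange_balanced
    hAZ
    (Literature.Barriers.SmoothPoincare4.msz_homotopySphere_gk_of_classification_univ hC :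
      Literature.Barriers.SmoothPoincare4.msz_homotopySphere_gk.{0})
    h38
    (msz_loopSurgery_homotopySphere_gk_of_classification
      (msz_trisection_classification_gk_of_univ hC))
    hP

/-- **The standing of the fact, weakest form (PROVED glue): TWO tracked named facts and three
Aranda–Zupan-specific steps, both loop-partner steps UNRANGED.**  The fact follows from the
Meier–Schirmer–Zupan classification `msz_trisection_classification_gk` (any universe), the
separating splitting fact `Trisection.isConnectedSum_of_reducing_separating.{0}`, and — inline,
none with a counterpart in the tree, none vendored (D-0026) — the UNRANGED five-chain surgery
step `h5♭` for weak reductions of balanced `(3; 1)`-trisected homotopy spheres (Thm. 1.3 first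
part + Lemma 5.4 + Prop. 5.5; through `irreducibleCore_zero_of_loopSurgery_of_fiveChainSurgeryNoRange`
and `Literature.Barriers.SmoothPoincare4.az2025_weaklyReducible_genusThree_homotopySphere_gk_of_classification_of_sep_zero_of_irreducible_zero`
it supplies the Thm. 1.3 fact), the separating-pair lemma `h38` (Lemma 3.8 + the parallel case)
and the UNRANGED loop-partner step `hP♭` (§7 configuration (3) through Prop. 5.5), the last two
for balanced `(3; 1,1,1)` homotopy spheres.  By `fiveChainSurgeryNoRange_of_fiveChainSurgery` and
`loopPartnerNoRange_of_loopPartner_type` this implies the ranged standing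
`…_of_classification_of_sep_of_fiveChainSurgery_of_separatingPair_of_loopPartner`.
[cite: ArandaZupan2025, Thm. 1.3, Thm. 1.4 (p. 2), §2 (p. 6), Lemma 3.8 (p. 10), Lemma 5.4, Prop. 5.5 (pp. 19–20), §6 (pp. 20–24) and §7 (pp. 24–26)] [cite: MeierSchirmerZupan2016, Thm. 1.2] [cite: Pao1977, Thm. (S_1 ≅ S'_1 ≅ S⁴)] -/
theorem arandaZupan_dependentTriple_genusThree_homotopySphere_of_classification_of_sep_of_fiveChainSurgeryNoRange_of_separatingPair_of_loopPartnerNoRange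
    (hC : msz_trisection_classification_gk.{u₁₉})
    (hsep₀ : isConnectedSum_of_reducing_separating.{0})
    (h5 : ∀ (X : Type) [TopologicalSpace X] [T2Space X] [SecondCountableTopology X]
      [ChartedSpace (𝔼 4) X] [IsManifold (𝓡 4) ∞ X] [CompactSpace X]
      [ConnectedSpace X] (_ : SmoothOrientation (𝓡 4) X) (S : Fin 3 → Set X),
      IsBalancedGKTrisection X 3 1 S →
      (∃ c c' : Set X, IsCurve S c ∧ IsCurve S c' ∧ Disjoint c c' ∧
        IsNonSeparating S c ∧ IsNonSeparating S c' ∧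
        BoundsDisc S (spineHandlebody S 0) c ∧ BoundsDisc S (spineHandlebody S 1) c' ∧
        BoundsDisc S (spineHandlebody S 2) c') →
      ¬ IsReducible S → X ≃ₕ 𝕊 4 →
      ∃ (X' : Type) (_ : TopologicalSpace X') (_ : T2Space X') (_ : SecondCountableTopology X')
        (_ : ChartedSpace (𝔼 4) X') (_ : IsManifold (𝓡 4) ∞ X')
        (g' : ℕ) (k' : Fin 3 → ℕ) (S' : Fin 3 → Set X')
        (ℓ : Metric.sphere (0 : EuclideanSpace ℝ (Fin 2)) 1 → X'),
        g' ≤ 2 ∧ IsGKTrisection X' g' k' S' ∧ IsCircleSurgery (𝓡 4) (𝓡 4) X' X ℓ)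
    (h38 : ∀ (M : Type) [TopologicalSpace M] [T2Space M] [SecondCountableTopology M]
      [ChartedSpace (𝔼 4) M] [IsManifold (𝓡 4) ∞ M],
      M ≃ₕ 𝕊 4 → ∀ T : Fin 3 → Set M, IsGKTrisection M 3 (fun _ => 1) T →
      ∀ i j : Fin 3, i ≠ j → ∀ a b : Set M, IsCurve T a → IsCurve T b →
      BoundsDisc T (spineHandlebody T i) a → BoundsDisc T (spineHandlebody T j) b →
      Disjoint a b → IsNonSeparating T a → IsNonSeparating T b →
      ¬ IsConnected (centralSurfaceSet T \ (a ∪ b)) →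
      BoundsDisc T (spineHandlebody T j) a ∨ BoundsDisc T (spineHandlebody T i) b)
    (hP : ∀ (M : Type) [TopologicalSpace M] [T2Space M] [SecondCountableTopology M]
      [ChartedSpace (𝔼 4) M] [IsManifold (𝓡 4) ∞ M],
      M ≃ₕ 𝕊 4 → ∀ T : Fin 3 → Set M, IsGKTrisection M 3 (fun _ => 1) T →
      ∀ f : Fin 3 → Set M,
      ((∀ i, IsCurve T (f i)) ∧ (Pairwise fun i j => Disjoint (f i) (f j)) ∧
        (∀ i, IsNonSeparating T (f i)) ∧ (∀ i, BoundsDisc T (spineHandlebody T i) (f i)) ∧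
        (∀ i j, i ≠ j → IsConnected (centralSurfaceSet T \ (f i ∪ f j))) ∧
        ¬ IsPreconnected (centralSurfaceSet T \ ⋃ i, f i)) →
      ¬ IsWeaklyReducible T →
      ∃ (X' : Type) (_ : TopologicalSpace X') (_ : T2Space X') (_ : SecondCountableTopology X')
        (_ : ChartedSpace (𝔼 4) X') (_ : IsManifold (𝓡 4) ∞ X')
        (g' : ℕ) (k' : Fin 3 → ℕ) (T' : Fin 3 → Set X')
        (ℓ : Metric.sphere (0 : EuclideanSpace ℝ (Fin 2)) 1 → X'),
        g' ≤ 2 ∧ IsGKTrisection X' g' k' T' ∧ IsCircleSurgery (𝓡 4) (𝓡 4) X' M ℓ) :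
    arandaZupan_dependentTriple_genusThree_homotopySphere := by
  have hL : msz_loopSurgery_homotopySphere_gk :=
    msz_loopSurgery_homotopySphere_gk_of_classification
      (msz_trisection_classification_gk_of_univ hC)
  exact
    arandaZupan_dependentTriple_genusThree_homotopySphere_of_az2025_of_msz_of_separatingPair_of_loopSurgery_of_loopPartnerNoRange_balanced
      (Literature.Barriers.SmoothPoincare4.az2025_weaklyReducible_genusThree_homotopySphere_gk_of_classification_of_sep_zero_of_irreducible_zero
        hC hsep₀ (irreducibleCore_zero_of_loopSurgery_of_fiveChainSurgeryNoRange hL h5) :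
        Literature.Barriers.SmoothPoincare4.az2025_weaklyReducible_genusThree_homotopySphere_gk.{0})
      (Literature.Barriers.SmoothPoincare4.msz_homotopySphere_gk_of_classification_univ hC :
        Literature.Barriers.SmoothPoincare4.msz_homotopySphere_gk.{0})
      h38 hL hP

end NoRange

end Literature.Topology.FourManifolds

end
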